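import Literature.NumberTheory.Automorphic.ShimuraCurveRibetTakahashiPeterssonTwistComparisonProofs
import Literature.NumberTheory.EllipticCurves.ModularCurveCuspsProofs
import Literature.NumberTheory.EllipticCurves.Gamma0CuspFormQSeriesBounds
import HarnessLib

/-!
# Mai–Murty's bound `(f, f) ≪ N (log N)³` at the levels `4M` and `8M` (`M` odd squarefree):
# the Fourier expansions of a newform at all cusps of `Γ₀(2ᵗM)`, `t ≤ 3`

Topic `NumberTheory/Automorphic`; namespace `Literature.NumberTheory.Automorphic`. A proofs-only file
(theorems and auxiliary definitions with bodies: no named fact; D-0026) continuing the work on the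
named fact `murty_petersson_newform_upper_bound` of `ShimuraCurveRibetTakahashi.lean`
(`‖f‖² ≪ N log N`, H. Pasten, *Shimura curves and the abc conjecture*, arXiv:1705.09251, §16 p. 49,
from [MaiMurty1994], [MurtyCongruencePrimes1999]). What the cited proof establishes — Mai–Murty 1994,
§2: `(f, f) ≪ N (log N)³` by Rankin–Selberg and Rademacher's Phragmén–Lindelöf theorem — is in the
tree for SQUAREFREE levels (`exists_petersson_le_mul_log_cube_of_squarefree`,
`…PeterssonConvexityCubeProofs.lean`) and, by comparison across the twist by `−1`, for levels `16 ∣ N`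
twisted from squarefree ones (`…PeterssonTwistComparisonProofs.lean`). The obstruction beyond that was
the Rankin–Selberg dictionary at a non-squarefree level: the trace `Σ_{γ ∈ Γ₀(N)\SL₂(ℤ)} y²|f|²∘γ`
needs the Fourier expansion of `f ∣ γ` at EVERY cusp, and for `p² ∣ N` the cusps `1/p` are not
Atkin–Lehner translates of `∞`. This file supplies that dictionary at the levels `N = 2ᵗM`, `M` odd
squarefree, `t ≤ 3`, where every cusp is still reached from `∞` by an Atkin–Lehner involution
followed by `L(c) = (1 0; c 1) = w_N (1 −c/N; 0 1) w_N⁻¹` with `c/N ∈ ½ℤ` — and a newform of level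
`4 ∣ N` has `a_{2n} = 0`, i.e. `f(τ + ½) = −f(τ)`. Contents:

* §§1–4 `slash_upperGL_apply`, `IsNewform0.exists_slash_lowerSL` (`f ∣ L(c) = ε·(f ∣ T^{−c/N}) ∣ w_N`),
  `IsNewform0.slash_lowerSL_of_half` (`f ∣ L(uN/2) = −f`), `qExpansion_coeff_mul_of_eq_dilate` /
  `norm_sq_qExpansion_coeff_of_eq_dilate` (the period-`N` coefficients of `K·f((D/N)τ + r)` live on
  `D ∣ n`: `|cₙ|² = 𝟙[D ∣ n]|K|²|a_{n/D}|²`), `IsNewform0.exists_slash_atkinLehnerSL_mul`,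
  `tpDinv_mul_mapGL_of_apply` (bringing `β(Q)·Y` to the shape `L(c')·(p q; 0 r)`).
* §5 the representatives `cuspRep t M m j k` (`m ∣ M`, `j ≤ t`, `k ∈ kSet(min(j, t−j))` odd
  `< 2^{min(j,t−j)}`): `β(M/m)·L(2ʲmk)` if `2j ≥ t` and `β(2ᵗM/m)·Y(j, mk)`,
  `Y(j, a) = (2ʲ, q; a, (aq+1)/2ʲ)`, if `2j < t`; `exists_slash_rep`:
  **`(f ∣ cuspRep)(τ) = K·f((D/N)τ + r)`, `|K| = D/N`**, `D = cuspRepDil = 2ᵗm` resp. `2^{2j}m`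
  (Atkin–Lehner 1970, Thm. 3: `f ∣ W_Q = ±f`; valid when `min(j, t−j) ≤ 1`, i.e. always for `t ≤ 3`).
* §§6–7 the cusp invariants of `cuspRep·Tˡ` (`cuspDivisor = 2ʲm`, the unit `∓k`), the widths
  (`rep_T_zpow_rep_inv_mem_iff`: `M/m` resp. `2^{t−2j}M/m`), and the COSET SYSTEM
  `sum_quotient_eq_sum_types`: **`Σ_{SL₂(ℤ)/Γ₀(2ᵗM)} F = Σ_{m∣M} Σ_{j≤t} Σ_{k} Σ_{l<width} F((cuspRep·Tˡ)⁻¹)`**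
  (injectivity by the tree's cusp invariants `cuspInv_eq_iff` [DiamondShurman2005, Prop. 3.8.3] and the
  widths; exhaustiveness by `exists_type_cuspInv_eq`, every class of `(ℤ/gcd(c′, N/c′))ˣ/±1` at
  `c′ = 2ʲm` being `∓k`).
* §8 `IsNewform0.rsCoeff_eq_of_two_pow_mul`: for `t ≤ 3` the trace coefficients are
  `rsCoeff N 2 f n = Σ_{m∣M} Σ_{j≤t} #kSet·width·𝟙[D ∣ n](D/N)²|a_{n/D}|²`.
* §§9–10 the Dirichlet series of such a dilate-sum (`LSeries_rsCoeff_eq_of_sum_dilate`,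
  `traceZeta_eq_of_sum_dilate`, Rankin's unfolding `J₀_eq_of_one_lt_re`) and the elementary factor:
  `sum_tpC_mul_cpow_eq`: **`Σ c·D^{-(s+1)} = N⁻¹·A_t(s)·Σ_{m∣M} m^{-s}`**, `A_t = twoFactor t`,
  `|A_t(s)| ≤ 4` on `Re s ≥ 0` (`norm_twoFactor_le`) — the odd part reproduces the squarefree dictionary.
* §11 `IsNewformOf.norm_sum_divisors_mul_LSeries_le_of_two_pow_mul`: on `Re s = σ > 1`,
  `‖(Σ_{c∣M} c^{-s})·Σ|aₙ|²n^{-(s+1)}‖ ≤ 2ζ(2σ)ζ(σ)³ζ(σ+1)‖ζ(s)‖` (Euler product; at `p = 2` the local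
  factor is `1` since `a₂ = 0`).
* §12 **`exists_petersson_le_mul_log_cube_of_two_pow_mul`**: an absolute `C` with
  `Re (f,f)_{Γ₀(2ᵗM)} ≤ C·N·(1 + log N)³` for `t ∈ {2, 3}`, `M` odd squarefree, every `E/ℚ` and every `f`
  with `IsNewformOf E f` (the proof of the squarefree case verbatim on the new dictionary); combined
  forms `exists_petersson_le_mul_log_cube_of_not_sixteen_dvd` (**all `N` with `16 ∤ N` and squarefree
  odd part**), `exists_petersson_le_mul_log_cube_of_quadraticTwist_neg_one` (`16 ∣ N` twisted from such
  a level), and the power forms `…_rpow_…` (`≤ C·N^{1+ε}/ε³`).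

Among the Frey–Hellegouarch curves (`v₂(N) ∈ {0, 1, 3, 4, 5}`, odd part squarefree) this settles
Mai–Murty's printed bound for `v₂(N) ≤ 3` and for the `v₂(N) = 4` curves whose twist by `−1` has
`v₂ ≤ 3`; `v₂(N) = 5` (where `χ₄`-twisted expansions enter at the cusps `1/8m`) is not treated here.

## References

* [MaiMurty1994] L. Mai, M. R. Murty, *The Phragmén–Lindelöf theorem and modular elliptic curves*,
  Contemp. Math. 166 (1994), §2 (Proposition: `log (f,f) = O(log N)`, via `L(1, Sym² f) = O((log N)³)`).
* [AtkinLehner1970] A. O. L. Atkin, J. Lehner, *Hecke operators on `Γ₀(m)`*, Math. Ann. 185 (1970),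
  Thm. 3 and §2 (cusps of `Γ₀(N)` and their widths).
* [DiamondShurman2005] F. Diamond, J. Shurman, *A first course in modular forms*, GTM 228, §3.8
  (Prop. 3.8.3, cusps of `Γ₀(N)`), §5.5.
* [Rankin1939] R. A. Rankin, *Contributions to the theory of Ramanujan's function `τ(n)` II*,
  Proc. Cambridge Philos. Soc. 35 (1939), §4.
* [PastenShimura2024] H. Pasten, *Shimura curves and the abc conjecture*, J. Number Theory 254 (2024)
  = arXiv:1705.09251, §16 p. 49.
-/

noncomputable section

open scoped MatrixGroups ModularForm
open Matrix.SpecialLinearGroup Complex ModularForm CongruenceSubgroup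
open UpperHalfPlane hiding I
open Literature.NumberTheory.EllipticCurves.ModularForms

namespace Literature.NumberTheory.Automorphic

/-! ### 1. Matrices: `L(c) = (1 0; c 1)`, upper triangular `V = (p q; 0 r)`, and `L(c) w_N = w_N (1 -c/N; 0 1)` -/

section Matrices

/-- The lower unipotent matrix `L(c) = (1 0; c 1) ∈ SL₂(ℤ)` (`L(c) ∞ = 1/c`). [folklore] -/
def lowerSL (c : ℤ) : SL(2, ℤ) :=
  ⟨!![1, 0; c, 1], by simp [Matrix.det_fin_two_of]⟩

/-- The `(0,0)` entry of `L(c)` is `1`. [folklore] -/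
@[simp] theorem lowerSL_apply_00 (c : ℤ) : (lowerSL c) 0 0 = 1 := rfl
/-- The `(0,1)` entry of `L(c)` is `0`. [folklore] -/
@[simp] theorem lowerSL_apply_01 (c : ℤ) : (lowerSL c) 0 1 = 0 := rfl
/-- The `(1,0)` entry of `L(c)` is `c`. [folklore] -/
@[simp] theorem lowerSL_apply_10 (c : ℤ) : (lowerSL c) 1 0 = c := rfl
/-- The `(1,1)` entry of `L(c)` is `1`. [folklore] -/
@[simp] theorem lowerSL_apply_11 (c : ℤ) : (lowerSL c) 1 1 = 1 := rfl

/-- The matrix of `L(c)` in `GL(2, ℝ)`. [folklore] -/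
theorem val_mapGL_lowerSL (c : ℤ) :
    ((mapGL ℝ (lowerSL c) : GL (Fin 2) ℝ) : Matrix (Fin 2) (Fin 2) ℝ) = !![(1 : ℝ), 0; (c : ℝ), 1] := by
  rw [val_mapGL']
  ext i j
  fin_cases i <;> fin_cases j <;> simp [lowerSL]

/-- An upper triangular matrix `(p q; 0 r) ∈ GL(2, ℚ)⁺` with `p, r > 0` (a dilation followed by a
translation of `ℍ`). [folklore] -/
def upperGL (p q r : ℚ) (hp : 0 < p) (hr : 0 < r) : GL(2, ℚ)⁺ :=
  ⟨Matrix.GeneralLinearGroup.mkOfDetNeZero !![p, q; 0, r]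
      (by simp [Matrix.det_fin_two, hp.ne', hr.ne']),
    by simp [Matrix.det_fin_two, hp, hr]⟩

/-- The matrix of `(p q; 0 r)` in `GL(2, ℝ)`. [folklore] -/
@[simp] theorem coe_glCast_upperGL (p q r : ℚ) (hp : 0 < p) (hr : 0 < r) :
    ((glCast (upperGL p q r hp hr : GL (Fin 2) ℚ) : GL (Fin 2) ℝ) : Matrix (Fin 2) (Fin 2) ℝ) =
      !![(p : ℝ), (q : ℝ); 0, (r : ℝ)] := by
  ext i j
  rw [glCast, Matrix.GeneralLinearGroup.map_apply]
  fin_cases i <;> fin_cases j <;> simp [upperGL]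

/-- `det (p q; 0 r) = p r`. [folklore] -/
theorem det_glCast_upperGL (p q r : ℚ) (hp : 0 < p) (hr : 0 < r) :
    (glCast (upperGL p q r hp hr : GL (Fin 2) ℚ)).det.val = p * r := by
  rw [Matrix.GeneralLinearGroup.val_det_apply, coe_glCast_upperGL, Matrix.det_fin_two_of]
  ring

/-- `(p q; 0 r) • τ = (p τ + q)/r`. [folklore] -/
theorem coe_upperGL_smul (p q r : ℚ) (hp : 0 < p) (hr : 0 < r) (τ : ℍ) :
    ((glCast (upperGL p q r hp hr : GL (Fin 2) ℚ) • τ : ℍ) : ℂ) = ((p : ℂ) * τ + q) / r := by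
  rw [coe_smul_of_det_pos (by rw [det_glCast_upperGL]; exact_mod_cast mul_pos hp hr), num, denom,
    coe_glCast_upperGL]
  simp only [Matrix.of_apply, Matrix.cons_val', Matrix.cons_val_zero, Matrix.cons_val_one,
    Matrix.cons_val_fin_one]
  push_cast
  ring

/-- `Im ((pτ + q)/r) > 0` for rational `p, r > 0`. [folklore] -/
theorem im_upperGL_pos {p r : ℚ} (hp : 0 < p) (hr : 0 < r) (q : ℚ) (τ : ℍ) :
    0 < (((p : ℂ) * τ + q) / r).im := by
  have hp' : (0 : ℝ) < p := by exact_mod_cast hp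
  have hr' : (0 : ℝ) < r := by exact_mod_cast hr
  have : (((p : ℂ) * τ + q) / r).im = p * τ.im / r := by
    rw [show (r : ℂ) = ((r : ℝ) : ℂ) from (Complex.ofReal_ratCast r).symm, Complex.div_ofReal_im,
      Complex.add_im, show (q : ℂ) = ((q : ℝ) : ℂ) from (Complex.ofReal_ratCast q).symm,
      Complex.ofReal_im, add_zero, show (p : ℂ) = ((p : ℝ) : ℂ) from (Complex.ofReal_ratCast p).symm,
      Complex.im_ofReal_mul]
    rfl
  rw [this]
  exact div_pos (mul_pos hp' τ.im_pos) hr'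

/-- **The weight-`2` slash of an upper triangular matrix is a dilate-translate**:
`(φ ∣[2] (p q; 0 r))(τ) = (p/r) φ((pτ + q)/r)`. [folklore] -/
theorem slash_upperGL_apply (φ : ℍ → ℂ) (p q r : ℚ) (hp : 0 < p) (hr : 0 < r) (τ : ℍ) :
    (φ ∣[(2 : ℤ)] glCast (upperGL p q r hp hr : GL (Fin 2) ℚ)) τ =
      (p : ℂ) / r * φ (UpperHalfPlane.mk (((p : ℂ) * τ + q) / r) (im_upperGL_pos hp hr q τ)) := by
  have hpt : (glCast (upperGL p q r hp hr : GL (Fin 2) ℚ) • τ : ℍ) =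
      UpperHalfPlane.mk (((p : ℂ) * τ + q) / r) (im_upperGL_pos hp hr q τ) :=
    UpperHalfPlane.ext (by rw [coe_upperGL_smul])
  rw [ModularForm.slash_apply, σ_glCast, det_glCast_upperGL, denom, coe_glCast_upperGL, hpt]
  simp only [Matrix.of_apply, Matrix.cons_val', Matrix.cons_val_zero, Matrix.cons_val_one,
    Matrix.cons_val_fin_one]
  have hr0 : (r : ℂ) ≠ 0 := by exact_mod_cast hr.ne'
  have hp0 : (p : ℂ) ≠ 0 := by exact_mod_cast hp.ne'
  have hp' : (0 : ℝ) < p := by exact_mod_cast hp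
  have hr' : (0 : ℝ) < r := by exact_mod_cast hr
  rw [abs_of_pos (mul_pos hp' hr')]
  push_cast
  simp only [zero_mul, zero_add, zpow_one]
  rw [zpow_neg, zpow_two]
  field_simp

variable (N : ℕ) [NeZero N]

/-- **`L(c) w_N = w_N (1 -c/N; 0 1)`** in `GL(2, ℝ)` (`w_N = (0 -1; N 0)`): the cusp `1/c` is the
image of `∞` under `w_N` composed with a rational translation. [folklore] -/
theorem mapGL_lowerSL_mul_frickeGL (c : ℤ) :
    (mapGL ℝ (lowerSL c) : GL (Fin 2) ℝ) * glCast (frickeGL N : GL (Fin 2) ℚ) =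
      glCast (frickeGL N : GL (Fin 2) ℚ) * glCast (translGL (-(c : ℚ) / N) : GL (Fin 2) ℚ) := by
  refine Units.ext ?_
  have hN : (N : ℝ) ≠ 0 := by exact_mod_cast NeZero.ne N
  rw [Matrix.GeneralLinearGroup.coe_mul, Matrix.GeneralLinearGroup.coe_mul, val_mapGL_lowerSL,
    val_glCast_frickeGL, coe_glCast_translGL]
  ext i j
  fin_cases i <;> fin_cases j <;> simp [Matrix.mul_apply, Fin.sum_univ_two]
  field_simp

/-- **`(φ ∣[2] w_N) ∣[2] w_N = φ`** (`w_N² = -N` is scalar and the weight is `2`). [folklore] -/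
theorem slash_frickeGL_slash_frickeGL (φ : ℍ → ℂ) :
    (φ ∣[(2 : ℤ)] glCast (frickeGL N : GL (Fin 2) ℚ)) ∣[(2 : ℤ)] glCast (frickeGL N : GL (Fin 2) ℚ) = φ := by
  have hN0 : (N : ℂ) ≠ 0 := by exact_mod_cast NeZero.ne N
  ext τ
  have hτ : (τ : ℂ) ≠ 0 := τ.ne_zero
  rw [ModularForm.slash_apply, σ_glCast, ModularForm.slash_apply, σ_glCast,
    frickeGL_smul_frickeGL_smul, det_glCast_frickeGL, denom, denom, val_glCast_frickeGL,
    coe_frickeGL_smul]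
  simp only [Matrix.of_apply, Matrix.cons_val', Matrix.cons_val_zero, Matrix.cons_val_one,
    Matrix.cons_val_fin_one, Nat.abs_cast]
  push_cast
  simp only [add_zero, zpow_one]
  rw [zpow_neg, zpow_neg, zpow_two, zpow_two]
  field_simp

/-- `(φ ∣[k] (1 x; 0 1))(τ) = φ(x + τ)`. [folklore] -/
theorem slash_translGL_apply (φ : ℍ → ℂ) (k : ℤ) (x : ℚ) (τ : ℍ) :
    (φ ∣[k] glCast (translGL x : GL (Fin 2) ℚ)) τ = φ (((x : ℝ)) +ᵥ τ) := by
  have hdet : (glCast (translGL x : GL (Fin 2) ℚ)).det.val = 1 := by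
    rw [Matrix.GeneralLinearGroup.val_det_apply, coe_glCast_translGL, Matrix.det_fin_two_of]; ring
  have hpt : (glCast (translGL x : GL (Fin 2) ℚ) • τ : ℍ) = ((x : ℝ)) +ᵥ τ := by
    refine UpperHalfPlane.ext ?_
    rw [coe_smul_of_det_pos (by rw [hdet]; exact one_pos), num, denom, coe_glCast_translGL,
      UpperHalfPlane.coe_vadd]
    simp only [Matrix.of_apply, Matrix.cons_val', Matrix.cons_val_zero, Matrix.cons_val_one,
      Matrix.cons_val_fin_one]
    push_cast
    ring
  rw [ModularForm.slash_apply, σ_glCast, hdet, denom, coe_glCast_translGL, hpt]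
  simp

end Matrices

end Literature.NumberTheory.Automorphic

namespace Literature.NumberTheory.Automorphic

/-! ### 2. Slash identities for a newform of weight `2`: `w_N`, `β(Q)`, `L(c)`, translations -/

section NewformSlash

variable {N : ℕ} [NeZero N] {k : ℤ}

omit [NeZero N] in
/-- `T^m ∈ Γ₀(N)`. [folklore] -/
theorem T_zpow_mem_Gamma0 (m : ℤ) : ModularGroup.T ^ m ∈ Gamma0 N := by
  rw [Gamma0_mem, ModularGroup.coe_T_zpow]
  simp

omit [NeZero N] in
/-- `f(τ + m) = f(τ)` for `f ∈ S_k(Γ₀(N))` and `m ∈ ℤ`. [folklore] -/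
theorem apply_intCast_vadd (f : CuspForm (Gamma0 N) k) (m : ℤ) (τ : ℍ) :
    f (((m : ℝ)) +ᵥ τ) = f τ := by
  have h := slash_mul_T_zpow_apply (⇑f) k 1 m τ
  rw [one_mul, SlashAction.slash_one, slash_eq_self_of_mem_Gamma0 f (T_zpow_mem_Gamma0 m)] at h
  exact h.symm

omit [NeZero N] in
/-- `f ∣[k] (1 m; 0 1) = f` for `m ∈ ℤ`. [folklore] -/
theorem slash_translGL_intCast (f : CuspForm (Gamma0 N) k) (m : ℤ) :
    (⇑f : ℍ → ℂ) ∣[k] glCast (translGL (m : ℚ) : GL (Fin 2) ℚ) = ⇑f := by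
  ext τ
  rw [slash_translGL_apply, Rat.cast_intCast]
  exact apply_intCast_vadd f m τ

/-- **`f(τ + 1/2) = -f(τ)` for a newform of level divisible by `4`** (its even-indexed coefficients
vanish, `IsNewform0.cuspCoeff_eq_zero_of_two_dvd`, so `f(τ + 1/2) = Σ_{n odd} aₙ e^{πin} qⁿ = -f(τ)`).
[cite: AtkinLehner1970, Thm. 3] -/
theorem _root_.Literature.NumberTheory.EllipticCurves.ModularForms.IsNewform0.apply_half_vadd
    {f : CuspForm (Gamma0 N) k} (hf : IsNewform0 f) (h4 : 4 ∣ N) (τ : ℍ) :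
    f (((1 / 2 : ℚ) : ℝ) +ᵥ τ) = -f τ := by
  have h1 := hasSum_cuspCoeff_exp f (((1 / 2 : ℚ) : ℝ) +ᵥ τ)
  have h2 := (hasSum_cuspCoeff_exp f τ).neg
  refine HasSum.unique ?_ h2
  refine h1.congr_fun fun m ↦ ?_
  rcases Nat.even_or_odd m with hm | hm
  · rw [IsNewform0.cuspCoeff_eq_zero_of_two_dvd hf h4 (even_iff_two_dvd.mp hm)]
    simp
  · rw [UpperHalfPlane.coe_vadd]
    obtain ⟨w, rfl⟩ := hm
    have he : Complex.exp (2 * Real.pi * Complex.I * ((2 * w + 1 : ℕ) : ℂ) * ((((1 / 2 : ℚ) : ℝ) : ℂ) + (τ : ℂ))) =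
        -Complex.exp (2 * Real.pi * Complex.I * ((2 * w + 1 : ℕ) : ℂ) * (τ : ℂ)) := by
      have hsplit : 2 * Real.pi * Complex.I * ((2 * w + 1 : ℕ) : ℂ) * ((((1 / 2 : ℚ) : ℝ) : ℂ) + (τ : ℂ)) =
          (w : ℕ) * (2 * Real.pi * Complex.I) + Real.pi * Complex.I + 2 * Real.pi * Complex.I * ((2 * w + 1 : ℕ) : ℂ) * (τ : ℂ) := by
        push_cast; ring
      rw [hsplit, Complex.exp_add, Complex.exp_add, Complex.exp_nat_mul, Complex.exp_two_pi_mul_I,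
        one_pow, one_mul, Complex.exp_pi_mul_I]
      ring
    rw [he]
    ring

/-- `f ∣[k] (1 u/2; 0 1) = -f` for a newform of level divisible by `4` and odd `u`. [folklore] -/
theorem _root_.Literature.NumberTheory.EllipticCurves.ModularForms.IsNewform0.slash_translGL_half
    {f : CuspForm (Gamma0 N) k} (hf : IsNewform0 f) (h4 : 4 ∣ N) {u : ℤ} (hu : Odd u) :
    (⇑f : ℍ → ℂ) ∣[k] glCast (translGL ((u : ℚ) / 2) : GL (Fin 2) ℚ) = -⇑f := by
  obtain ⟨w, rfl⟩ := hu
  ext τ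
  rw [slash_translGL_apply, Pi.neg_apply]
  have hx : ((((2 * w + 1 : ℤ) : ℚ) / 2 : ℚ) : ℝ) = (w : ℝ) + (((1 / 2 : ℚ)) : ℝ) := by
    push_cast; ring
  rw [hx, add_vadd, apply_intCast_vadd f w]
  exact hf.apply_half_vadd h4 τ

/-- **`f ∣[2] w_N = ε f` as functions**, `ε = ±1` the Fricke eigenvalue of the newform `f`
(Atkin–Lehner 1970, Thm. 3; the tree's `IsNewform0.exists_frickeInvolution_eq_smul_holds`).
[cite: AtkinLehner1970, Thm. 3] -/
theorem _root_.Literature.NumberTheory.EllipticCurves.ModularForms.IsNewform0.exists_slash_frickeGL_eq_smul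
    {f : CuspForm (Gamma0 N) 2} (hf : IsNewform0 f) :
    ∃ ε : ℂ, (ε = 1 ∨ ε = -1) ∧
      (⇑f : ℍ → ℂ) ∣[(2 : ℤ)] glCast (frickeGL N : GL (Fin 2) ℚ) = ε • (⇑f : ℍ → ℂ) := by
  obtain ⟨ε, hε, hW⟩ := IsNewform0.exists_frickeInvolution_eq_smul_holds hf
  refine ⟨ε, hε, ?_⟩
  have h := frickeInvolution_apply_eq_slash_holds N 2 f
  rw [hW] at h
  have hN : ((N : ℝ) ^ (1 - ((2 : ℤ) : ℝ) / 2) : ℝ) = 1 := by norm_num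
  rw [hN, Complex.ofReal_one, one_smul] at h
  rw [← h]
  ext τ
  simp

/-- **`f ∣[2] L(c) = ε (f ∣[2] (1 -c/N; 0 1)) ∣[2] w_N`** for a newform `f` with Fricke eigenvalue
`ε` (`f ∣[2] w_N = ε f`): the expansion of `f` at the cusp `1/c` is the expansion at `∞` of a
translate of `f`, moved by `w_N` (`L(c) w_N = w_N (1 -c/N; 0 1)` and `w_N² = -N`).
[cite: AtkinLehner1970, Thm. 3] -/
theorem _root_.Literature.NumberTheory.EllipticCurves.ModularForms.IsNewform0.exists_slash_lowerSL
    {f : CuspForm (Gamma0 N) 2} (hf : IsNewform0 f) :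
    ∃ ε : ℂ, (ε = 1 ∨ ε = -1) ∧
      (⇑f : ℍ → ℂ) ∣[(2 : ℤ)] glCast (frickeGL N : GL (Fin 2) ℚ) = ε • (⇑f : ℍ → ℂ) ∧
      ∀ c : ℤ, (⇑f : ℍ → ℂ) ∣[(2 : ℤ)] (mapGL ℝ (lowerSL c) : GL (Fin 2) ℝ) =
        ε • (((⇑f : ℍ → ℂ) ∣[(2 : ℤ)] glCast (translGL (-(c : ℚ) / N) : GL (Fin 2) ℚ)) ∣[(2 : ℤ)]
          glCast (frickeGL N : GL (Fin 2) ℚ)) := by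
  obtain ⟨ε, hε, hW⟩ := hf.exists_slash_frickeGL_eq_smul
  refine ⟨ε, hε, hW, fun c ↦ ?_⟩
  have h1 : ((⇑f : ℍ → ℂ) ∣[(2 : ℤ)] (mapGL ℝ (lowerSL c) : GL (Fin 2) ℝ)) ∣[(2 : ℤ)]
      glCast (frickeGL N : GL (Fin 2) ℚ) =
        ε • ((⇑f : ℍ → ℂ) ∣[(2 : ℤ)] glCast (translGL (-(c : ℚ) / N) : GL (Fin 2) ℚ)) := by
    rw [← SlashAction.slash_mul, mapGL_lowerSL_mul_frickeGL, SlashAction.slash_mul, hW,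
      ModularForm.smul_slash, σ_glCast]
  rw [← slash_frickeGL_slash_frickeGL N ((⇑f : ℍ → ℂ) ∣[(2 : ℤ)] (mapGL ℝ (lowerSL c) : GL (Fin 2) ℝ)),
    h1, ModularForm.smul_slash, σ_glCast]

omit [NeZero N] in
/-- `f ∣[2] L(c) = f` when `N ∣ c` (`L(c) ∈ Γ₀(N)`). [folklore] -/
theorem slash_lowerSL_of_dvd (f : CuspForm (Gamma0 N) k) {c : ℤ} (h : (N : ℤ) ∣ c) :
    (⇑f : ℍ → ℂ) ∣[k] (mapGL ℝ (lowerSL c) : GL (Fin 2) ℝ) = ⇑f := by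
  have hmem : lowerSL c ∈ Gamma0 N := by
    rw [Gamma0_mem]
    simpa [lowerSL] using (ZMod.intCast_zmod_eq_zero_iff_dvd c N).mpr h
  have := slash_eq_self_of_mem_Gamma0 f hmem
  rwa [ModularForm.SL_slash] at this

/-- **`f ∣[2] L(c) = -f` when `2c/N` is an odd integer** (newform `f`, `4 ∣ N`): the translate by
`-c/N ≡ 1/2` is `-f`, and `ε² = 1`. [cite: AtkinLehner1970, Thm. 3] -/
theorem _root_.Literature.NumberTheory.EllipticCurves.ModularForms.IsNewform0.slash_lowerSL_of_half
    {f : CuspForm (Gamma0 N) 2} (hf : IsNewform0 f) (h4 : 4 ∣ N) {c u : ℤ} (hu : Odd u)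
    (h : 2 * c = u * N) :
    (⇑f : ℍ → ℂ) ∣[(2 : ℤ)] (mapGL ℝ (lowerSL c) : GL (Fin 2) ℝ) = -⇑f := by
  obtain ⟨ε, hε, hW, hL⟩ := hf.exists_slash_lowerSL
  have hN0 : (N : ℚ) ≠ 0 := by exact_mod_cast NeZero.ne N
  have hq : (-(c : ℚ) / N : ℚ) = ((-u : ℤ) : ℚ) / 2 := by
    have h' : (2 : ℚ) * c = u * N := by exact_mod_cast h
    field_simp
    push_cast
    linarith
  have hεε : ε * ε = 1 := by rcases hε with rfl | rfl <;> norm_num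
  rw [hL c, hq, hf.slash_translGL_half h4 hu.neg, SlashAction.neg_slash, hW, smul_neg, smul_smul, hεε,
    one_smul]

end NewformSlash

end Literature.NumberTheory.Automorphic

namespace Literature.NumberTheory.Automorphic

/-! ### 3. Period-`N` coefficients of a dilate-translate `K · g(Dτ/N + r)` -/

section Coefficients

open MeasureTheory

variable {N : ℕ} [NeZero N] {L : ℕ} [NeZero L] {k' : ℤ}

/-- `Im (Dτ/N + r) > 0`. [folklore] -/
theorem im_dilate_pos {D : ℕ} (hD : 0 < D) (r : ℝ) (τ : ℍ) : 0 < ((D : ℂ) / N * τ + r).im := by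
  have hN0 : (0 : ℝ) < N := Nat.cast_pos.mpr (NeZero.pos N)
  have hDr : (0 : ℝ) < D := Nat.cast_pos.mpr hD
  have : ((D : ℂ) / N * τ + r).im = D / N * τ.im := by
    rw [Complex.add_im, Complex.ofReal_im, add_zero, Complex.mul_im, Complex.div_natCast_im,
      Complex.natCast_im, zero_div, zero_mul, add_zero, Complex.div_natCast_re, Complex.natCast_re]
    rfl
  rw [this]
  exact mul_pos (div_pos hDr hN0) τ.im_pos

/-- **The horizontal substitution behind the coefficients of a dilate-translate**: for
`g ∈ S_{k'}(Γ₀(L))` (`1`-periodic), `D ≥ 1`, real `r`,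
`(1/N)∫₀ᴺ e^{-2πi(Dm)x/N} g(Dx/N + r + i) dx = e^{2πimr} · ∫₀¹ e^{-2πimu} g(u + i) du`
(substitute `u = Dx/N + r` and use the `1`-periodicity of `g` over the `D` periods `[r, r + D]`).
[folklore] -/
theorem fourierCoeffOn_comp_dilate_add (g : CuspForm (Gamma0 L) k') {D : ℕ} (hD : 0 < D) (r : ℝ)
    (m : ℕ) :
    fourierCoeffOn (Nat.cast_pos.mpr (NeZero.pos N) : (0 : ℝ) < N)
        (fun x : ℝ ↦ (⇑g) (ofComplex (((((D : ℝ) / N * x + r : ℝ)) : ℂ) + (1 : ℝ) * Complex.I)))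
          ((D * m : ℕ) : ℤ) =
      Complex.exp (2 * Real.pi * Complex.I * m * r) *
        fourierCoeffOn (isCuspFunction_one g).pos
          (fun x : ℝ ↦ (⇑g) (ofComplex ((x : ℂ) + (1 : ℝ) * Complex.I))) (m : ℤ) := by
  have h1g : IsCuspFunction 1 ⇑g := isCuspFunction_one g
  have hN0 : (0 : ℝ) < N := Nat.cast_pos.mpr (NeZero.pos N)
  have hDr : (0 : ℝ) < D := Nat.cast_pos.mpr hD
  have hc : (D : ℝ) / N ≠ 0 := (div_pos hDr hN0).ne'
  rw [fourierCoeffOn_eq_integral, fourierCoeffOn_eq_integral]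
  set h : ℝ → ℂ := fun u : ℝ ↦ fourier (-(m : ℤ)) (u : AddCircle ((1 : ℝ) - 0)) •
    (⇑g) (ofComplex (((u : ℝ) : ℂ) + (1 : ℝ) * Complex.I)) with hh
  have hi : ∀ x : ℝ, fourier (-((D * m : ℕ) : ℤ)) (x : AddCircle ((N : ℝ) - 0)) •
      (⇑g) (ofComplex (((((D : ℝ) / N * x + r : ℝ)) : ℂ) + (1 : ℝ) * Complex.I)) =
        Complex.exp (2 * Real.pi * Complex.I * m * r) * h ((D : ℝ) / N * x + r) := by
    intro x
    simp only [hh, fourier_coe_apply, sub_zero, smul_eq_mul, ← mul_assoc]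
    congr 1
    rw [← Complex.exp_add]
    congr 1
    have hNc : (N : ℂ) ≠ 0 := by exact_mod_cast (NeZero.ne N)
    push_cast
    field_simp
    ring
  simp_rw [hi]
  rw [intervalIntegral.integral_const_mul, intervalIntegral.integral_comp_mul_add (fun u ↦ h u) hc r,
    mul_zero, zero_add, div_mul_cancel₀ (D : ℝ) hN0.ne']
  -- `∫_r^{D + r} h = ∫_0^D h = D ∫_0^1 h` by `1`-periodicity
  have hhp : Function.Periodic h 1 := by
    intro u
    simp only [hh]
    congr 1
    · rw [sub_zero]
      congr 1
      rw [AddCircle.coe_add, AddCircle.coe_period, add_zero]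
    · have := h1g.periodic ((u : ℂ) + (1 : ℝ) * Complex.I)
      simp only [Function.comp_apply] at this
      push_cast at this ⊢
      rw [show (u : ℂ) + 1 + 1 * I = (u : ℂ) + 1 * I + 1 by ring]
      exact this
  have hhc : Continuous h :=
    (((fourier (-(m : ℤ))).continuous.comp (AddCircle.continuous_mk' _))).smul
      (h1g.continuous_horizontal one_pos)
  have hhD : Function.Periodic h (D : ℝ) := by
    have := hhp.nat_mul D
    rwa [mul_one] at this
  have hint : ∫ x in r..(D : ℝ) + r, h x = ∫ x in (0 : ℝ)..D, h x := by
    rw [show (D : ℝ) + r = r + D by ring, hhD.intervalIntegral_add_eq r 0, zero_add]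
  rw [hint, intervalIntegral_zero_nat_of_periodic hhp hhc D]
  simp only [sub_zero, Complex.real_smul, Complex.ofReal_one, div_one, one_mul]
  have hNc : (N : ℂ) ≠ 0 := by exact_mod_cast (NeZero.ne N)
  have hDc : (D : ℂ) ≠ 0 := by exact_mod_cast hD.ne'
  push_cast
  field_simp

/-- **The period-`N` coefficients of a dilate-translate.** Let `F` be a cuspidal `q`-series of period
`N` with `F(τ) = K · g(Dτ/N + r)` for a cusp form `g ∈ S_{k'}(Γ₀(L))` (`1`-periodic, coefficients
`aₘ(g)`), `D ≥ 1`, `r ∈ ℝ`. Then `c_{Dm}(F) = K e^{2πimr} aₘ(g)` for all `m` (the coefficients of `F`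
at the multiples of `D`; the others vanish when `D ∣ N`, `qExpansion_coeff_eq_zero_of_vadd_periodic`).
This is the bookkeeping of Fourier expansions at the cusps of `Γ₀(N)` for every cusp whose
expansion is a dilate of a `1`-periodic form. [folklore] -/
theorem qExpansion_coeff_mul_of_eq_dilate (g : CuspForm (Gamma0 L) k') {F : ℍ → ℂ}
    (hF : IsCuspFunction N F) (K : ℂ) {D : ℕ} (hD : 0 < D) (r : ℝ)
    (hFg : ∀ τ : ℍ, F τ = K * g (UpperHalfPlane.mk ((D : ℂ) / N * τ + r) (im_dilate_pos hD r τ)))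
    (m : ℕ) :
    (qExpansion (N : ℝ) F).coeff (D * m) = K * Complex.exp (2 * Real.pi * Complex.I * m * r) * cuspCoeff g m := by
  have h1g : IsCuspFunction 1 ⇑g := isCuspFunction_one g
  have hN0 : (0 : ℝ) < N := Nat.cast_pos.mpr (NeZero.pos N)
  have hDr : (0 : ℝ) < D := Nat.cast_pos.mpr hD
  have hy : (0 : ℝ) < N / D := div_pos hN0 hDr
  have eN := hF.fourierCoeffOn_horizontal hy ((D * m : ℕ) : ℤ)
  have e1 := h1g.fourierCoeffOn_horizontal one_pos (m : ℤ)
  rw [if_pos (Int.natCast_nonneg _), Int.toNat_natCast] at eN e1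
  have hpt : ∀ x : ℝ, F (ofComplex ((x : ℂ) + ((N / D : ℝ)) * Complex.I)) =
      K * g (ofComplex (((((D : ℝ) / N * x + r : ℝ)) : ℂ) + (1 : ℝ) * Complex.I)) := by
    intro x
    have hz : 0 < ((x : ℂ) + ((N / D : ℝ)) * Complex.I).im := by simpa using hy
    have hz' : 0 < (((((D : ℝ) / N * x + r : ℝ)) : ℂ) + (1 : ℝ) * Complex.I).im := by simp
    rw [ofComplex_apply_of_im_pos hz, hFg, ofComplex_apply_of_im_pos hz']
    congr 2
    refine UpperHalfPlane.ext ?_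
    show (D : ℂ) / N * ((x : ℂ) + ((N / D : ℝ)) * Complex.I) + r = ((((D : ℝ) / N * x + r : ℝ)) : ℂ) + (1 : ℝ) * I
    have hNc : (N : ℂ) ≠ 0 := by exact_mod_cast (NeZero.ne N)
    have hDc : (D : ℂ) ≠ 0 := by exact_mod_cast hD.ne'
    push_cast
    field_simp
    ring
  have hFc : fourierCoeffOn hF.pos (fun x : ℝ ↦ F (ofComplex ((x : ℂ) + ((N / D : ℝ)) * Complex.I)))
      ((D * m : ℕ) : ℤ) = K * (Complex.exp (2 * Real.pi * Complex.I * m * r) *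
        fourierCoeffOn h1g.pos (fun x : ℝ ↦ (⇑g) (ofComplex ((x : ℂ) + (1 : ℝ) * Complex.I))) (m : ℤ)) := by
    simp_rw [hpt]
    rw [fourierCoeffOn.const_mul, fourierCoeffOn_comp_dilate_add g hD r m]
  rw [hFc, e1] at eN
  have hexp : (Real.exp (-(2 * Real.pi * m / 1) * 1) : ℂ) ≠ 0 := by
    exact_mod_cast (Real.exp_pos _).ne'
  have hexp' : (Real.exp (-(2 * Real.pi * ((D * m : ℕ) : ℕ) / N) * (N / D : ℝ)) : ℂ) =
      (Real.exp (-(2 * Real.pi * m / 1) * 1) : ℂ) := by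
    congr 2
    push_cast
    field_simp
  rw [hexp'] at eN
  have key : (qExpansion (N : ℝ) F).coeff (D * m) * (Real.exp (-(2 * Real.pi * m / 1) * 1) : ℂ) =
      (K * Complex.exp (2 * Real.pi * Complex.I * m * r) * (qExpansion 1 ⇑g).coeff m) *
        (Real.exp (-(2 * Real.pi * m / 1) * 1) : ℂ) := by
    rw [← eN]; ring
  rw [mul_right_cancel₀ hexp key, cuspCoeff]

/-- **Norms of the period-`N` coefficients of a dilate-translate**: under the hypotheses of
`qExpansion_coeff_mul_of_eq_dilate` and `D ∣ N`,
`‖cₙ(F)‖² = 𝟙[D ∣ n] ‖K‖² ‖a_{n/D}(g)‖²`. [folklore] -/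
theorem norm_sq_qExpansion_coeff_of_eq_dilate (g : CuspForm (Gamma0 L) k') {F : ℍ → ℂ}
    (hF : IsCuspFunction N F) (K : ℂ) {D : ℕ} (hD : 0 < D) (hDN : D ∣ N) (r : ℝ)
    (hFg : ∀ τ : ℍ, F τ = K * g (UpperHalfPlane.mk ((D : ℂ) / N * τ + r) (im_dilate_pos hD r τ)))
    (n : ℕ) :
    ‖(qExpansion (N : ℝ) F).coeff n‖ ^ 2 =
      if D ∣ n then ‖K‖ ^ 2 * ‖cuspCoeff g (n / D)‖ ^ 2 else 0 := by
  by_cases hDn : D ∣ n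
  · rw [if_pos hDn]
    obtain ⟨m, rfl⟩ := hDn
    rw [qExpansion_coeff_mul_of_eq_dilate g hF K hD r hFg m, Nat.mul_div_cancel_left _ hD, norm_mul,
      norm_mul, Complex.norm_exp]
    have : (2 * Real.pi * Complex.I * m * r : ℂ).re = 0 := by
      simp [Complex.mul_re, Complex.mul_im]
    rw [this, Real.exp_zero, mul_one, mul_pow]
  · rw [if_neg hDn]
    obtain ⟨Q, hQ⟩ := hDN
    have hper : ∀ τ : ℍ, F ((Q : ℝ) +ᵥ τ) = F τ := by
      intro τ
      rw [hFg, hFg]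
      congr 1
      have h1 : UpperHalfPlane.mk ((D : ℂ) / N * (((Q : ℝ) +ᵥ τ : ℍ) : ℂ) + r) (im_dilate_pos hD r _) =
          (1 : ℝ) +ᵥ UpperHalfPlane.mk ((D : ℂ) / N * τ + r) (im_dilate_pos hD r τ) := by
        refine UpperHalfPlane.ext ?_
        show (D : ℂ) / N * (((Q : ℝ) +ᵥ τ : ℍ) : ℂ) + r =
          (((1 : ℝ) +ᵥ UpperHalfPlane.mk ((D : ℂ) / N * τ + r) (im_dilate_pos hD r τ) : ℍ) : ℂ)
        rw [UpperHalfPlane.coe_vadd, UpperHalfPlane.coe_vadd]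
        show (D : ℂ) / N * (((Q : ℝ) : ℂ) + (τ : ℂ)) + r = ((1 : ℝ) : ℂ) + ((D : ℂ) / N * τ + r)
        have hNc : (N : ℂ) = D * Q := by exact_mod_cast hQ
        have hDc : (D : ℂ) ≠ 0 := by exact_mod_cast hD.ne'
        have hQc : (Q : ℂ) ≠ 0 := by
          intro h0
          have : (N : ℂ) = 0 := by rw [hNc, h0, mul_zero]
          exact (NeZero.ne N) (by exact_mod_cast this)
        rw [hNc]
        push_cast
        field_simp
        ring
      rw [h1]
      exact_mod_cast apply_intCast_vadd g 1 _
    rw [qExpansion_coeff_eq_zero_of_vadd_periodic hF (c := D) (Q := Q) hQ.symm hper hDn, norm_zero,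
      zero_pow two_ne_zero]

end Coefficients

end Literature.NumberTheory.Automorphic

namespace Literature.NumberTheory.Automorphic

/-! ### 4. The Atkin–Lehner side: `f ∣ β(Q') Y = ε (f ∣ diag(1/Q', 1) Y)` and the two matrix shapes -/

section AtkinLehnerSide

variable {N : ℕ} [NeZero N]

/-- `diag(1/Q, 1) ∈ GL(2, ℝ)` (the cast of a rational matrix of positive determinant). [folklore] -/
def tpDinv (Q : ℕ) [NeZero Q] : GL (Fin 2) ℝ :=
  glCast (diagGL (Q : ℚ)⁻¹ 1 (by have := NeZero.pos Q; positivity) one_pos : GL (Fin 2) ℚ)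

/-- The matrix of `diag(1/Q, 1)`. [folklore] -/
theorem val_tpDinv (Q : ℕ) [NeZero Q] :
    ((tpDinv Q : GL (Fin 2) ℝ) : Matrix (Fin 2) (Fin 2) ℝ) = !![(Q : ℝ)⁻¹, 0; 0, 1] := by
  ext i j
  rw [tpDinv, glCast, Matrix.GeneralLinearGroup.map_apply, coe_coe_diagGL]
  fin_cases i <;> fin_cases j <;> simp

/-- `diag(Q, 1) diag(1/Q, 1) = 1`. [folklore] -/
theorem tpD_mul_tpDinv (Q : ℕ) [NeZero Q] : tpD Q * tpDinv Q = 1 := by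
  refine Units.ext ?_
  have hQ : (Q : ℝ) ≠ 0 := by exact_mod_cast NeZero.ne Q
  rw [Matrix.GeneralLinearGroup.coe_mul, val_tpD, val_tpDinv]
  ext i j
  fin_cases i <;> fin_cases j <;> simp [Matrix.mul_apply, Fin.sum_univ_two, hQ]

/-- **`f ∣[2] (β(Q) Y) = ε_Q · f ∣[2] (diag(1/Q, 1) Y)`** for a newform `f ∈ S₂(Γ₀(N))`, an exact
divisor `Q ∥ N` with Atkin–Lehner eigenvalue `ε_Q = ±1`, and any `Y ∈ SL₂(ℤ)`
(`w(Q) = β(Q) diag(Q, 1)` and `f ∣ w(Q) = ε_Q f`, Knapp 1993, Thm. 9.27). [cite: Knapp1993, Thm. 9.27] -/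
theorem _root_.Literature.NumberTheory.EllipticCurves.ModularForms.IsNewform0.exists_slash_atkinLehnerSL_mul
    {f : CuspForm (Gamma0 N) 2} (hf : IsNewform0 f) {Q : ℕ} [NeZero Q] (hQN : Q ∣ N)
    (hc : Nat.Coprime Q (N / Q)) :
    ∃ ε : ℂ, (ε = 1 ∨ ε = -1) ∧ ∀ Y : SL(2, ℤ),
      (⇑f : ℍ → ℂ) ∣[(2 : ℤ)] (mapGL ℝ (atkinLehnerSL N Q * Y) : GL (Fin 2) ℝ) =
        ε • ((⇑f : ℍ → ℂ) ∣[(2 : ℤ)] (tpDinv Q * (mapGL ℝ Y : GL (Fin 2) ℝ))) := by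
  obtain ⟨ε, hε, hW⟩ := hf.exists_atkinLehnerInvolution_eq_smul hQN hc
  refine ⟨ε, hε, fun Y ↦ ?_⟩
  have h := atkinLehnerInvolution_apply_eq_slash N 2 Q hQN hc f
  rw [hW] at h
  have hQ1 : ((Q : ℝ) ^ (1 - ((2 : ℤ) : ℝ) / 2) : ℝ) = 1 := by norm_num
  rw [hQ1, Complex.ofReal_one, one_smul] at h
  have hslashW : (⇑f : ℍ → ℂ) ∣[(2 : ℤ)] glCast (atkinLehnerW N Q : GL (Fin 2) ℚ) = ε • (⇑f : ℍ → ℂ) := by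
    rw [← h]; ext τ; simp
  have hmat : (mapGL ℝ (atkinLehnerSL N Q * Y) : GL (Fin 2) ℝ) =
      glCast (atkinLehnerW N Q : GL (Fin 2) ℚ) * (tpDinv Q * (mapGL ℝ Y : GL (Fin 2) ℝ)) := by
    rw [map_mul, glCast_atkinLehnerW, ← mul_assoc, mul_assoc (mapGL ℝ (atkinLehnerSL N Q)),
      tpD_mul_tpDinv, mul_one]
  have hσ : ∀ g : GL (Fin 2) ℝ, σ g ε = ε := by
    intro g
    rcases hε with rfl | rfl <;> simp
  rw [hmat, SlashAction.slash_mul, hslashW, ModularForm.smul_slash, hσ]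

/-- **Family 1**: `diag(1/Q, 1) L(c) = L(Qc) (1/Q 0; 0 1)`. [folklore] -/
theorem tpDinv_mul_mapGL_lowerSL (Q : ℕ) [NeZero Q] (c : ℤ) :
    tpDinv Q * (mapGL ℝ (lowerSL c) : GL (Fin 2) ℝ) =
      (mapGL ℝ (lowerSL (Q * c)) : GL (Fin 2) ℝ) *
        glCast (upperGL (Q : ℚ)⁻¹ 0 1 (by have := NeZero.pos Q; positivity) one_pos : GL (Fin 2) ℚ) := by
  refine Units.ext ?_
  have hQ : (Q : ℝ) ≠ 0 := by exact_mod_cast NeZero.ne Q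
  rw [Matrix.GeneralLinearGroup.coe_mul, Matrix.GeneralLinearGroup.coe_mul, val_tpDinv,
    val_mapGL_lowerSL, val_mapGL_lowerSL, coe_glCast_upperGL]
  ext i j
  fin_cases i <;> fin_cases j <;> simp [Matrix.mul_apply, Fin.sum_univ_two]
  field_simp

/-- **Family 2**: for `Y = (P b; a d) ∈ SL₂(ℤ)` and `Q' = P R`,
`diag(1/Q', 1) Y = L(R a) (1/R, b/Q'; 0, 1/P)` (the lower-right entry is `(ab + 1)/P = d`).
[folklore] -/
theorem tpDinv_mul_mapGL_of_apply (P R Q' : ℕ) [NeZero P] [NeZero R] [NeZero Q'] (hQ' : Q' = P * R)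
    (Y : SL(2, ℤ)) (hY : Y 0 0 = P) :
    tpDinv Q' * (mapGL ℝ Y : GL (Fin 2) ℝ) =
      (mapGL ℝ (lowerSL (R * Y 1 0)) : GL (Fin 2) ℝ) *
        glCast (upperGL (R : ℚ)⁻¹ ((Y 0 1 : ℚ) / Q') (P : ℚ)⁻¹
          (by have := NeZero.pos R; positivity) (by have := NeZero.pos P; positivity) : GL (Fin 2) ℚ) := by
  refine Units.ext ?_
  have hP : (P : ℝ) ≠ 0 := by exact_mod_cast NeZero.ne P
  have hR : (R : ℝ) ≠ 0 := by exact_mod_cast NeZero.ne R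
  have hdet : (P : ℝ) * (Y 1 1 : ℝ) - (Y 0 1 : ℝ) * (Y 1 0 : ℝ) = 1 := by
    have h := det_entries Y
    rw [hY] at h
    exact_mod_cast h
  have hYv : ((mapGL ℝ Y : GL (Fin 2) ℝ) : Matrix (Fin 2) (Fin 2) ℝ) =
      !![(P : ℝ), (Y 0 1 : ℝ); (Y 1 0 : ℝ), (Y 1 1 : ℝ)] := by
    rw [val_mapGL']
    ext i j
    fin_cases i <;> fin_cases j <;> simp [hY]
  rw [Matrix.GeneralLinearGroup.coe_mul, Matrix.GeneralLinearGroup.coe_mul, val_tpDinv, hYv,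
    val_mapGL_lowerSL, coe_glCast_upperGL, hQ']
  push_cast
  ext i j
  fin_cases i <;> fin_cases j <;> simp [Matrix.mul_apply, Fin.sum_univ_two, hP]
  · field_simp
  · field_simp
  · field_simp
    linear_combination hdet

end AtkinLehnerSide

end Literature.NumberTheory.Automorphic

namespace Literature.NumberTheory.Automorphic

/-! ### 5. The cusp representatives of `Γ₀(2ᵗM)` and their slashes -/

section Types

/-- The odd integers in `[1, 2ⁱ]` — representatives of `(ℤ/2ⁱ)ˣ` (for `i = 0`: `{1}`). [folklore] -/
def kSet (i : ℕ) : Finset ℕ := (Finset.range ((2 ^ i + 1) / 2)).image fun x ↦ 2 * x + 1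

/-- Membership in `kSet i`: the odd numbers `2x + 1`, `x < (2ⁱ + 1)/2`. [folklore] -/
theorem mem_kSet {i k : ℕ} : k ∈ kSet i ↔ ∃ x, x < (2 ^ i + 1) / 2 ∧ 2 * x + 1 = k := by
  simp [kSet]

/-- The elements of `kSet i` are odd. [folklore] -/
theorem odd_of_mem_kSet {i k : ℕ} (h : k ∈ kSet i) : Odd k := by
  obtain ⟨x, -, rfl⟩ := mem_kSet.mp h
  exact odd_two_mul_add_one x

/-- `#kSet i = (2ⁱ + 1)/2` (`= φ(2ⁱ)/2` for `i ≥ 1`, `= 1` for `i = 0`). [folklore] -/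
theorem card_kSet (i : ℕ) : (kSet i).card = (2 ^ i + 1) / 2 := by
  rw [kSet, Finset.card_image_of_injective _ (fun a b h ↦ by simpa using h), Finset.card_range]

/-- The elements of `kSet i` are `≤ 2ⁱ`. [folklore] -/
theorem le_of_mem_kSet {i k : ℕ} (h : k ∈ kSet i) : 1 ≤ k ∧ k ≤ 2 ^ i := by
  obtain ⟨x, hx, rfl⟩ := mem_kSet.mp h
  refine ⟨by omega, ?_⟩
  have h2 : 2 * ((2 ^ i + 1) / 2) ≤ 2 ^ i + 1 := Nat.mul_div_le (2 ^ i + 1) 2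
  have h1 : 1 ≤ 2 ^ i := Nat.one_le_two_pow
  omega

/-- `q₀(j, a) ∈ [0, 2ʲ)`: minus the inverse of `a` modulo `2ʲ` (for odd `a`). [folklore] -/
def qInv (j : ℕ) (a : ℤ) : ℤ := (ZMod.val (-(a : ZMod (2 ^ j))⁻¹) : ℕ)

/-- An odd integer is coprime to every power of `2`. [folklore] -/
theorem isCoprime_two_pow_of_odd (j : ℕ) {a : ℤ} (ha : Odd a) : IsCoprime ((2 : ℤ) ^ j) a := by
  obtain ⟨w, rfl⟩ := ha
  have h2 : IsCoprime (2 : ℤ) (2 * w + 1) := ⟨-w, 1, by ring⟩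
  exact h2.pow_left

/-- `2ʲ ∣ a q₀ + 1` for odd `a`. [folklore] -/
theorem two_pow_dvd_mul_qInv_add_one (j : ℕ) {a : ℤ} (ha : Odd a) : (2 ^ j : ℤ) ∣ a * qInv j a + 1 := by
  have hu : IsUnit (a : ZMod (2 ^ j)) :=
    (ZMod.coe_int_isUnit_iff_isCoprime a (2 ^ j)).mpr (by exact_mod_cast isCoprime_two_pow_of_odd j ha)
  have h : ((a * qInv j a + 1 : ℤ) : ZMod (2 ^ j)) = 0 := by
    rw [qInv, Int.cast_add, Int.cast_mul, Int.cast_one, Int.cast_natCast, ZMod.natCast_zmod_val, mul_neg,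
      ZMod.mul_inv_of_unit _ hu, neg_add_cancel]
  have := (ZMod.intCast_zmod_eq_zero_iff_dvd (a * qInv j a + 1) (2 ^ j)).mp h
  exact_mod_cast this

/-- `qInv j a ≥ 0`. [folklore] -/
theorem qInv_nonneg (j : ℕ) (a : ℤ) : 0 ≤ qInv j a := Int.natCast_nonneg _

/-- `qInv j a < 2ʲ`. [folklore] -/
theorem qInv_lt (j : ℕ) (a : ℤ) : qInv j a < 2 ^ j := by
  have := ZMod.val_lt (-(a : ZMod (2 ^ j))⁻¹)
  rw [qInv]
  exact_mod_cast this

/-- The family-2 matrix `Y(j, a) = (2ʲ, q₀; a, (a q₀ + 1)/2ʲ) ∈ SL₂(ℤ)` for odd `a` (junk `1`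
otherwise). [folklore] -/
def ySL (j : ℕ) (a : ℤ) : SL(2, ℤ) :=
  if h : (2 ^ j : ℤ) ∣ a * qInv j a + 1 then
    ⟨!![(2 ^ j : ℤ), qInv j a; a, (a * qInv j a + 1) / 2 ^ j], by
      rw [Matrix.det_fin_two_of, Int.mul_ediv_cancel' h]; ring⟩
  else 1

/-- The entries of `Y(j, a)`. [folklore] -/
theorem ySL_apply {j : ℕ} {a : ℤ} (ha : Odd a) :
    (ySL j a) 0 0 = 2 ^ j ∧ (ySL j a) 0 1 = qInv j a ∧ (ySL j a) 1 0 = a ∧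
      (ySL j a) 1 1 = (a * qInv j a + 1) / 2 ^ j := by
  have h := two_pow_dvd_mul_qInv_add_one j ha
  simp only [ySL, dif_pos h]
  exact ⟨rfl, rfl, rfl, rfl⟩

variable (t M : ℕ)

/-- The cusp representative attached to the type `(m, j, k)` of level `N = 2ᵗM`:
`β(M/m) L(2ʲ m k)` if `2j ≥ t`, and `β(2ᵗM/m) Y(j, m k)` if `2j < t`. [folklore] -/
def cuspRep (m j k : ℕ) : SL(2, ℤ) :=
  if t ≤ 2 * j then atkinLehnerSL (2 ^ t * M) (M / m) * lowerSL ((2 ^ j * m * k : ℕ) : ℤ)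
  else atkinLehnerSL (2 ^ t * M) (2 ^ t * (M / m)) * ySL j ((m * k : ℕ) : ℤ)

/-- The width of the cusp of type `(m, j, ·)`: `M/m` if `2j ≥ t`, `2^{t-2j} M/m` if `2j < t`. [folklore] -/
def cuspRepWidth (m j : ℕ) : ℕ := if t ≤ 2 * j then M / m else 2 ^ (t - 2 * j) * (M / m)

/-- The dilation factor of the expansion at the cusp of type `(m, j, ·)`: the period-`N`
coefficients of `f ∣ cuspRep` live on the multiples of `cuspRepDil`: `2ᵗ m` if `2j ≥ t`, `2^{2j} m` if
`2j < t`. [folklore] -/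
def cuspRepDil (m j : ℕ) : ℕ := if t ≤ 2 * j then 2 ^ t * m else 2 ^ (2 * j) * m

variable {t M}

/-- The dilation `cuspRepDil` is positive for `m > 0`. [folklore] -/
theorem dil_pos {m : ℕ} (j : ℕ) (hm : 0 < m) : 0 < cuspRepDil t m j := by
  unfold cuspRepDil; split_ifs <;> positivity

variable [NeZero M]

/-- `2ᵗM ≠ 0` for `M ≠ 0`. [folklore] -/
instance neZero_two_pow_mul : NeZero (2 ^ t * M) := ⟨mul_ne_zero (pow_ne_zero t two_ne_zero) (NeZero.ne M)⟩

omit [NeZero M] in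
/-- A divisor of `M ≠ 0` is positive. [folklore] -/
theorem pos_of_dvd {m : ℕ} [NeZero M] (hm : m ∣ M) : 0 < m :=
  Nat.pos_of_dvd_of_pos hm (Nat.pos_of_ne_zero (NeZero.ne M))

variable (t) in
/-- Arithmetic of a type: `Q = M/m` is odd, coprime to `m`, and `N = 2ᵗ m Q`. [folklore] -/
theorem type_arith (hMo : Odd M) (hMs : Squarefree M) {m : ℕ} (hm : m ∣ M) :
    0 < m ∧ Odd m ∧ Odd (M / m) ∧ Nat.Coprime (M / m) m ∧ M = m * (M / m) ∧
      2 ^ t * M = 2 ^ t * m * (M / m) := by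
  have hm0 : 0 < m := pos_of_dvd hm
  have hMeq : M = m * (M / m) := (Nat.mul_div_cancel' hm).symm
  have hmo : Odd m := hMo.of_dvd_nat hm
  have hQo : Odd (M / m) := hMo.of_dvd_nat (Nat.div_dvd_of_dvd hm)
  refine ⟨hm0, hmo, hQo, coprime_div_of_squarefree hMs hm, hMeq, ?_⟩
  conv_lhs => rw [hMeq]
  ring

omit [NeZero M] in
/-- `4 ∣ 2ᵗM` for `t ≥ 2`. [folklore] -/
theorem four_dvd_of_two_le (ht : 2 ≤ t) : 4 ∣ 2 ^ t * M := by
  have := (pow_dvd_pow 2 ht).mul_right M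
  norm_num at this
  exact this

/-- **The slash of `f` by a family-1 representative** (`2j ≥ t` and `j ≥ t − 1`, i.e. the
translation `k/2^{t−j}` is an integer or a half-integer): `(f ∣ β(Q)L(2ʲmk))(τ) = ±(ε_Q/Q) f(τ/Q)`,
`Q = M/m`. [cite: AtkinLehner1970, Thm. 3] -/
theorem exists_slash_rep_of_le (hMo : Odd M) (hMs : Squarefree M) {m j k : ℕ} (hm : m ∣ M)
    (hj : j ≤ t) (htj : t ≤ 2 * j) (hsmall : t ≤ j + 1) (hk : Odd k)
    {f : CuspForm (Gamma0 (2 ^ t * M)) 2} (hf : IsNewform0 f) :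
    ∃ K : ℂ, ‖K‖ = (cuspRepDil t m j : ℝ) / (2 ^ t * M : ℕ) ∧ ∃ r : ℝ, ∀ τ : ℍ,
      ((⇑f : ℍ → ℂ) ∣[(2 : ℤ)] (mapGL ℝ (cuspRep t M m j k) : GL (Fin 2) ℝ)) τ =
        K * f (UpperHalfPlane.mk (((cuspRepDil t m j : ℕ) : ℂ) / ((2 ^ t * M : ℕ) : ℕ) * τ + r)
          (im_dilate_pos (dil_pos j (pos_of_dvd hm)) r τ)) := by
  obtain ⟨hm0, hmo, hQo, hcop, hMeq, hNeq⟩ := type_arith t hMo hMs hm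
  set Q := M / m with hQdef
  have hQ0 : 0 < Q := Nat.pos_of_ne_zero fun h ↦ by simp [h] at hQo
  haveI : NeZero Q := ⟨hQ0.ne'⟩
  have hQN : Q ∣ 2 ^ t * M := ⟨2 ^ t * m, by rw [hNeq]; ring⟩
  have hNQ : 2 ^ t * M / Q = 2 ^ t * m := by
    rw [hNeq, Nat.mul_div_cancel _ hQ0]
  have hc : Nat.Coprime Q (2 ^ t * M / Q) := by
    rw [hNQ]
    exact Nat.Coprime.mul_right ((Nat.coprime_two_right.mpr hQo).pow_right t) hcop
  obtain ⟨ε, hε, hAL⟩ := hf.exists_slash_atkinLehnerSL_mul hQN hc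
  -- the slash by `L(Q c) = L(2ʲ M k)`: `f` (`j = t`) or `-f` (`j = t - 1`)
  have hθ : ∃ θ : ℂ, (θ = 1 ∨ θ = -1) ∧
      (⇑f : ℍ → ℂ) ∣[(2 : ℤ)] (mapGL ℝ (lowerSL ((Q : ℤ) * ((2 ^ j * m * k : ℕ) : ℤ))) : GL (Fin 2) ℝ) =
        θ • (⇑f : ℍ → ℂ) := by
    rcases Nat.eq_or_lt_of_le hj with rfl | hjt
    · refine ⟨1, Or.inl rfl, ?_⟩
      rw [one_smul]
      refine slash_lowerSL_of_dvd f ⟨k, ?_⟩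
      rw [hMeq]
      push_cast
      ring
    · have hjt1 : j + 1 = t := by omega
      refine ⟨-1, Or.inr rfl, ?_⟩
      rw [neg_one_smul]
      refine hf.slash_lowerSL_of_half (four_dvd_of_two_le (by omega)) (u := k) (by exact_mod_cast hk) ?_
      rw [hMeq, ← hjt1]
      push_cast
      ring
  obtain ⟨θ, hθ1, hθ⟩ := hθ
  have hm' : (0 : ℝ) < m := by exact_mod_cast hm0
  have hQr : (0 : ℝ) < Q := by exact_mod_cast hQ0
  refine ⟨ε * θ / Q, ?_, 0, fun τ ↦ ?_⟩
  · have hε1 : ‖ε‖ = 1 := by rcases hε with rfl | rfl <;> simp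
    have hθn : ‖θ‖ = 1 := by rcases hθ1 with rfl | rfl <;> simp
    rw [norm_div, norm_mul, hε1, hθn, Complex.norm_natCast, one_mul]
    simp only [cuspRepDil, if_pos htj]
    rw [hNeq]
    push_cast
    field_simp
  · rw [cuspRep, if_pos htj, hAL, tpDinv_mul_mapGL_lowerSL, SlashAction.slash_mul, hθ,
      ModularForm.smul_slash, σ_glCast, Pi.smul_apply, Pi.smul_apply, slash_upperGL_apply,
      smul_eq_mul, smul_eq_mul]
    have hpt : UpperHalfPlane.mk (((((Q : ℚ)⁻¹ : ℚ) : ℂ) * τ + ((0 : ℚ) : ℂ)) / ((1 : ℚ) : ℂ))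
        (im_upperGL_pos (by positivity) one_pos 0 τ) =
        UpperHalfPlane.mk (((cuspRepDil t m j : ℕ) : ℂ) / ((2 ^ t * M : ℕ) : ℕ) * τ + ((0 : ℝ) : ℂ))
          (im_dilate_pos (dil_pos j (pos_of_dvd hm)) (0 : ℝ) τ) := by
      refine UpperHalfPlane.ext ?_
      show ((((Q : ℚ)⁻¹ : ℚ) : ℂ) * τ + ((0 : ℚ) : ℂ)) / ((1 : ℚ) : ℂ) =
        ((cuspRepDil t m j : ℕ) : ℂ) / ((2 ^ t * M : ℕ) : ℕ) * τ + ((0 : ℝ) : ℂ)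
      simp only [cuspRepDil, if_pos htj]
      rw [hNeq]
      have hQc : (Q : ℂ) ≠ 0 := by exact_mod_cast hQ0.ne'
      have hmc : (m : ℂ) ≠ 0 := by exact_mod_cast hm0.ne'
      push_cast
      field_simp
    rw [hpt]
    have hQc : (Q : ℂ) ≠ 0 := by exact_mod_cast hQ0.ne'
    push_cast
    field_simp

/-- **The slash of `f` by a family-2 representative** (`2j < t` and `j ≤ 1`, i.e. the translation
`k/2ʲ` is an integer or a half-integer): `(f ∣ β(2ᵗQ) Y(j, mk))(τ) = ±ε (2ʲ/R) f((2ʲ/R)τ + r₀)`,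
`R = 2^{t−j} Q`, `Q = M/m`, `r₀ = 2ʲq₀/(2ᵗQ)`. [cite: AtkinLehner1970, Thm. 3] -/
theorem exists_slash_rep_of_lt (hMo : Odd M) (hMs : Squarefree M) {m j k : ℕ} (hm : m ∣ M)
    (htj : 2 * j < t) (hsmall : j ≤ 1) (hk : Odd k)
    {f : CuspForm (Gamma0 (2 ^ t * M)) 2} (hf : IsNewform0 f) :
    ∃ K : ℂ, ‖K‖ = (cuspRepDil t m j : ℝ) / (2 ^ t * M : ℕ) ∧ ∃ r : ℝ, ∀ τ : ℍ,
      ((⇑f : ℍ → ℂ) ∣[(2 : ℤ)] (mapGL ℝ (cuspRep t M m j k) : GL (Fin 2) ℝ)) τ =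
        K * f (UpperHalfPlane.mk (((cuspRepDil t m j : ℕ) : ℂ) / ((2 ^ t * M : ℕ) : ℕ) * τ + r)
          (im_dilate_pos (dil_pos j (pos_of_dvd hm)) r τ)) := by
  obtain ⟨hm0, hmo, hQo, hcop, hMeq, hNeq⟩ := type_arith t hMo hMs hm
  have hjt : j ≤ t := by omega
  have htj' : ¬ t ≤ 2 * j := by omega
  set Q := M / m with hQdef
  have hQ0 : 0 < Q := Nat.pos_of_ne_zero fun h ↦ by simp [h] at hQo
  haveI : NeZero Q := ⟨hQ0.ne'⟩
  -- `Q' = 2ᵗ Q = P R`, `P = 2ʲ`, `R = 2^{t-j} Q`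
  set P : ℕ := 2 ^ j with hPdef
  set R : ℕ := 2 ^ (t - j) * Q with hRdef
  haveI : NeZero P := ⟨pow_ne_zero j two_ne_zero⟩
  haveI : NeZero R := ⟨mul_ne_zero (pow_ne_zero _ two_ne_zero) hQ0.ne'⟩
  haveI : NeZero (2 ^ t * Q) := ⟨mul_ne_zero (pow_ne_zero _ two_ne_zero) hQ0.ne'⟩
  have hPR : 2 ^ t * Q = P * R := by
    rw [hPdef, hRdef, ← mul_assoc, ← pow_add, Nat.add_sub_cancel' hjt]
  have hQN : 2 ^ t * Q ∣ 2 ^ t * M := ⟨m, by rw [hNeq]; ring⟩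
  have hNQ : 2 ^ t * M / (2 ^ t * Q) = m := by
    rw [hNeq, show 2 ^ t * m * Q = m * (2 ^ t * Q) by ring, Nat.mul_div_cancel _ (NeZero.pos _)]
  have hc : Nat.Coprime (2 ^ t * Q) (2 ^ t * M / (2 ^ t * Q)) := by
    rw [hNQ]
    exact Nat.Coprime.mul_left ((Nat.coprime_two_left.mpr hmo).pow_left t) hcop
  obtain ⟨ε, hε, hAL⟩ := hf.exists_slash_atkinLehnerSL_mul hQN hc
  -- the matrix `Y`
  have ha : Odd (((m * k : ℕ)) : ℤ) := by exact_mod_cast hmo.mul hk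
  obtain ⟨hY00, hY01, hY10, hY11⟩ := ySL_apply (j := j) ha
  have hY00' : (ySL j ((m * k : ℕ) : ℤ)) 0 0 = (P : ℤ) := by rw [hY00, hPdef]; push_cast; ring
  -- the slash by `L(R a) = L(2^{t-j} M k)`: `f` (`j = 0`) or `-f` (`j = 1`)
  have hθ : ∃ θ : ℂ, (θ = 1 ∨ θ = -1) ∧
      (⇑f : ℍ → ℂ) ∣[(2 : ℤ)] (mapGL ℝ (lowerSL ((R : ℤ) * (ySL j ((m * k : ℕ) : ℤ)) 1 0)) : GL (Fin 2) ℝ) =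
        θ • (⇑f : ℍ → ℂ) := by
    rw [hY10]
    rcases Nat.le_one_iff_eq_zero_or_eq_one.mp hsmall with rfl | rfl
    · refine ⟨1, Or.inl rfl, ?_⟩
      rw [one_smul]
      refine slash_lowerSL_of_dvd f ⟨k, ?_⟩
      rw [hRdef, hMeq, Nat.sub_zero]
      push_cast
      ring
    · refine ⟨-1, Or.inr rfl, ?_⟩
      rw [neg_one_smul]
      refine hf.slash_lowerSL_of_half (four_dvd_of_two_le (by omega)) (u := k) (by exact_mod_cast hk) ?_
      rw [hRdef, hMeq, show t = (t - 1) + 1 by omega, pow_succ, Nat.add_sub_cancel]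
      push_cast
      ring
  obtain ⟨θ, hθ1, hθ⟩ := hθ
  have hm' : (0 : ℝ) < m := by exact_mod_cast hm0
  have hQr : (0 : ℝ) < Q := by exact_mod_cast hQ0
  refine ⟨ε * θ * P / R, ?_, (P : ℝ) * (qInv j ((m * k : ℕ) : ℤ) : ℝ) / (2 ^ t * Q : ℕ), fun τ ↦ ?_⟩
  · have hε1 : ‖ε‖ = 1 := by rcases hε with rfl | rfl <;> simp
    have hθn : ‖θ‖ = 1 := by rcases hθ1 with rfl | rfl <;> simp
    rw [norm_div, norm_mul, norm_mul, hε1, hθn, Complex.norm_natCast, Complex.norm_natCast, one_mul,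
      one_mul]
    simp only [cuspRepDil, if_neg htj']
    rw [hNeq, hRdef, hPdef, show t = (t - j) + j by omega, pow_add, Nat.add_sub_cancel]
    push_cast
    field_simp
    ring
  · rw [cuspRep, if_neg htj', hAL, tpDinv_mul_mapGL_of_apply P R (2 ^ t * Q) hPR _ hY00',
      SlashAction.slash_mul, hθ, ModularForm.smul_slash, σ_glCast, Pi.smul_apply, Pi.smul_apply,
      slash_upperGL_apply, smul_eq_mul, smul_eq_mul]
    have hpt : UpperHalfPlane.mk (((((R : ℚ)⁻¹ : ℚ) : ℂ) * τ +
          ((((ySL j ((m * k : ℕ) : ℤ)) 0 1 : ℚ) / (2 ^ t * Q : ℕ) : ℚ) : ℂ)) / (((P : ℚ)⁻¹ : ℚ) : ℂ))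
        (im_upperGL_pos (by positivity) (by positivity) _ τ) =
        UpperHalfPlane.mk (((cuspRepDil t m j : ℕ) : ℂ) / ((2 ^ t * M : ℕ) : ℕ) * τ +
          (((P : ℝ) * (qInv j ((m * k : ℕ) : ℤ) : ℝ) / (2 ^ t * Q : ℕ) : ℝ) : ℂ))
          (im_dilate_pos (dil_pos j (pos_of_dvd hm)) _ τ) := by
      refine UpperHalfPlane.ext ?_
      show ((((R : ℚ)⁻¹ : ℚ) : ℂ) * τ +
          ((((ySL j ((m * k : ℕ) : ℤ)) 0 1 : ℚ) / (2 ^ t * Q : ℕ) : ℚ) : ℂ)) / (((P : ℚ)⁻¹ : ℚ) : ℂ) =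
        ((cuspRepDil t m j : ℕ) : ℂ) / ((2 ^ t * M : ℕ) : ℕ) * τ +
          (((P : ℝ) * (qInv j ((m * k : ℕ) : ℤ) : ℝ) / (2 ^ t * Q : ℕ) : ℝ) : ℂ)
      simp only [cuspRepDil, if_neg htj', hY01]
      rw [hNeq, hRdef, hPdef, show t = (t - j) + j by omega, pow_add, Nat.add_sub_cancel]
      have hQc : (Q : ℂ) ≠ 0 := by exact_mod_cast hQ0.ne'
      have hmc : (m : ℂ) ≠ 0 := by exact_mod_cast hm0.ne'
      push_cast
      field_simp
      ring
    rw [hpt]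
    have hRc : (R : ℂ) ≠ 0 := by exact_mod_cast (NeZero.ne R)
    have hPc : (P : ℂ) ≠ 0 := by exact_mod_cast (NeZero.ne P)
    push_cast
    field_simp

/-- **The slash of `f` by a representative, both families** (`min(j, t − j) ≤ 1`, which is every
type when `t ≤ 3`): `(f ∣ cuspRep)(τ) = K f((D/N)τ + r)` with `|K| = D/N`, `D = cuspRepDil`. [cite: AtkinLehner1970, Thm. 3] -/
theorem exists_slash_rep (hMo : Odd M) (hMs : Squarefree M) {m j k : ℕ} (hm : m ∣ M) (hj : j ≤ t)
    (hsmall : min j (t - j) ≤ 1) (hk : Odd k) {f : CuspForm (Gamma0 (2 ^ t * M)) 2} (hf : IsNewform0 f) :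
    ∃ K : ℂ, ‖K‖ = (cuspRepDil t m j : ℝ) / (2 ^ t * M : ℕ) ∧ ∃ r : ℝ, ∀ τ : ℍ,
      ((⇑f : ℍ → ℂ) ∣[(2 : ℤ)] (mapGL ℝ (cuspRep t M m j k) : GL (Fin 2) ℝ)) τ =
        K * f (UpperHalfPlane.mk (((cuspRepDil t m j : ℕ) : ℂ) / ((2 ^ t * M : ℕ) : ℕ) * τ + r)
          (im_dilate_pos (dil_pos j (pos_of_dvd hm)) r τ)) := by
  by_cases htj : t ≤ 2 * j
  · refine exists_slash_rep_of_le hMo hMs hm hj htj ?_ hk hf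
    rcases le_total j (t - j) with h | h
    · rw [min_eq_left h] at hsmall; omega
    · rw [min_eq_right h] at hsmall; omega
  · refine exists_slash_rep_of_lt hMo hMs hm (by omega) ?_ hk hf
    rcases le_total j (t - j) with h | h
    · rw [min_eq_left h] at hsmall; omega
    · rw [min_eq_right h] at hsmall; omega

end Types

/-! ### 6. The cusp invariants and widths of the representatives -/

section Invariants

variable {t M : ℕ} [NeZero M]

omit [NeZero M] in
/-- The `(1,0)` entry of a product in `SL(2, ℤ)`. [folklore] -/
theorem SL_mul_apply_10 (β Y : SL(2, ℤ)) : (β * Y) 1 0 = β 1 0 * Y 0 0 + β 1 1 * Y 1 0 := by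
  simp [Matrix.mul_apply, Fin.sum_univ_two]

omit [NeZero M] in
/-- The `(0,0)` entry of a product in `SL(2, ℤ)`. [folklore] -/
theorem SL_mul_apply_00 (β Y : SL(2, ℤ)) : (β * Y) 0 0 = β 0 0 * Y 0 0 + β 0 1 * Y 1 0 := by
  simp [Matrix.mul_apply, Fin.sum_univ_two]

/-- **Entries of a family-1 representative**: `c = 2ʲm(2^{t−j} + Qk)`, `a = x + y·2ʲmk` with
`Qx − 2ᵗm·y = 1` (`Q = M/m`). [folklore] -/
theorem rep_entries_of_le (hMo : Odd M) (hMs : Squarefree M) {m j : ℕ} (hm : m ∣ M) (hj : j ≤ t)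
    (htj : t ≤ 2 * j) (k : ℕ) :
    ∃ x y : ℤ, ((M / m : ℕ) : ℤ) * x - ((2 ^ t * m : ℕ) : ℤ) * y = 1 ∧
      (cuspRep t M m j k) 1 0 = ((2 ^ j * m : ℕ) : ℤ) * (((2 ^ (t - j) : ℕ) : ℤ) + ((M / m : ℕ) : ℤ) * k) ∧
      (cuspRep t M m j k) 0 0 = x + y * ((2 ^ j * m * k : ℕ) : ℤ) := by
  obtain ⟨hm0, hmo, hQo, hcop, hMeq, hNeq⟩ := type_arith t hMo hMs hm
  set Q := M / m with hQdef
  have hQ0 : 0 < Q := Nat.pos_of_ne_zero fun h ↦ by simp [h] at hQo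
  have hNQ : 2 ^ t * M / Q = 2 ^ t * m := by rw [hNeq, Nat.mul_div_cancel _ hQ0]
  have hc : Nat.Coprime Q (2 ^ t * M / Q) := by
    rw [hNQ]
    exact Nat.Coprime.mul_right ((Nat.coprime_two_right.mpr hQo).pow_right t) hcop
  obtain ⟨h10, h11⟩ := atkinLehnerSL_apply_one (2 ^ t * M) Q hc
  have hbez := atkinLehnerSL_bezout (2 ^ t * M) Q hc
  rw [hNQ] at h10 hbez
  refine ⟨(atkinLehnerSL (2 ^ t * M) Q) 0 0, (atkinLehnerSL (2 ^ t * M) Q) 0 1, hbez, ?_, ?_⟩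
  · rw [cuspRep, if_pos htj, SL_mul_apply_10, h10, h11, lowerSL_apply_00, lowerSL_apply_10,
      show t = (t - j) + j by omega, pow_add, Nat.add_sub_cancel]
    push_cast
    ring
  · rw [cuspRep, if_pos htj, SL_mul_apply_00, lowerSL_apply_00, lowerSL_apply_10]
    ring

/-- **Entries of a family-2 representative**: `c = 2ʲm(1 + 2^{t−j}Qk)`, `a = 2ʲx + y·mk` with
`2ᵗQ·x − m·y = 1`, and `Y₀₁ = q₀ ∈ [0, 2ʲ)`. [folklore] -/
theorem rep_entries_of_lt (hMo : Odd M) (hMs : Squarefree M) {m j k : ℕ} (hm : m ∣ M)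
    (htj : 2 * j < t) (hk : Odd k) :
    ∃ x y : ℤ, ((2 ^ t * (M / m) : ℕ) : ℤ) * x - (m : ℤ) * y = 1 ∧
      (cuspRep t M m j k) 1 0 =
        ((2 ^ j * m : ℕ) : ℤ) * (1 + ((2 ^ (t - j) : ℕ) : ℤ) * ((M / m : ℕ) : ℤ) * k) ∧
      (cuspRep t M m j k) 0 0 = x * ((2 ^ j : ℕ) : ℤ) + y * ((m * k : ℕ) : ℤ) := by
  obtain ⟨hm0, hmo, hQo, hcop, hMeq, hNeq⟩ := type_arith t hMo hMs hm
  have hjt : j ≤ t := by omega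
  have htj' : ¬ t ≤ 2 * j := by omega
  set Q := M / m with hQdef
  have hQ0 : 0 < Q := Nat.pos_of_ne_zero fun h ↦ by simp [h] at hQo
  haveI : NeZero (2 ^ t * Q) := ⟨mul_ne_zero (pow_ne_zero _ two_ne_zero) hQ0.ne'⟩
  have hNQ : 2 ^ t * M / (2 ^ t * Q) = m := by
    rw [hNeq, show 2 ^ t * m * Q = m * (2 ^ t * Q) by ring, Nat.mul_div_cancel _ (NeZero.pos _)]
  have hc : Nat.Coprime (2 ^ t * Q) (2 ^ t * M / (2 ^ t * Q)) := by
    rw [hNQ]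
    exact Nat.Coprime.mul_left ((Nat.coprime_two_left.mpr hmo).pow_left t) hcop
  obtain ⟨h10, h11⟩ := atkinLehnerSL_apply_one (2 ^ t * M) (2 ^ t * Q) hc
  have hbez := atkinLehnerSL_bezout (2 ^ t * M) (2 ^ t * Q) hc
  rw [hNQ] at h10 hbez
  have ha : Odd (((m * k : ℕ)) : ℤ) := by exact_mod_cast hmo.mul hk
  obtain ⟨hY00, hY01, hY10, hY11⟩ := ySL_apply (j := j) ha
  refine ⟨(atkinLehnerSL (2 ^ t * M) (2 ^ t * Q)) 0 0, (atkinLehnerSL (2 ^ t * M) (2 ^ t * Q)) 0 1,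
    hbez, ?_, ?_⟩
  · rw [cuspRep, if_neg htj', SL_mul_apply_10, h10, h11, hY00, hY10,
      show t = (t - j) + j by omega, pow_add, Nat.add_sub_cancel]
    push_cast
    ring
  · rw [cuspRep, if_neg htj', SL_mul_apply_00, hY00, hY10]
    push_cast
    ring

/-- **The divisor invariant of a representative**: `gcd(c, N) = 2ʲ m`. [folklore] -/
theorem cuspDivisor_rep (hMo : Odd M) (hMs : Squarefree M) {m j k : ℕ} (hm : m ∣ M) (hj : j ≤ t)
    (hk : Odd k) : cuspDivisor (2 ^ t * M) (cuspRep t M m j k) = 2 ^ j * m := by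
  obtain ⟨hm0, hmo, hQo, hcop, hMeq, hNeq⟩ := type_arith t hMo hMs hm
  set Q := M / m with hQdef
  have hN : ((2 ^ t * M : ℕ) : ℤ) = ((2 ^ j * m : ℕ) : ℤ) * (((2 ^ (t - j) : ℕ) : ℤ) * Q) := by
    rw [hNeq, show t = (t - j) + j by omega, pow_add, Nat.add_sub_cancel]
    push_cast
    ring
  have h2Q : IsCoprime (2 : ℤ) Q := by
    obtain ⟨w, hw⟩ := hQo
    exact ⟨-(w : ℤ), 1, by rw [hw]; push_cast; ring⟩
  have hQk : Odd ((Q : ℤ) * k) := by exact_mod_cast hQo.mul hk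
  -- `gcd(r, 2^{t-j} Q) = 1` for the cofactor `r` of `c = 2ʲ m r`
  have key : ∀ r : ℤ, IsCoprime r (((2 ^ (t - j) : ℕ) : ℤ) * Q) →
      (cuspRep t M m j k) 1 0 = ((2 ^ j * m : ℕ) : ℤ) * r →
        cuspDivisor (2 ^ t * M) (cuspRep t M m j k) = 2 ^ j * m := by
    intro r hr h10
    rw [cuspDivisor, h10, hN, Int.gcd_mul_left, Int.isCoprime_iff_gcd_eq_one.mp hr, mul_one,
      Int.natAbs_natCast]
  by_cases htj : t ≤ 2 * j
  · obtain ⟨x, y, -, h10, -⟩ := rep_entries_of_le hMo hMs hm hj htj k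
    refine key _ ?_ h10
    refine IsCoprime.mul_right ?_ ?_
    · -- `2^{t-j} + Qk` is prime to `2^{t-j}` since `Qk` is odd
      have h1 : IsCoprime ((Q : ℤ) * k) (((2 ^ (t - j) : ℕ) : ℤ)) := by
        push_cast
        exact (isCoprime_two_pow_of_odd (t - j) hQk).symm
      have := h1.add_mul_right_left 1
      rwa [one_mul, add_comm] at this
    · -- and prime to `Q`
      have h1 : IsCoprime (((2 ^ (t - j) : ℕ) : ℤ)) (Q : ℤ) := by
        push_cast
        exact h2Q.pow_left
      exact h1.add_mul_left_left k
  · have htj2 : 2 * j < t := by omega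
    obtain ⟨x, y, -, h10, -⟩ := rep_entries_of_lt hMo hMs hm htj2 hk
    refine key _ ?_ h10
    have h1 : IsCoprime (1 : ℤ) (((2 ^ (t - j) : ℕ) : ℤ) * Q) := isCoprime_one_left
    have := h1.add_mul_left_left (k : ℤ)
    convert this using 2

/-- `gcd(d, N/d)` for `d = 2ʲm`: it is a multiple of `2^{min(j,t−j)}`, divides `2^{t−j}` and
divides `2ʲ` times nothing else — precisely, `e ∣ 2^{t−j}` and `e ∣ 2ʲ·m`-free parts:
we record `2^{t-j} ∣ e` when `t ≤ 2j`, `2ʲ ∣ e` when `2j < t`, `e ∣ 2^{t−j}` and `e ∣ 2ʲ`. [folklore] -/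
theorem gcd_type (hMo : Odd M) (hMs : Squarefree M) {m j : ℕ} (hm : m ∣ M) (hj : j ≤ t) :
    2 ^ t * M / (2 ^ j * m) = 2 ^ (t - j) * (M / m) ∧
    Nat.gcd (2 ^ j * m) (2 ^ (t - j) * (M / m)) ∣ 2 ^ (t - j) ∧
    Nat.gcd (2 ^ j * m) (2 ^ (t - j) * (M / m)) ∣ 2 ^ j ∧
    2 ^ (min j (t - j)) ∣ Nat.gcd (2 ^ j * m) (2 ^ (t - j) * (M / m)) := by
  obtain ⟨hm0, hmo, hQo, hcop, hMeq, hNeq⟩ := type_arith t hMo hMs hm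
  set Q := M / m with hQdef
  have hNd : 2 ^ t * M = (2 ^ j * m) * (2 ^ (t - j) * Q) := by
    rw [hNeq, show t = (t - j) + j by omega, pow_add, Nat.add_sub_cancel]; ring
  have hd0 : 0 < 2 ^ j * m := by positivity
  refine ⟨by rw [hNd, Nat.mul_div_cancel_left _ hd0], ?_, ?_, ?_⟩
  · -- `e ∣ 2^{t-j} Q` and `e` is prime to `Q` (it divides `2ʲ m`)
    have he1 : Nat.gcd (2 ^ j * m) (2 ^ (t - j) * Q) ∣ 2 ^ j * m := Nat.gcd_dvd_left _ _
    have he2 : Nat.gcd (2 ^ j * m) (2 ^ (t - j) * Q) ∣ 2 ^ (t - j) * Q := Nat.gcd_dvd_right _ _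
    have hcQ : Nat.Coprime (2 ^ j * m) Q :=
      Nat.Coprime.mul_left ((Nat.coprime_two_left.mpr hQo).pow_left j) hcop.symm
    exact (Nat.Coprime.coprime_dvd_left he1 hcQ).dvd_of_dvd_mul_right he2
  · have he1 : Nat.gcd (2 ^ j * m) (2 ^ (t - j) * Q) ∣ 2 ^ j * m := Nat.gcd_dvd_left _ _
    have he2 : Nat.gcd (2 ^ j * m) (2 ^ (t - j) * Q) ∣ 2 ^ (t - j) * Q := Nat.gcd_dvd_right _ _
    have hcm : Nat.Coprime (2 ^ (t - j) * Q) m :=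
      Nat.Coprime.mul_left ((Nat.coprime_two_left.mpr hmo).pow_left _) hcop
    exact (Nat.Coprime.coprime_dvd_left he2 hcm).dvd_of_dvd_mul_right he1
  · refine Nat.dvd_gcd ?_ ?_
    · exact (pow_dvd_pow 2 (min_le_left j (t - j))).mul_right m
    · exact (pow_dvd_pow 2 (min_le_right j (t - j))).mul_right Q

/-- **The unit invariant of a family-1 representative**: `a·(c/d) ≡ k (mod gcd(d, N/d))`. [folklore] -/
theorem cuspUnitInt_rep_of_le (hMo : Odd M) (hMs : Squarefree M) {m j k : ℕ} (hm : m ∣ M) (hj : j ≤ t)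
    (htj : t ≤ 2 * j) (hk : Odd k) :
    ((Nat.gcd (2 ^ j * m) (2 ^ (t - j) * (M / m)) : ℕ) : ℤ) ∣
      cuspUnitInt (2 ^ t * M) (cuspRep t M m j k) - k := by
  obtain ⟨hm0, hmo, hQo, hcop, hMeq, hNeq⟩ := type_arith t hMo hMs hm
  obtain ⟨-, he, -, -⟩ := gcd_type hMo hMs hm hj
  refine (Int.natCast_dvd_natCast.mpr he).trans ?_
  obtain ⟨x, y, hbez, h10, h00⟩ := rep_entries_of_le hMo hMs hm hj htj k
  have hd := cuspDivisor_rep hMo hMs hm hj hk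
  rw [cuspUnitInt, hd, h10, h00]
  have hd0 : ((2 ^ j * m : ℕ) : ℤ) ≠ 0 := by positivity
  rw [Int.mul_ediv_cancel_left _ hd0]
  -- `(x + y 2ʲ m k)(2^{t-j} + Q k) - k = 2^{t-j}(…)`, using `Q x = 1 + 2ᵗ m y` and `2ʲ = 2^{t-j} 2^{2j-t}`
  have h2j : ((2 ^ j : ℕ) : ℤ) = ((2 ^ (t - j) : ℕ) : ℤ) * ((2 ^ (2 * j - t) : ℕ) : ℤ) := by
    rw [← Nat.cast_mul, ← pow_add]; congr 2; omega
  have h2t : ((2 ^ t : ℕ) : ℤ) = ((2 ^ (t - j) : ℕ) : ℤ) * ((2 ^ j : ℕ) : ℤ) := by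
    rw [← Nat.cast_mul, ← pow_add]; congr 2; omega
  refine ⟨x + 2 * 2 ^ j * m * y * k + 2 ^ (2 * j - t) * m * ((M / m : ℕ) : ℤ) * y * k ^ 2, ?_⟩
  set Qz : ℤ := ((M / m : ℕ) : ℤ) with hQz
  push_cast at hbez h2j h2t ⊢
  linear_combination (k : ℤ) * hbez + (y * m * k) * h2t + (y * m * Qz * k ^ 2) * h2j

/-- **The unit invariant of a family-2 representative**: `a·(c/d) ≡ -k (mod gcd(d, N/d))`. [folklore] -/
theorem cuspUnitInt_rep_of_lt (hMo : Odd M) (hMs : Squarefree M) {m j k : ℕ} (hm : m ∣ M)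
    (htj : 2 * j < t) (hk : Odd k) :
    ((Nat.gcd (2 ^ j * m) (2 ^ (t - j) * (M / m)) : ℕ) : ℤ) ∣
      cuspUnitInt (2 ^ t * M) (cuspRep t M m j k) + k := by
  obtain ⟨hm0, hmo, hQo, hcop, hMeq, hNeq⟩ := type_arith t hMo hMs hm
  have hj : j ≤ t := by omega
  obtain ⟨-, -, he, -⟩ := gcd_type hMo hMs hm hj
  refine (Int.natCast_dvd_natCast.mpr he).trans ?_
  obtain ⟨x, y, hbez, h10, h00⟩ := rep_entries_of_lt hMo hMs hm htj hk
  have hd := cuspDivisor_rep hMo hMs hm hj hk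
  clear hm
  rw [cuspUnitInt, hd, h10, h00]
  have hd0 : ((2 ^ j * m : ℕ) : ℤ) ≠ 0 := by positivity
  rw [Int.mul_ediv_cancel_left _ hd0]
  have h2t : ((2 ^ t : ℕ) : ℤ) = ((2 ^ j : ℕ) : ℤ) * ((2 ^ (t - j) : ℕ) : ℤ) := by
    rw [← Nat.cast_mul, ← pow_add]; congr 2; omega
  have h2tj : ((2 ^ (t - j) : ℕ) : ℤ) = ((2 ^ j : ℕ) : ℤ) * ((2 ^ (t - 2 * j) : ℕ) : ℤ) := by
    rw [← Nat.cast_mul, ← pow_add]; congr 2; omega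
  refine ⟨x + 2 * 2 ^ (t - j) * ((M / m : ℕ) : ℤ) * x * k +
    2 ^ (t - 2 * j) * ((M / m : ℕ) : ℤ) * k ^ 2 * (2 ^ t * ((M / m : ℕ) : ℤ) * x - 1), ?_⟩
  simp only [Nat.cast_mul, Nat.cast_pow, Nat.cast_ofNat] at hbez h2t h2tj ⊢
  set Qz : ℤ := ((M / m : ℕ) : ℤ) with hQz
  linear_combination (-(k : ℤ) * (1 + 2 ^ (t - j) * Qz * k)) * hbez + (x * Qz * k) * h2t +
    (k ^ 2 * Qz * (2 ^ t * Qz * x - 1)) * h2tj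

omit [NeZero M] in
/-- **`g T^n g⁻¹ ∈ Γ₀(N) ⟺ N ∣ n c²`** for `g = (a b; c d) ∈ SL₂(ℤ)` (the lower-left entry of
`g T^n g⁻¹` is `-n c²`): the width of the cusp `g ∞` is `N / gcd(N, c²)`. [folklore] -/
theorem conj_T_zpow_mem_Gamma0_iff {N : ℕ} (g : SL(2, ℤ)) (n : ℤ) :
    g * ModularGroup.T ^ n * g⁻¹ ∈ Gamma0 N ↔ (N : ℤ) ∣ n * (g 1 0) ^ 2 := by
  rw [Gamma0_mem]
  have h10 : ((g * ModularGroup.T ^ n * g⁻¹ : SL(2, ℤ)) : Matrix (Fin 2) (Fin 2) ℤ) 1 0 =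
      -(n * (g 1 0) ^ 2) := by
    rw [Matrix.SpecialLinearGroup.coe_mul, Matrix.SpecialLinearGroup.coe_mul,
      Matrix.SpecialLinearGroup.coe_inv, ModularGroup.coe_T_zpow]
    simp [Matrix.mul_apply, Fin.sum_univ_two, Matrix.adjugate_fin_two]
    ring
  rw [h10, Int.cast_neg, neg_eq_zero, ZMod.intCast_zmod_eq_zero_iff_dvd]

omit [NeZero M] in
/-- An odd natural number is coprime to `2` (as integers). [folklore] -/
theorem isCoprime_two_of_odd {Q : ℕ} (hQ : Odd Q) : IsCoprime (2 : ℤ) Q := by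
  obtain ⟨w, hw⟩ := hQ
  exact ⟨-(w : ℤ), 1, by rw [hw]; push_cast; ring⟩

omit [NeZero M] in
/-- Coprime natural numbers are coprime as integers. [folklore] -/
theorem isCoprime_natCast_of_coprime {a b : ℕ} (h : Nat.Coprime a b) : IsCoprime (a : ℤ) (b : ℤ) :=
  Int.isCoprime_iff_gcd_eq_one.mpr (by simpa [Nat.coprime_iff_gcd_eq_one] using h)

/-- **The width of a family-1 cusp is `Q = M/m`**: `cuspRep Tⁿ cuspRep⁻¹ ∈ Γ₀(N) ⟺ Q ∣ n`. [folklore] -/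
theorem rep_T_zpow_rep_inv_mem_iff_of_le (hMo : Odd M) (hMs : Squarefree M) {m j : ℕ} (k : ℕ)
    (hm : m ∣ M) (hj : j ≤ t) (htj : t ≤ 2 * j) (n : ℤ) :
    cuspRep t M m j k * ModularGroup.T ^ n * (cuspRep t M m j k)⁻¹ ∈ Gamma0 (2 ^ t * M) ↔
      ((cuspRepWidth t M m j : ℕ) : ℤ) ∣ n := by
  obtain ⟨hm0, hmo, hQo, hcop, hMeq, hNeq⟩ := type_arith t hMo hMs hm
  obtain ⟨x, y, -, h10, -⟩ := rep_entries_of_le hMo hMs hm hj htj k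
  clear hm
  rw [conj_T_zpow_mem_Gamma0_iff, h10, cuspRepWidth, if_pos htj]
  set Qz : ℤ := ((M / m : ℕ) : ℤ) with hQz
  set r : ℤ := ((2 ^ (t - j) : ℕ) : ℤ) + Qz * k with hr
  have h2Q : IsCoprime (2 : ℤ) Qz := isCoprime_two_of_odd hQo
  -- `Q` is prime to `c = 2ʲ m r`
  have hQc : IsCoprime Qz (((2 ^ j * m : ℕ) : ℤ) * r) := by
    refine IsCoprime.mul_right ?_ ?_
    · simp only [Nat.cast_mul, Nat.cast_pow, Nat.cast_ofNat]
      exact IsCoprime.mul_right h2Q.symm.pow_right (isCoprime_natCast_of_coprime hcop)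
    · have h1 : IsCoprime (((2 ^ (t - j) : ℕ) : ℤ)) Qz := by
        simp only [Nat.cast_pow, Nat.cast_ofNat]; exact h2Q.pow_left
      exact (h1.add_mul_left_left k).symm
  have h2j : ((2 ^ j : ℕ) : ℤ) = ((2 ^ (t - j) : ℕ) : ℤ) * ((2 ^ (2 * j - t) : ℕ) : ℤ) := by
    rw [← Nat.cast_mul, ← pow_add]; congr 2; omega
  have hN : ((2 ^ t * M : ℕ) : ℤ) = ((2 ^ j * m : ℕ) : ℤ) * ((2 ^ (t - j) : ℕ) : ℤ) * Qz := by
    have e : 2 ^ t = 2 ^ (t - j) * 2 ^ j := by rw [← pow_add]; congr 1; omega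
    rw [hNeq, e]; simp only [Nat.cast_mul, Nat.cast_pow, Nat.cast_ofNat]; ring
  constructor
  · intro h
    have hQN : Qz ∣ ((2 ^ t * M : ℕ) : ℤ) := ⟨((2 ^ j * m : ℕ) : ℤ) * ((2 ^ (t - j) : ℕ) : ℤ), by
      rw [hN]; ring⟩
    have h' : Qz ∣ n * ((((2 ^ j * m : ℕ) : ℤ) * r) * (((2 ^ j * m : ℕ) : ℤ) * r)) := by
      rw [← sq]; exact hQN.trans h
    exact (hQc.mul_right hQc).dvd_of_dvd_mul_right h'
  · rintro ⟨n', rfl⟩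
    refine ⟨n' * ((2 ^ (2 * j - t) : ℕ) : ℤ) * m * r ^ 2, ?_⟩
    rw [hN]
    simp only [Nat.cast_mul, Nat.cast_pow, Nat.cast_ofNat] at h2j ⊢
    linear_combination (Qz * n' * m * r ^ 2 * 2 ^ j * m) * h2j

/-- **The width of a family-2 cusp is `2^{t−2j} Q`**: `cuspRep Tⁿ cuspRep⁻¹ ∈ Γ₀(N) ⟺ 2^{t−2j}Q ∣ n`. [folklore] -/
theorem rep_T_zpow_rep_inv_mem_iff_of_lt (hMo : Odd M) (hMs : Squarefree M) {m j k : ℕ} (hm : m ∣ M)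
    (htj : 2 * j < t) (hk : Odd k) (n : ℤ) :
    cuspRep t M m j k * ModularGroup.T ^ n * (cuspRep t M m j k)⁻¹ ∈ Gamma0 (2 ^ t * M) ↔
      ((cuspRepWidth t M m j : ℕ) : ℤ) ∣ n := by
  obtain ⟨hm0, hmo, hQo, hcop, hMeq, hNeq⟩ := type_arith t hMo hMs hm
  have htj' : ¬ t ≤ 2 * j := by omega
  obtain ⟨x, y, -, h10, -⟩ := rep_entries_of_lt hMo hMs hm htj hk
  clear hm
  rw [conj_T_zpow_mem_Gamma0_iff, h10, cuspRepWidth, if_neg htj']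
  set Qz : ℤ := ((M / m : ℕ) : ℤ) with hQz
  set r : ℤ := 1 + ((2 ^ (t - j) : ℕ) : ℤ) * Qz * k with hr
  have h2Q : IsCoprime (2 : ℤ) Qz := isCoprime_two_of_odd hQo
  have h2m : IsCoprime (2 : ℤ) m := isCoprime_two_of_odd hmo
  have h2tj : ((2 ^ (t - j) : ℕ) : ℤ) = ((2 ^ (t - 2 * j) : ℕ) : ℤ) * ((2 ^ j : ℕ) : ℤ) := by
    rw [← Nat.cast_mul, ← pow_add]; congr 2; omega
  have hN : ((2 ^ t * M : ℕ) : ℤ) =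
      ((2 ^ (t - 2 * j) : ℕ) : ℤ) * Qz * (((2 ^ j : ℕ) : ℤ) * ((2 ^ j : ℕ) : ℤ) * m) := by
    have e : 2 ^ t = 2 ^ (t - 2 * j) * 2 ^ j * 2 ^ j := by rw [← pow_add, ← pow_add]; congr 1; omega
    rw [hNeq, e]; simp only [Nat.cast_mul, Nat.cast_pow, Nat.cast_ofNat]; ring
  -- `2^{t-2j} Q` is prime to `m r²`
  have hW : IsCoprime (((2 ^ (t - 2 * j) : ℕ) : ℤ) * Qz) ((m : ℤ) * r ^ 2) := by
    refine IsCoprime.mul_right ?_ ?_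
    · refine IsCoprime.mul_left ?_ ?_
      · simp only [Nat.cast_pow, Nat.cast_ofNat]; exact h2m.pow_left
      · exact isCoprime_natCast_of_coprime hcop
    · have h1 : IsCoprime (((2 ^ (t - 2 * j) : ℕ) : ℤ) * Qz) r := by
        have h0 : IsCoprime (1 : ℤ) (((2 ^ (t - 2 * j) : ℕ) : ℤ) * Qz) := isCoprime_one_left
        have := h0.add_mul_left_left (((2 ^ j : ℕ) : ℤ) * k)
        have heq : r = 1 + ((2 ^ (t - 2 * j) : ℕ) : ℤ) * Qz * (((2 ^ j : ℕ) : ℤ) * k) := by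
          rw [hr, h2tj]; ring
        rw [heq]
        exact this.symm
      have := h1.mul_right h1
      rwa [← sq] at this
  constructor
  · intro h
    rw [hN] at h
    have h' : ((2 ^ (t - 2 * j) : ℕ) : ℤ) * Qz ∣ n * ((m : ℤ) * r ^ 2) := by
      have h2 : ((2 ^ (t - 2 * j) : ℕ) : ℤ) * Qz * (((2 ^ j : ℕ) : ℤ) * ((2 ^ j : ℕ) : ℤ) * m) ∣
          (n * ((m : ℤ) * r ^ 2)) * (((2 ^ j : ℕ) : ℤ) * ((2 ^ j : ℕ) : ℤ) * m) := by
        have heq : n * (((2 ^ j * m : ℕ) : ℤ) * r) ^ 2 =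
            (n * ((m : ℤ) * r ^ 2)) * (((2 ^ j : ℕ) : ℤ) * ((2 ^ j : ℕ) : ℤ) * m) := by
          simp only [Nat.cast_mul, Nat.cast_pow, Nat.cast_ofNat]; ring
        rwa [heq] at h
      have hne : (((2 ^ j : ℕ) : ℤ) * ((2 ^ j : ℕ) : ℤ) * m) ≠ 0 := by positivity
      exact (mul_dvd_mul_iff_right hne).mp h2
    exact hW.dvd_of_dvd_mul_right h'
  · rintro ⟨n', rfl⟩
    refine ⟨n' * m * r ^ 2, ?_⟩
    rw [hN]
    simp only [Nat.cast_mul, Nat.cast_pow, Nat.cast_ofNat]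
    ring

end Invariants

/-! ### 7. The coset system `SL₂(ℤ) = ⨆ Γ₀(2ᵗM) · (cuspRep T^l)⁻¹…`: the types enumerate the cusps -/

section Cosets

variable {t M : ℕ} [NeZero M]

omit [NeZero M] in
/-- Uniqueness of the decomposition `2ᵃ m` with `m` odd. [folklore] -/
theorem two_pow_mul_odd_inj {a b m m' : ℕ} (hm : Odd m) (hm' : Odd m') (h : 2 ^ a * m = 2 ^ b * m') :
    a = b ∧ m = m' := by
  have key : ∀ {a b m m' : ℕ}, Odd m → a ≤ b → 2 ^ a * m = 2 ^ b * m' → a = b := by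
    intro a b m m' hm hab h
    by_contra hne
    have hlt : a < b := lt_of_le_of_ne hab hne
    have e : 2 ^ b = 2 ^ a * (2 * 2 ^ (b - a - 1)) := by
      rw [← pow_succ', ← pow_add]; congr 1; omega
    have h2 : 2 ^ a * m = 2 ^ a * (2 * (2 ^ (b - a - 1) * m')) := by rw [h, e]; ring
    have h3 : m = 2 * (2 ^ (b - a - 1) * m') := Nat.eq_of_mul_eq_mul_left (by positivity) h2
    exact (Nat.not_even_iff_odd.mpr hm) ⟨2 ^ (b - a - 1) * m', by rw [h3]; ring⟩
  have hab : a = b := by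
    rcases le_total a b with hab | hab
    · exact key hm hab h
    · exact (key hm' hab h.symm).symm
  subst hab
  exact ⟨rfl, Nat.eq_of_mul_eq_mul_left (by positivity) h⟩

omit [NeZero M] in
/-- Two elements of `kSet i` congruent modulo `2ⁱ` are equal. [folklore] -/
theorem eq_of_mem_kSet_of_dvd_sub {i k k' : ℕ} (hk : k ∈ kSet i) (hk' : k' ∈ kSet i)
    (h : ((2 ^ i : ℕ) : ℤ) ∣ (k : ℤ) - k') : k = k' := by
  obtain ⟨h1, h2⟩ := le_of_mem_kSet hk
  obtain ⟨h1', h2'⟩ := le_of_mem_kSet hk'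
  obtain ⟨q, hq⟩ := h
  have hq0 : q = 0 := by
    by_contra hne
    rcases lt_or_gt_of_ne hne with hlt | hgt
    · have : (k : ℤ) - k' ≤ -((2 ^ i : ℕ) : ℤ) := by rw [hq]; nlinarith
      push_cast at this
      have : (k' : ℤ) ≤ 2 ^ i := by exact_mod_cast h2'
      have : (1 : ℤ) ≤ k := by exact_mod_cast h1
      linarith
    · have : ((2 ^ i : ℕ) : ℤ) ≤ (k : ℤ) - k' := by rw [hq]; nlinarith
      push_cast at this
      have : (k : ℤ) ≤ 2 ^ i := by exact_mod_cast h2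
      have : (1 : ℤ) ≤ k' := by exact_mod_cast h1'
      linarith
  rw [hq0, mul_zero, sub_eq_zero] at hq
  exact_mod_cast hq

omit [NeZero M] in
/-- For `i ≥ 1`, an odd integer has an odd residue modulo `2ⁱ`, which lies in `kSet i`; for `i = 0`
take `1`. [folklore] -/
theorem exists_mem_kSet_dvd_sub (i : ℕ) (s : ℤ) (hs : i ≠ 0 → Odd s) :
    ∃ k ∈ kSet i, ((2 ^ i : ℕ) : ℤ) ∣ s - k := by
  rcases Nat.eq_zero_or_pos i with rfl | hi
  · exact ⟨1, by simp [kSet], by simp⟩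
  have hso := hs hi.ne'
  set r : ℤ := s % ((2 ^ i : ℕ) : ℤ) with hr
  have h2i : (0 : ℤ) < ((2 ^ i : ℕ) : ℤ) := by positivity
  have hr0 : 0 ≤ r := Int.emod_nonneg _ h2i.ne'
  have hrlt : r < ((2 ^ i : ℕ) : ℤ) := Int.emod_lt_of_pos _ h2i
  have hdiv : ((2 ^ i : ℕ) : ℤ) ∣ s - r := ⟨s / ((2 ^ i : ℕ) : ℤ), by rw [hr, Int.emod_def]; ring⟩
  have hro : Odd r := by
    have he : Even (s - r) := by
      obtain ⟨c, hc⟩ := hdiv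
      refine ⟨2 ^ (i - 1) * c, ?_⟩
      rw [hc, ← two_mul, ← mul_assoc]
      congr 1
      push_cast
      rw [← pow_succ', Nat.sub_add_cancel hi]
    have : r = s - (s - r) := by ring
    rw [this]
    exact hso.sub_even he
  obtain ⟨w, hw⟩ := hro
  have hw0 : 0 ≤ w := by omega
  refine ⟨(2 * w + 1).toNat, ?_, ?_⟩
  · rw [mem_kSet]
    refine ⟨w.toNat, ?_, ?_⟩
    · have : 2 * w + 1 < ((2 ^ i : ℕ) : ℤ) := hw ▸ hrlt
      push_cast at this
      have h2 : (2 : ℤ) ^ i = 2 * 2 ^ (i - 1) := by rw [← pow_succ', Nat.sub_add_cancel hi]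
      have : ((w.toNat : ℕ) : ℤ) < 2 ^ (i - 1) := by rw [Int.toNat_of_nonneg hw0]; linarith
      have h3 : (2 ^ i + 1) / 2 = 2 ^ (i - 1) := by
        conv_lhs => rw [show i = (i - 1) + 1 by omega, pow_succ]
        omega
      rw [h3]
      exact_mod_cast this
    · zify
      rw [Int.toNat_of_nonneg hw0, Int.toNat_of_nonneg (by omega)]
  · rw [Int.toNat_of_nonneg (by omega), ← hw]
    exact hdiv

omit [NeZero M] in
/-- An upper triangular element of `SL₂(ℤ)` is `±T^n`. [folklore] -/
theorem exists_eq_T_zpow_of_apply_10 (p : SL(2, ℤ)) (hp : p 1 0 = 0) :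
    ∃ n : ℤ, p = ModularGroup.T ^ n ∨ p = -ModularGroup.T ^ n := by
  have hdet := det_entries p
  rw [hp, mul_zero, sub_zero] at hdet
  rcases Int.eq_one_or_neg_one_of_mul_eq_one' hdet with ⟨h00, h11⟩ | ⟨h00, h11⟩
  · refine ⟨p 0 1, Or.inl ?_⟩
    ext i j
    rw [ModularGroup.coe_T_zpow]
    fin_cases i <;> fin_cases j <;> simp [h00, h11, hp]
  · refine ⟨-(p 0 1), Or.inr ?_⟩
    ext i j
    rw [Matrix.SpecialLinearGroup.coe_neg, ModularGroup.coe_T_zpow]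
    fin_cases i <;> fin_cases j <;> simp [h00, h11, hp]

omit [NeZero M] in
/-- The `(1,0)` entry of `Tⁿ` is `0`. [folklore] -/
theorem T_zpow_apply_10 (n : ℤ) : (ModularGroup.T ^ n) 1 0 = 0 := by
  rw [ModularGroup.coe_T_zpow]; simp

/-- **The width of the cusp of type `(m, j, ·)`**: `cuspRep Tⁿ cuspRep⁻¹ ∈ Γ₀(N) ⟺ width ∣ n`. [folklore] -/
theorem rep_T_zpow_rep_inv_mem_iff (hMo : Odd M) (hMs : Squarefree M) {m j k : ℕ} (hm : m ∣ M)
    (hj : j ≤ t) (hk : Odd k) (n : ℤ) :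
    cuspRep t M m j k * ModularGroup.T ^ n * (cuspRep t M m j k)⁻¹ ∈ Gamma0 (2 ^ t * M) ↔
      ((cuspRepWidth t M m j : ℕ) : ℤ) ∣ n := by
  by_cases htj : t ≤ 2 * j
  · exact rep_T_zpow_rep_inv_mem_iff_of_le hMo hMs k hm hj htj n
  · exact rep_T_zpow_rep_inv_mem_iff_of_lt hMo hMs hm (by omega) hk n

/-- The width `cuspRepWidth` is positive. [folklore] -/
theorem width_pos (hMo : Odd M) (hMs : Squarefree M) {m : ℕ} (j : ℕ) (hm : m ∣ M) : 0 < cuspRepWidth t M m j := by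
  obtain ⟨-, -, hQo, -⟩ := type_arith t hMo hMs hm
  have hQ0 : 0 < M / m := Nat.pos_of_ne_zero fun h ↦ by simp [h] at hQo
  unfold cuspRepWidth; split_ifs <;> positivity

/-- **Different types have different cusps**: the invariant `(d, u)` of `cuspRep(m, j, k) ∞` determines
`(m, j, k)` (`d = 2ʲm`, `u ≡ ±k`). [folklore] -/
theorem type_eq_of_cuspInv_eq (hMo : Odd M) (hMs : Squarefree M) {m j k m' j' k' : ℕ}
    (hm : m ∣ M) (hj : j ≤ t) (hk : k ∈ kSet (min j (t - j)))
    (hm' : m' ∣ M) (hj' : j' ≤ t) (hk' : k' ∈ kSet (min j' (t - j')))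
    (h : cuspInv (2 ^ t * M) (cuspRep t M m j k) = cuspInv (2 ^ t * M) (cuspRep t M m' j' k')) :
    m = m' ∧ j = j' ∧ k = k' := by
  have hko := odd_of_mem_kSet hk
  have hko' := odd_of_mem_kSet hk'
  rw [cuspInv, cuspInv, CuspIndex.mk_eq_mk_iff] at h
  obtain ⟨hd, hu⟩ := h
  have hu' := (ZMod.intCast_eq_intCast_iff_dvd_sub _ _ _).mp hu
  rw [cuspDivisor_rep hMo hMs hm hj hko, cuspDivisor_rep hMo hMs hm' hj' hko'] at hd
  rw [cuspDivisor_rep hMo hMs hm hj hko, (gcd_type hMo hMs hm hj).1] at hu'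
  obtain ⟨-, hmo, -⟩ := type_arith t hMo hMs hm
  obtain ⟨-, hmo', -⟩ := type_arith t hMo hMs hm'
  obtain ⟨rfl, rfl⟩ := two_pow_mul_odd_inj hmo hmo' hd
  refine ⟨rfl, rfl, ?_⟩
  obtain ⟨-, -, -, hmin⟩ := gcd_type hMo hMs hm hj
  by_cases htj : t ≤ 2 * j
  · have h1 := cuspUnitInt_rep_of_le hMo hMs hm hj htj hko
    have h2 := cuspUnitInt_rep_of_le hMo hMs hm hj htj hko'
    have hmin' : min j (t - j) = t - j := min_eq_right (by omega)
    rw [hmin'] at hk hk' hmin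
    refine eq_of_mem_kSet_of_dvd_sub hk hk' ((Int.natCast_dvd_natCast.mpr hmin).trans ?_)
    have := (h2.sub h1).sub hu'
    convert this using 1; ring
  · have htj2 : 2 * j < t := by omega
    have h1 := cuspUnitInt_rep_of_lt hMo hMs hm htj2 hko
    have h2 := cuspUnitInt_rep_of_lt hMo hMs hm htj2 hko'
    have hmin' : min j (t - j) = j := min_eq_left (by omega)
    rw [hmin'] at hk hk' hmin
    refine eq_of_mem_kSet_of_dvd_sub hk hk' ((Int.natCast_dvd_natCast.mpr hmin).trans ?_)
    have := (h1.sub h2).add hu'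
    convert this using 1; ring

/-- **Every cusp has a type**: for every `g ∈ SL₂(ℤ)` there is a type `(m, j, k)` whose
representative defines the same cusp of `Γ₀(2ᵗM)` as `g`. [folklore] -/
theorem exists_type_cuspInv_eq (hMo : Odd M) (hMs : Squarefree M) (g : SL(2, ℤ)) :
    ∃ m j k : ℕ, m ∣ M ∧ j ≤ t ∧ k ∈ kSet (min j (t - j)) ∧
      cuspInv (2 ^ t * M) (cuspRep t M m j k) = cuspInv (2 ^ t * M) g := by
  obtain ⟨d, hd⟩ : ∃ d, d = cuspDivisor (2 ^ t * M) g := ⟨_, rfl⟩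
  have hdN : d ∣ 2 ^ t * M := hd ▸ cuspDivisor_dvd (2 ^ t * M) g
  have hd0 : d ≠ 0 := hd ▸ cuspDivisor_ne_zero (2 ^ t * M) g
  obtain ⟨j, m, hmo, hdjm⟩ := Nat.exists_eq_two_pow_mul_odd hd0
  have hmM : m ∣ M := by
    have h1 : m ∣ 2 ^ t * M := (Dvd.intro_left _ hdjm.symm).trans hdN
    exact (Nat.Coprime.pow_right t (Nat.coprime_two_right.mpr hmo)).dvd_of_dvd_mul_left h1
  have hjt : j ≤ t := by
    have h1 : 2 ^ j ∣ 2 ^ t * M := (Dvd.intro _ hdjm.symm).trans hdN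
    have h2 : 2 ^ j ∣ 2 ^ t :=
      (Nat.Coprime.pow_left j (Nat.coprime_two_left.mpr hMo)).dvd_of_dvd_mul_right h1
    exact (Nat.pow_dvd_pow_iff_le_right one_lt_two).mp h2
  obtain ⟨he1, he2, he3, hmin⟩ := gcd_type hMo hMs hmM hjt
  obtain ⟨e, he⟩ : ∃ e, e = Nat.gcd (2 ^ j * m) (2 ^ (t - j) * (M / m)) := ⟨_, rfl⟩
  rw [← he] at he2 he3 hmin
  -- the unit invariant `u₀` of `g` is prime to `e`, hence odd as soon as `e` is even
  obtain ⟨u₀, hu₀⟩ : ∃ u, u = cuspUnitInt (2 ^ t * M) g := ⟨_, rfl⟩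
  have hcop : IsCoprime u₀ (e : ℤ) := by
    have := isCoprime_cuspUnitInt (2 ^ t * M) g
    rwa [← hd, hdjm, he1, ← he, ← hu₀] at this
  have hodd : min j (t - j) ≠ 0 → Odd u₀ := by
    intro hi
    have h2e : (2 : ℤ) ∣ e := by
      refine Int.natCast_dvd_natCast.mpr ((dvd_pow_self 2 hi).trans hmin)
    have h2u : IsCoprime (2 : ℤ) u₀ := (hcop.of_isCoprime_of_dvd_right h2e).symm
    rcases Int.even_or_odd u₀ with hu | hu
    · exfalso
      obtain ⟨c, hc⟩ := hu
      have : (2 : ℤ) ∣ 1 :=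
        h2u.dvd_of_dvd_mul_left (show (2 : ℤ) ∣ u₀ * 1 from ⟨c, by rw [hc]; ring⟩)
      omega
    · exact hu
  by_cases htj : t ≤ 2 * j
  · -- family 1: `k ≡ u₀ (mod 2^{t-j})`
    have hmin' : min j (t - j) = t - j := min_eq_right (by omega)
    obtain ⟨k, hk, hdvd⟩ := exists_mem_kSet_dvd_sub (t - j) u₀ (fun hi ↦ hodd (by rwa [hmin']))
    refine ⟨m, j, k, hmM, hjt, by rwa [hmin'], ?_⟩
    have hko := odd_of_mem_kSet hk
    rw [cuspInv, cuspInv, CuspIndex.mk_eq_mk_iff]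
    have hdr : cuspDivisor (2 ^ t * M) (cuspRep t M m j k) = cuspDivisor (2 ^ t * M) g := by
      rw [← hd, hdjm]; exact cuspDivisor_rep hMo hMs hmM hjt hko
    refine ⟨hdr, ?_⟩
    rw [ZMod.intCast_eq_intCast_iff_dvd_sub, hdr, ← hd, hdjm, he1, ← he, ← hu₀]
    have h1 := cuspUnitInt_rep_of_le hMo hMs hmM hjt htj hko
    rw [← he] at h1
    have h2 : (e : ℤ) ∣ u₀ - k := (Int.natCast_dvd_natCast.mpr he2).trans hdvd
    rw [show u₀ - cuspUnitInt (2 ^ t * M) (cuspRep t M m j k) =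
      (u₀ - k) - (cuspUnitInt (2 ^ t * M) (cuspRep t M m j k) - k) by ring]
    exact h2.sub h1
  · -- family 2: `k ≡ -u₀ (mod 2^j)`
    have htj2 : 2 * j < t := by omega
    have hmin' : min j (t - j) = j := min_eq_left (by omega)
    obtain ⟨k, hk, hdvd⟩ := exists_mem_kSet_dvd_sub j (-u₀) (fun hi ↦ (hodd (by rwa [hmin'])).neg)
    refine ⟨m, j, k, hmM, hjt, by rwa [hmin'], ?_⟩
    have hko := odd_of_mem_kSet hk
    rw [cuspInv, cuspInv, CuspIndex.mk_eq_mk_iff]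
    have hdr : cuspDivisor (2 ^ t * M) (cuspRep t M m j k) = cuspDivisor (2 ^ t * M) g := by
      rw [← hd, hdjm]; exact cuspDivisor_rep hMo hMs hmM hjt hko
    refine ⟨hdr, ?_⟩
    rw [ZMod.intCast_eq_intCast_iff_dvd_sub, hdr, ← hd, hdjm, he1, ← he, ← hu₀]
    have h1 := cuspUnitInt_rep_of_lt hMo hMs hmM htj2 hko
    rw [← he] at h1
    have h2 : (e : ℤ) ∣ -u₀ - k := (Int.natCast_dvd_natCast.mpr he3).trans hdvd
    rw [show u₀ - cuspUnitInt (2 ^ t * M) (cuspRep t M m j k) =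
      -(-u₀ - k + (cuspUnitInt (2 ^ t * M) (cuspRep t M m j k) + k)) by ring]
    exact dvd_neg.mpr (h2.add h1)

variable (t M) in
/-- The index set of the coset system: types `(m, j, k)` and `0 ≤ l < width`. [folklore] -/
def typeIndex : Finset (Σ _ : ℕ, Σ _ : ℕ, Σ _ : ℕ, ℕ) :=
  M.divisors.sigma fun m ↦ (Finset.range (t + 1)).sigma fun j ↦
    (kSet (min j (t - j))).sigma fun _ ↦ Finset.range (cuspRepWidth t M m j)

variable (t M) in
/-- The coset `(cuspRep(m,j,k) T^l)⁻¹ Γ₀(2ᵗM)` attached to an index. [folklore] -/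
def typeCoset (x : Σ _ : ℕ, Σ _ : ℕ, Σ _ : ℕ, ℕ) : SL(2, ℤ) ⧸ Gamma0 (2 ^ t * M) :=
  QuotientGroup.mk ((cuspRep t M x.1 x.2.1 x.2.2.1 * ModularGroup.T ^ (x.2.2.2 : ℤ))⁻¹)

omit [NeZero M] in
/-- Membership in the index set `typeIndex` of the coset system. [folklore] -/
theorem mem_typeIndex {x : Σ _ : ℕ, Σ _ : ℕ, Σ _ : ℕ, ℕ} :
    x ∈ typeIndex t M ↔ (x.1 ∣ M ∧ M ≠ 0) ∧ x.2.1 < t + 1 ∧ x.2.2.1 ∈ kSet (min x.2.1 (t - x.2.1)) ∧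
      x.2.2.2 < cuspRepWidth t M x.1 x.2.1 := by
  obtain ⟨m, j, k, l⟩ := x
  simp [typeIndex, and_assoc]

/-- **The cosets attached to distinct indices are distinct.** [folklore] -/
theorem typeCoset_injOn (hMo : Odd M) (hMs : Squarefree M) :
    Set.InjOn (typeCoset t M) (typeIndex t M : Set (Σ _ : ℕ, Σ _ : ℕ, Σ _ : ℕ, ℕ)) := by
  rintro ⟨m, j, k, l⟩ hx ⟨m', j', k', l'⟩ hx' hxx'
  rw [Finset.mem_coe, mem_typeIndex] at hx hx'
  obtain ⟨⟨hm, -⟩, hj, hk, hl⟩ := hx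
  obtain ⟨⟨hm', -⟩, hj', hk', hl'⟩ := hx'
  dsimp only at hm hj hk hl hm' hj' hk' hl' hxx'
  have hjt : j ≤ t := by omega
  have hjt' : j' ≤ t := by omega
  rw [typeCoset, typeCoset, QuotientGroup.eq, inv_inv] at hxx'
  dsimp only at hxx'
  set γ := cuspRep t M m j k * ModularGroup.T ^ (l : ℤ) * (cuspRep t M m' j' k' * ModularGroup.T ^ (l' : ℤ))⁻¹
    with hγdef
  have h1 : γ * cuspRep t M m' j' k' = cuspRep t M m j k * ModularGroup.T ^ ((l : ℤ) - l') := by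
    rw [hγdef]; group
  have hinv : cuspInv (2 ^ t * M) (cuspRep t M m j k) = cuspInv (2 ^ t * M) (cuspRep t M m' j' k') := by
    rw [← cuspInv_mul_left (2 ^ t * M) hxx' (cuspRep t M m' j' k'), h1,
      cuspInv_mul_right (2 ^ t * M) _ (T_zpow_apply_10 _)]
  obtain ⟨rfl, rfl, rfl⟩ := type_eq_of_cuspInv_eq hMo hMs hm hjt hk hm' hjt' hk' hinv
  have hmem : cuspRep t M m j k * ModularGroup.T ^ ((l : ℤ) - l') * (cuspRep t M m j k)⁻¹ ∈ Gamma0 (2 ^ t * M) := by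
    rw [← h1, mul_inv_cancel_right]; exact hxx'
  have hw := (rep_T_zpow_rep_inv_mem_iff hMo hMs hm hjt (odd_of_mem_kSet hk) _).mp hmem
  have h0 : (l : ℤ) - l' = 0 := Int.eq_zero_of_dvd_of_natAbs_lt_natAbs hw (by omega)
  obtain rfl : l = l' := by omega
  rfl

/-- **Every coset is attached to an index**: `SL₂(ℤ) = ⋃ Γ₀(2ᵗM)·(cuspRep T^l)⁻¹…`, i.e. the types
enumerate the cusps of `Γ₀(2ᵗM)` and `l` the cosets at each cusp (separation of cusps with equal
invariants, Diamond–Shurman Prop. 3.8.3, and reduction of `l` modulo the width). [folklore] -/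
theorem image_typeCoset_eq_univ (hMo : Odd M) (hMs : Squarefree M)
    [Fintype (SL(2, ℤ) ⧸ Gamma0 (2 ^ t * M))] [DecidableEq (SL(2, ℤ) ⧸ Gamma0 (2 ^ t * M))] :
    (typeIndex t M).image (typeCoset t M) = Finset.univ := by
  refine Finset.eq_univ_iff_forall.mpr fun x ↦ ?_
  rw [Finset.mem_image]
  obtain ⟨B, rfl⟩ := QuotientGroup.mk_surjective x
  obtain ⟨m, j, k, hm, hj, hk, hinv⟩ := exists_type_cuspInv_eq (t := t) hMo hMs B⁻¹
  obtain ⟨γ, hγ, hp⟩ := exists_mem_gamma0_of_cuspInv_eq (2 ^ t * M) hinv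
  obtain ⟨n, hn⟩ := exists_eq_T_zpow_of_apply_10 _ hp
  set w : ℕ := cuspRepWidth t M m j with hw
  have hw0 : 0 < w := width_pos hMo hMs j hm
  have hw0' : (0 : ℤ) < w := by exact_mod_cast hw0
  set l : ℕ := (n % (w : ℤ)).toNat with hl
  have hl0 : 0 ≤ n % (w : ℤ) := Int.emod_nonneg _ hw0'.ne'
  have hlw : (l : ℤ) = n % (w : ℤ) := by rw [hl, Int.toNat_of_nonneg hl0]
  have hlt : l < w := by
    have := Int.emod_lt_of_pos n hw0'
    omega
  refine ⟨⟨m, j, k, l⟩, ?_, ?_⟩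
  · rw [mem_typeIndex]
    exact ⟨⟨hm, NeZero.ne M⟩, Nat.lt_succ_of_le hj, hk, hlt⟩
  · rw [typeCoset, QuotientGroup.eq, inv_inv]
    dsimp only
    -- `cuspRep T^l B = ±(cuspRep T^{l-n} cuspRep⁻¹) γ`
    have hconj : cuspRep t M m j k * ModularGroup.T ^ ((l : ℤ) - n) * (cuspRep t M m j k)⁻¹ ∈ Gamma0 (2 ^ t * M) := by
      refine (rep_T_zpow_rep_inv_mem_iff hMo hMs hm hj (odd_of_mem_kSet hk) _).mpr ?_
      refine ⟨-(n / (w : ℤ)), ?_⟩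
      rw [hlw, Int.emod_def]; ring
    rcases hn with hn | hn
    · have hB : B = (γ⁻¹ * cuspRep t M m j k * ModularGroup.T ^ n)⁻¹ := by
        rw [← hn]; group
      have key : cuspRep t M m j k * ModularGroup.T ^ (l : ℤ) * B =
          (cuspRep t M m j k * ModularGroup.T ^ ((l : ℤ) - n) * (cuspRep t M m j k)⁻¹) * γ := by
        rw [hB]; group
      rw [key]
      exact Subgroup.mul_mem _ hconj hγ
    · have hB : B = -(γ⁻¹ * cuspRep t M m j k * ModularGroup.T ^ n)⁻¹ := by
        have h1 : B⁻¹ = γ⁻¹ * cuspRep t M m j k * ((cuspRep t M m j k)⁻¹ * γ * B⁻¹) := by group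
        rw [hn, mul_neg] at h1
        rw [neg_inv, ← h1, inv_inv]
      have key : cuspRep t M m j k * ModularGroup.T ^ (l : ℤ) * B =
          -((cuspRep t M m j k * ModularGroup.T ^ ((l : ℤ) - n) * (cuspRep t M m j k)⁻¹) * γ) := by
        rw [hB, mul_neg]
        congr 1
        group
      rw [key]
      -- `Γ₀(N)` contains `−1`
      have hmem : (cuspRep t M m j k * ModularGroup.T ^ ((l : ℤ) - n) * (cuspRep t M m j k)⁻¹) * γ ∈
          Gamma0 (2 ^ t * M) := Subgroup.mul_mem _ hconj hγ
      rw [Gamma0_mem] at hmem ⊢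
      rw [Matrix.SpecialLinearGroup.coe_neg, Matrix.neg_apply, Int.cast_neg, hmem, neg_zero]

/-- **The coset decomposition of a sum over `SL₂(ℤ)/Γ₀(2ᵗM)`**: for any `F`,
`Σ_{SL₂(ℤ)/Γ₀(N)} F = Σ_{m ∣ M} Σ_{j ≤ t} Σ_{k} Σ_{l < width} F((cuspRep T^l)⁻¹ Γ₀(N))`. [folklore] -/
theorem sum_quotient_eq_sum_types (hMo : Odd M) (hMs : Squarefree M)
    [Fintype (SL(2, ℤ) ⧸ Gamma0 (2 ^ t * M))] {A : Type*} [AddCommMonoid A]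
    (F : SL(2, ℤ) ⧸ Gamma0 (2 ^ t * M) → A) :
    ∑ x, F x = ∑ m ∈ M.divisors, ∑ j ∈ Finset.range (t + 1), ∑ k ∈ kSet (min j (t - j)),
      ∑ l ∈ Finset.range (cuspRepWidth t M m j),
        F (QuotientGroup.mk ((cuspRep t M m j k * ModularGroup.T ^ (l : ℤ))⁻¹)) := by
  classical
  rw [← image_typeCoset_eq_univ hMo hMs, Finset.sum_image (typeCoset_injOn hMo hMs)]
  simp only [typeIndex, Finset.sum_sigma]
  rfl

end Cosets

/-! ### 8. The coefficients of the Rankin–Selberg trace at level `2ᵗM`, `t ≤ 3` -/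

section TraceCoefficients

variable {t M : ℕ} [NeZero M]

omit [NeZero M] in
/-- `cuspRepDil ∣ N = 2ᵗM` (for `m ∣ M`, `j ≤ t`). [folklore] -/
theorem dil_dvd {m : ℕ} (j : ℕ) (hm : m ∣ M) : cuspRepDil t m j ∣ 2 ^ t * M := by
  unfold cuspRepDil
  split_ifs with h
  · exact Nat.mul_dvd_mul_left _ hm
  · exact Nat.mul_dvd_mul (pow_dvd_pow 2 (by omega)) hm

/-- **The period-`N` coefficients on the cosets of type `(m, j, k)`** (`min(j, t−j) ≤ 1`):
`|cₙ(f ∣ cuspRep T^l)|² = 𝟙[D ∣ n] (D/N)² |a_{n/D}(f)|²`, `D = cuspRepDil`. [cite: AtkinLehner1970, Thm. 3] -/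
theorem norm_sq_coeff_slash_rep_mul_T_zpow (hMo : Odd M) (hMs : Squarefree M) {m j k : ℕ}
    (hm : m ∣ M) (hj : j ≤ t) (hsmall : min j (t - j) ≤ 1) (hk : Odd k)
    {f : CuspForm (Gamma0 (2 ^ t * M)) 2} (hf : IsNewform0 f) (l : ℤ) (n : ℕ) :
    ‖(qExpansion ((2 ^ t * M : ℕ) : ℝ)
        ((⇑f : ℍ → ℂ) ∣[(2 : ℤ)] (cuspRep t M m j k * ModularGroup.T ^ l))).coeff n‖ ^ 2 =
      if cuspRepDil t m j ∣ n then
        ((cuspRepDil t m j : ℝ) / (2 ^ t * M : ℕ)) ^ 2 * ‖cuspCoeff f (n / cuspRepDil t m j)‖ ^ 2 else 0 := by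
  rw [norm_qExpansion_coeff_slash_mul_T_zpow f _ l n]
  obtain ⟨K, hK, r, hFg⟩ := exists_slash_rep hMo hMs hm hj hsmall hk hf
  have hF : IsCuspFunction ((2 ^ t * M : ℕ) : ℝ) ((⇑f : ℍ → ℂ) ∣[(2 : ℤ)] cuspRep t M m j k) :=
    isCuspFunction_slash f _
  have hFg' : ∀ τ : ℍ, ((⇑f : ℍ → ℂ) ∣[(2 : ℤ)] cuspRep t M m j k) τ =
      K * f (UpperHalfPlane.mk (((cuspRepDil t m j : ℕ) : ℂ) / ((2 ^ t * M : ℕ) : ℕ) * τ + r)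
        (im_dilate_pos (dil_pos j (pos_of_dvd hm)) r τ)) := fun τ ↦ by
    rw [ModularForm.SL_slash]; exact hFg τ
  have h := norm_sq_qExpansion_coeff_of_eq_dilate f hF K (dil_pos j (pos_of_dvd hm)) (dil_dvd j hm) r
    hFg' n
  rw [hK] at h
  exact_mod_cast h

/-- **The coefficients of the Rankin–Selberg trace of a newform of level `2ᵗM`** (`M` odd
squarefree, `t ≤ 3`): `rsCoeff N 2 f n = Σ_{m ∣ M} Σ_{j ≤ t} #kSet · width · 𝟙[D ∣ n](D/N)²|a_{n/D}|²`
— the sum over the cusps (types `(m, j, k)`, each with `width` cosets) of the squared coefficients of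
the dilated expansions. For `t = 0` this is `IsNewform0.rsCoeff_eq_sum_divisors_of_squarefree`.
[cite: Rankin1939, §4; AtkinLehner1970, Thm. 3] -/
theorem _root_.Literature.NumberTheory.EllipticCurves.ModularForms.IsNewform0.rsCoeff_eq_of_two_pow_mul
    (hMo : Odd M) (hMs : Squarefree M) (ht : t ≤ 3) {f : CuspForm (Gamma0 (2 ^ t * M)) 2}
    (hf : IsNewform0 f) (n : ℕ) :
    rsCoeff (2 ^ t * M) 2 f n = ∑ m ∈ M.divisors, ∑ j ∈ Finset.range (t + 1),
      (((kSet (min j (t - j))).card * cuspRepWidth t M m j : ℕ) : ℝ) *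
        (if cuspRepDil t m j ∣ n then
          ((cuspRepDil t m j : ℝ) / (2 ^ t * M : ℕ)) ^ 2 * ‖cuspCoeff f (n / cuspRepDil t m j)‖ ^ 2 else 0) := by
  classical
  haveI : Fintype (SL(2, ℤ) ⧸ Gamma0 (2 ^ t * M)) := Fintype.ofFinite _
  rw [rsCoeff_eq_sum, sum_quotient_eq_sum_types hMo hMs]
  refine Finset.sum_congr rfl fun m hm ↦ Finset.sum_congr rfl fun j hj ↦ ?_
  have hmM : m ∣ M := Nat.dvd_of_mem_divisors hm
  have hjt : j ≤ t := by have := Finset.mem_range.mp hj; omega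
  have hsmall : min j (t - j) ≤ 1 := by
    rcases le_total j (t - j) with h | h
    · rw [min_eq_left h]; omega
    · rw [min_eq_right h]; omega
  -- every coset of type `(m, j, ·)` contributes the same
  have hval : ∀ k ∈ kSet (min j (t - j)), ∀ l ∈ Finset.range (cuspRepWidth t M m j),
      ‖(qExpansion ((2 ^ t * M : ℕ) : ℝ) ((⇑f : ℍ → ℂ) ∣[(2 : ℤ)]
        (Quotient.out (QuotientGroup.mk ((cuspRep t M m j k * ModularGroup.T ^ (l : ℤ))⁻¹) :
          SL(2, ℤ) ⧸ Gamma0 (2 ^ t * M)))⁻¹)).coeff n‖ ^ 2 =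
      if cuspRepDil t m j ∣ n then
        ((cuspRepDil t m j : ℝ) / (2 ^ t * M : ℕ)) ^ 2 * ‖cuspCoeff f (n / cuspRepDil t m j)‖ ^ 2 else 0 := by
    intro k hk l _
    obtain ⟨γ, hγ⟩ := QuotientGroup.mk_out_eq_mul (Gamma0 (2 ^ t * M))
      ((cuspRep t M m j k * ModularGroup.T ^ (l : ℤ))⁻¹)
    rw [hγ, mul_inv_rev, inv_inv, SlashAction.slash_mul, slash_eq_self_of_mem_Gamma0 f (inv_mem γ.2)]
    exact norm_sq_coeff_slash_rep_mul_T_zpow hMo hMs hmM hjt hsmall (odd_of_mem_kSet hk) hf _ n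
  rw [Finset.sum_congr rfl fun k hk ↦ Finset.sum_congr rfl fun l hl ↦ hval k hk l hl]
  simp only [Finset.sum_const, Finset.card_range, nsmul_eq_mul]
  push_cast
  ring

end TraceCoefficients

/-! ### 9. The trace Dirichlet series and the completed trace zeta function for a dilate-sum -/

section Dictionary

open MeasureTheory Set Filter

variable {N : ℕ} [NeZero N]

/-- `Σ |aₙ(f)|² n^{-w}` is `LSeries`-summable for `Re w > 2`. [cite: Rankin1939, §4] -/
theorem lseriesSummable_normSq' (f : CuspForm (Gamma0 N) 2) {w : ℂ} (hw : 2 < w.re) :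
    LSeriesSummable (fun n ↦ (((‖cuspCoeff f n‖ ^ 2 : ℝ)) : ℂ)) w := by
  rw [LSeriesSummable, ← summable_norm_iff]
  have h := summable_normSq_cuspCoeff_div_rpow f hw
  refine h.congr fun n ↦ ?_
  rw [LSeries.norm_term_eq]
  rcases eq_or_ne n 0 with rfl | hn
  · simp [Real.zero_rpow (by linarith : w.re ≠ 0)]
  · rw [if_neg hn, Complex.norm_real, Real.norm_of_nonneg (sq_nonneg _)]

/-- **The trace Dirichlet series of a dilate-sum.** If the coefficients of the Rankin–Selberg trace
of `f ∈ S₂(Γ₀(N))` have the shape `rsCoeff(n) = Σᵢ 𝟙[Dᵢ ∣ n] cᵢ |a_{n/Dᵢ}(f)|²` for a finite family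
`(cᵢ, Dᵢ)`, then for `Re w > 2`
`Σₙ rsCoeff(n) n^{-w} = (Σᵢ cᵢ Dᵢ^{-w}) · Σₙ |aₙ(f)|² n^{-w}` (reindex `n = Dᵢ m`). For squarefree `N`
this is `IsNewform0.LSeries_rsCoeff_eq_of_squarefree` (`cᵢ = c/N`, `Dᵢ = c ∣ N`). [cite: Rankin1939, §4] -/
theorem LSeries_rsCoeff_eq_of_sum_dilate {ι : Type*} (S : Finset ι) (c : ι → ℝ) (D : ι → ℕ)
    (hD : ∀ i ∈ S, 0 < D i) (f : CuspForm (Gamma0 N) 2)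
    (hrs : ∀ n, rsCoeff N 2 f n = ∑ i ∈ S, if D i ∣ n then c i * ‖cuspCoeff f (n / D i)‖ ^ 2 else 0)
    {w : ℂ} (hw : 2 < w.re) :
    LSeries (fun n ↦ ((rsCoeff N 2 f n : ℝ) : ℂ)) w =
      (∑ i ∈ S, (c i : ℂ) * (D i : ℂ) ^ (-w)) * LSeries (fun n ↦ (((‖cuspCoeff f n‖ ^ 2 : ℝ)) : ℂ)) w := by
  set a₂ : ℕ → ℂ := fun n ↦ (((‖cuspCoeff f n‖ ^ 2 : ℝ)) : ℂ) with ha₂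
  have hsum : HasSum (fun n ↦ LSeries.term a₂ w n) (LSeries a₂ w) :=
    (lseriesSummable_normSq' f hw).hasSum
  set L := LSeries a₂ w with hL
  -- each `i` contributes `cᵢ Dᵢ^{-w} L`
  have hc_term : ∀ i ∈ S, HasSum (fun n : ℕ ↦ LSeries.term
      (fun n ↦ (((if D i ∣ n then c i * ‖cuspCoeff f (n / D i)‖ ^ 2 else 0 : ℝ)) : ℂ)) w n)
        ((c i : ℂ) * (D i : ℂ) ^ (-w) * L) := by
    intro i hi
    have hc0 : 0 < D i := hD i hi
    have hcc : (D i : ℂ) ≠ 0 := by exact_mod_cast hc0.ne'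
    have hcw : (D i : ℂ) ^ w ≠ 0 := by
      rw [Ne, Complex.cpow_eq_zero_iff]; exact fun h ↦ hcc h.1
    -- reindex `n = Dᵢ m`
    have hg : (fun m : ℕ ↦ (c i : ℂ) * (D i : ℂ) ^ (-w) * LSeries.term a₂ w m) =
        fun m : ℕ ↦ (fun n : ℕ ↦ LSeries.term
          (fun n ↦ (((if D i ∣ n then c i * ‖cuspCoeff f (n / D i)‖ ^ 2 else 0 : ℝ)) : ℂ)) w n)
            (D i * m) := by
      funext m
      rcases eq_or_ne m 0 with rfl | hm
      · simp [LSeries.term_zero]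
      · have hcm : D i * m ≠ 0 := mul_ne_zero hc0.ne' hm
        beta_reduce
        rw [LSeries.term_of_ne_zero hm, LSeries.term_of_ne_zero hcm]
        simp only [Nat.dvd_mul_right, if_true, Nat.mul_div_cancel_left _ hc0, ha₂]
        push_cast
        rw [Complex.natCast_mul_natCast_cpow, Complex.cpow_neg]
        field_simp
    have h1 : HasSum (fun m : ℕ ↦ (c i : ℂ) * (D i : ℂ) ^ (-w) * LSeries.term a₂ w m)
        ((c i : ℂ) * (D i : ℂ) ^ (-w) * L) := hsum.mul_left _
    rw [hg] at h1
    have hinj : Function.Injective (fun m : ℕ ↦ D i * m) := mul_right_injective₀ hc0.ne'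
    have hsupp : ∀ n ∉ Set.range (fun m : ℕ ↦ D i * m), LSeries.term
        (fun n ↦ (((if D i ∣ n then c i * ‖cuspCoeff f (n / D i)‖ ^ 2 else 0 : ℝ)) : ℂ)) w n = 0 := by
      intro n hn
      by_cases hcn : D i ∣ n
      · obtain ⟨m, rfl⟩ := hcn; exact absurd ⟨m, rfl⟩ hn
      · rcases eq_or_ne n 0 with rfl | hn0
        · exact LSeries.term_zero _ _
        · rw [LSeries.term_of_ne_zero hn0, if_neg hcn]; simp
    exact (hinj.hasSum_iff hsupp).mp h1
  -- sum over the family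
  have htot : HasSum (fun n ↦ LSeries.term (fun n ↦ ((rsCoeff N 2 f n : ℝ) : ℂ)) w n)
      (∑ i ∈ S, (c i : ℂ) * (D i : ℂ) ^ (-w) * L) := by
    have h := hasSum_sum hc_term
    refine h.congr_fun fun n ↦ ?_
    rcases eq_or_ne n 0 with rfl | hn
    · simp [LSeries.term_zero]
    · rw [LSeries.term_of_ne_zero hn, hrs n]
      push_cast
      rw [Finset.sum_div]
      refine Finset.sum_congr rfl fun i _ ↦ ?_
      rw [LSeries.term_of_ne_zero hn]
  rw [LSeries, htot.tsum_eq, Finset.sum_mul]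

/-- **The completed trace zeta function of a dilate-sum on `Re s > 1`**: under the hypothesis of
`LSeries_rsCoeff_eq_of_sum_dilate`,
`s(s−1) ∫_𝒟 G_f E₀*(·,s) dμ + ½∫_𝒟 G_f dμ
 = s(s−1) π^{-s}Γ(s)ζ(2s) Γ(s+1)(4π/N)^{-(s+1)} · (Σᵢ cᵢ Dᵢ^{-(s+1)}) · Σₙ |aₙ(f)|² n^{-(s+1)}`
(the Rankin–Selberg unfolding `J₀_eq_of_one_lt_re` for the trace datum). [cite: Rankin1939, §4.4] -/
theorem traceZeta_eq_of_sum_dilate {ι : Type*} (S : Finset ι) (c : ι → ℝ) (D : ι → ℕ)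
    (hD : ∀ i ∈ S, 0 < D i) (f : CuspForm (Gamma0 N) 2)
    (hrs : ∀ n, rsCoeff N 2 f n = ∑ i ∈ S, if D i ∣ n then c i * ‖cuspCoeff f (n / D i)‖ ^ 2 else 0)
    {s : ℂ} (hs : 1 < s.re) :
    s * (s - 1) * (∫ w in ModularGroup.fd, (rsTrace N 2 f w : ℂ) * completedEisenstein₀ w s) +
        (((∫ w in ModularGroup.fd, rsTrace N 2 f w : ℝ)) : ℂ) / 2 =
      s * (s - 1) * ((Real.pi : ℂ) ^ (-s) * Complex.Gamma s * riemannZeta (2 * s) *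
          (Complex.Gamma (s + 1) * (((4 * Real.pi / N : ℝ)) : ℂ) ^ (-(s + 1)))) *
        ((∑ i ∈ S, (c i : ℂ) * (D i : ℂ) ^ (-(s + 1))) *
          LSeries (fun n ↦ (((‖cuspCoeff f n‖ ^ 2 : ℝ)) : ℂ)) (s + 1)) := by
  have hGc : Continuous (rsTrace N 2 f) := continuous_rsTrace (ModularFormClass.continuous f)
  have hGinv : ∀ (A : SL(2, ℤ)) (τ : ℍ), rsTrace N 2 f (A • τ) = rsTrace N 2 f τ :=
    fun A τ ↦ rsTrace_smul f A τ
  have hG0 : ∀ τ, 0 ≤ rsTrace N 2 f τ := fun τ ↦ rsTrace_nonneg _ τ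
  obtain ⟨B, -, hB⟩ := exists_rsTrace_le f
  have hC : ∀ n, 0 ≤ rsCoeff N 2 f n := fun n ↦ rsCoeff_nonneg _ n
  have hC0 : rsCoeff N 2 f 0 = 0 := rsCoeff_zero f
  set a : ℝ := 4 * Real.pi / N with hadef
  have ha : 0 < a := by
    have hN0 : (0 : ℝ) < N := Nat.cast_pos.mpr (NeZero.pos N)
    positivity
  have hexp : ∀ (n : ℕ) (y : ℝ), Real.exp (-a * n * y) = Real.exp (-(4 * Real.pi * n / N) * y) := by
    intro n y; congr 1; rw [hadef]; ring
  have hsum : ∀ y : ℝ, 0 < y → Summable fun n : ℕ ↦ rsCoeff N 2 f n * Real.exp (-a * n * y) := by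
    intro y hy; simp_rw [hexp]; exact summable_rsCoeff_mul_exp f hy
  have hle : ∀ y : ℝ, 0 < y → ∑' n : ℕ, rsCoeff N 2 f n * Real.exp (-a * n * y) ≤ B * y ^ (-(2 : ℝ)) := by
    intro y hy
    simp_rw [hexp]
    have h := tsum_rsCoeff_mul_exp_le f hB hy
    rwa [Real.rpow_neg hy.le, Real.rpow_two, ← zpow_ofNat, ← div_eq_mul_inv]
  have hm : ∀ y : ℝ, 0 < y → ∫ x in (0 : ℝ)..1, rsTrace N 2 f (pt x y) =
      y ^ (2 : ℝ) * ∑' n : ℕ, rsCoeff N 2 f n * Real.exp (-a * n * y) := by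
    intro y hy
    simp_rw [hexp]
    have hpt : ∀ x : ℝ, pt x y = ofComplex ((x : ℂ) + y * Complex.I) := by
      intro x; rw [pt, Complex.mk_eq_add_mul_I]
    simp_rw [hpt]
    rw [intervalIntegral_rsTrace_horizontal f hy, Real.rpow_two, ← zpow_ofNat]
  have hκ : (0 : ℝ) ≤ 2 := by norm_num
  have hJ := J₀_eq_of_one_lt_re hGc hGinv hG0 hB hC hC0 ha hκ hsum hle hm hs
  have e : s + ((2 : ℝ) : ℂ) - 1 = s + 1 := by push_cast; ring
  rw [e, integral_complex_ofReal] at hJ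
  have hs0 : s ≠ 0 := fun h ↦ by rw [h, Complex.zero_re] at hs; linarith
  have hs1 : (1 : ℂ) - s ≠ 0 := by
    intro h
    have : s = 1 := by linear_combination -h
    rw [this, Complex.one_re] at hs
    exact lt_irrefl _ hs
  set V : ℝ := ∫ w in ModularGroup.fd, rsTrace N 2 f w with hV
  set P : ℂ := (Real.pi : ℂ) ^ (-s) * Complex.Gamma s * riemannZeta (2 * s) with hP
  set Dser : ℂ := LSeries (fun n ↦ ((rsCoeff N 2 f n : ℝ) : ℂ)) (s + 1) with hDser
  have hscal : s * (s - 1) * (1 / (2 * s) + 1 / (2 * (1 - s))) + 1 / 2 = 0 := by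
    field_simp
    ring
  calc s * (s - 1) * (∫ w in ModularGroup.fd, (rsTrace N 2 f w : ℂ) * completedEisenstein₀ w s) + (V : ℂ) / 2
      = s * (s - 1) * (P * (Complex.Gamma (s + 1) * (a : ℂ) ^ (-(s + 1)) * Dser)) +
          (s * (s - 1) * (1 / (2 * s) + 1 / (2 * (1 - s))) + 1 / 2) * (V : ℂ) := by
        rw [hJ]; ring
    _ = s * (s - 1) * (P * (Complex.Gamma (s + 1) * (a : ℂ) ^ (-(s + 1)) * Dser)) := by
        rw [hscal, zero_mul, add_zero]
    _ = _ := by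
        rw [hDser, LSeries_rsCoeff_eq_of_sum_dilate S c D hD f hrs (by simp; linarith : 2 < (s + 1).re)]
        ring

end Dictionary

/-! ### 10. The elementary factor at level `2ᵗM` -/

section Factor

variable {t M : ℕ} [NeZero M]

variable (t M) in
/-- The family `(m, j)`, `m ∣ M`, `j ≤ t`. [folklore] -/
def tpS : Finset (ℕ × ℕ) := M.divisors ×ˢ Finset.range (t + 1)

variable (t M) in
/-- The coefficient `#kSet · width · (D/N)²` of the type `(m, j)`. [folklore] -/
def tpC (x : ℕ × ℕ) : ℝ :=
  (((kSet (min x.2 (t - x.2))).card * cuspRepWidth t M x.1 x.2 : ℕ) : ℝ) *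
    ((cuspRepDil t x.1 x.2 : ℝ) / (2 ^ t * M : ℕ)) ^ 2

variable (t) in
/-- The dilation of the type `(m, j)`. [folklore] -/
def dilP (x : ℕ × ℕ) : ℕ := cuspRepDil t x.1 x.2

omit [NeZero M] in
/-- The dilations `dilP` of the family `tpS` are positive. [folklore] -/
theorem dilP_pos {x : ℕ × ℕ} (hx : x ∈ tpS t M) : 0 < dilP t x := by
  obtain ⟨m, j⟩ := x
  rw [tpS, Finset.mem_product, Nat.mem_divisors] at hx
  exact dil_pos j (Nat.pos_of_dvd_of_pos hx.1.1 (Nat.pos_of_ne_zero hx.1.2))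

/-- The coefficients of the trace in the dilate-sum shape of `LSeries_rsCoeff_eq_of_sum_dilate`.
[cite: Rankin1939, §4] -/
theorem _root_.Literature.NumberTheory.EllipticCurves.ModularForms.IsNewform0.rsCoeff_eq_sum_tpS
    (hMo : Odd M) (hMs : Squarefree M) (ht : t ≤ 3) {f : CuspForm (Gamma0 (2 ^ t * M)) 2}
    (hf : IsNewform0 f) (n : ℕ) :
    rsCoeff (2 ^ t * M) 2 f n =
      ∑ x ∈ tpS t M, if dilP t x ∣ n then tpC t M x * ‖cuspCoeff f (n / dilP t x)‖ ^ 2 else 0 := by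
  rw [hf.rsCoeff_eq_of_two_pow_mul hMo hMs ht n, tpS, Finset.sum_product]
  refine Finset.sum_congr rfl fun m _ ↦ Finset.sum_congr rfl fun j _ ↦ ?_
  simp only [tpC, dilP]
  split_ifs
  · ring
  · rw [mul_zero]

variable (t) in
/-- The `2`-adic elementary factor `A_t(s) = Σ_{j ≤ t} #kSet(min(j,t−j)) · P_j^{-s}`,
`P_j = 2ᵗ` (`2j ≥ t`) or `2^{2j}` (`2j < t`); `A₃(s) = 1 + 2^{-2s} + 2·2^{-3s}`. [folklore] -/
def twoFactor (s : ℂ) : ℂ :=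
  ∑ j ∈ Finset.range (t + 1), ((kSet (min j (t - j))).card : ℂ) *
    (if t ≤ 2 * j then ((2 ^ t : ℕ) : ℂ) ^ (-s) else ((2 ^ (2 * j) : ℕ) : ℂ) ^ (-s))

/-- **The elementary factor at level `2ᵗM` factors**:
`Σ_{(m,j)} c_{m,j} D_{m,j}^{-(s+1)} = N⁻¹ · A_t(s) · Σ_{m ∣ M} m^{-s}` — the odd part is the same
divisor sum as for squarefree levels, completing the Euler factors at `p ∣ M`. [folklore] -/
theorem sum_tpC_mul_cpow_eq (hMo : Odd M) (hMs : Squarefree M) (s : ℂ) :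
    ∑ x ∈ tpS t M, (tpC t M x : ℂ) * (dilP t x : ℂ) ^ (-(s + 1)) =
      ((2 ^ t * M : ℕ) : ℂ)⁻¹ * twoFactor t s * ∑ m ∈ M.divisors, (m : ℂ) ^ (-s) := by
  rw [tpS, Finset.sum_product, Finset.sum_comm]
  have hR : ((2 ^ t * M : ℕ) : ℂ)⁻¹ * twoFactor t s * ∑ m ∈ M.divisors, (m : ℂ) ^ (-s) =
      ∑ j ∈ Finset.range (t + 1), ∑ m ∈ M.divisors,
        ((2 ^ t * M : ℕ) : ℂ)⁻¹ * (((kSet (min j (t - j))).card : ℂ) *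
          (if t ≤ 2 * j then ((2 ^ t : ℕ) : ℂ) ^ (-s) else ((2 ^ (2 * j) : ℕ) : ℂ) ^ (-s))) *
            (m : ℂ) ^ (-s) := by
    rw [twoFactor]
    simp only [Finset.mul_sum, Finset.sum_mul]
    rw [Finset.sum_comm]
  rw [hR]
  refine Finset.sum_congr rfl fun j hj ↦ Finset.sum_congr rfl fun m hm ↦ ?_
  have hmM : m ∣ M := Nat.dvd_of_mem_divisors hm
  have hjt : j ≤ t := by have := Finset.mem_range.mp hj; omega
  obtain ⟨hm0, hmo, hQo, hcop, hMeq, hNeq⟩ := type_arith t hMo hMs hmM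
  have hN0 : ((2 ^ t * M : ℕ) : ℂ) ≠ 0 := by exact_mod_cast (NeZero.ne (2 ^ t * M))
  have hmc : (m : ℂ) ≠ 0 := by exact_mod_cast hm0.ne'
  -- `width · D = N` and `D = P m` with `P = 2ᵗ` or `2^{2j}`
  have key : ∀ (P wd : ℕ), 0 < P → cuspRepDil t m j = P * m → wd * (P * m) = 2 ^ t * M → cuspRepWidth t M m j = wd →
      ((((kSet (min j (t - j))).card * cuspRepWidth t M m j : ℕ) : ℝ) *
          ((cuspRepDil t m j : ℝ) / (2 ^ t * M : ℕ)) ^ 2 : ℝ) * ((cuspRepDil t m j : ℕ) : ℂ) ^ (-(s + 1)) =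
        ((2 ^ t * M : ℕ) : ℂ)⁻¹ * (((kSet (min j (t - j))).card : ℂ) * ((P : ℕ) : ℂ) ^ (-s)) *
          (m : ℂ) ^ (-s) := by
    intro P wd hP hdil hwd hwidth
    have hPc : (P : ℂ) ≠ 0 := by exact_mod_cast hP.ne'
    have hDc : ((P * m : ℕ) : ℂ) ≠ 0 := by exact_mod_cast (mul_ne_zero hP.ne' hm0.ne')
    rw [hdil, hwidth, show -(s + 1) = -s + (-1 : ℂ) by ring, Complex.cpow_add _ _ hDc, Complex.cpow_neg_one]
    have hwd' : ((wd : ℕ) : ℂ) * ((P : ℂ) * m) = 2 ^ t * (M : ℂ) := by exact_mod_cast hwd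
    have hwd0 : ((wd : ℕ) : ℂ) ≠ 0 := by
      intro h0; rw [h0, zero_mul] at hwd'; exact hN0 (by push_cast; exact hwd'.symm)
    push_cast
    rw [Complex.natCast_mul_natCast_cpow, ← hwd']
    field_simp
  simp only [tpC, dilP]
  by_cases htj : t ≤ 2 * j
  · rw [if_pos htj]
    refine key (2 ^ t) (M / m) (by positivity) (by rw [cuspRepDil, if_pos htj]) ?_ (by rw [cuspRepWidth, if_pos htj])
    rw [hNeq]; ring
  · rw [if_neg htj]
    refine key (2 ^ (2 * j)) (2 ^ (t - 2 * j) * (M / m)) (by positivity) (by rw [cuspRepDil, if_neg htj]) ?_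
      (by rw [cuspRepWidth, if_neg htj])
    rw [hNeq, show 2 ^ t = 2 ^ (t - 2 * j) * 2 ^ (2 * j) by rw [← pow_add]; congr 1; omega]
    ring

omit [NeZero M] in
/-- For `t ≤ 3` every `kSet(min(j, t−j))`, `j ≤ t`, is a singleton. [folklore] -/
theorem card_kSet_eq_one (ht : t ≤ 3) {j : ℕ} (hj : j ≤ t) : (kSet (min j (t - j))).card = 1 := by
  rw [card_kSet]
  have : min j (t - j) ≤ 1 := by
    rcases le_total j (t - j) with h | h
    · rw [min_eq_left h]; omega
    · rw [min_eq_right h]; omega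
  interval_cases (min j (t - j)) <;> rfl

omit [NeZero M] in
/-- **`|A_t(s)| ≤ t + 1 ≤ 4`** for `t ≤ 3` and `Re s ≥ 0`. [folklore] -/
theorem norm_twoFactor_le (ht : t ≤ 3) {s : ℂ} (hs : 0 ≤ s.re) : ‖twoFactor t s‖ ≤ 4 := by
  have hterm : ∀ j ∈ Finset.range (t + 1), ‖((kSet (min j (t - j))).card : ℂ) *
      (if t ≤ 2 * j then ((2 ^ t : ℕ) : ℂ) ^ (-s) else ((2 ^ (2 * j) : ℕ) : ℂ) ^ (-s))‖ ≤ 1 := by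
    intro j hj
    have hjt : j ≤ t := by have := Finset.mem_range.mp hj; omega
    rw [norm_mul, card_kSet_eq_one ht hjt, Nat.cast_one, norm_one, one_mul]
    have hP : ∀ P : ℕ, 0 < P → ‖((P : ℕ) : ℂ) ^ (-s)‖ ≤ 1 := by
      intro P hP
      rw [Complex.norm_natCast_cpow_of_pos hP, Complex.neg_re]
      exact Real.rpow_le_one_of_one_le_of_nonpos (by exact_mod_cast hP) (by linarith)
    split_ifs
    · exact hP _ (by positivity)
    · exact hP _ (by positivity)
  calc ‖twoFactor t s‖ ≤ ∑ j ∈ Finset.range (t + 1), ‖((kSet (min j (t - j))).card : ℂ) *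
        (if t ≤ 2 * j then ((2 ^ t : ℕ) : ℂ) ^ (-s) else ((2 ^ (2 * j) : ℕ) : ℂ) ^ (-s))‖ :=
        norm_sum_le _ _
    _ ≤ ∑ j ∈ Finset.range (t + 1), (1 : ℝ) := Finset.sum_le_sum hterm
    _ = t + 1 := by simp
    _ ≤ 4 := by
        have h3 : (t : ℝ) ≤ 3 := by exact_mod_cast ht
        linarith

end Factor

/-! ### 11. The Euler-product bound at level `2ᵗM` (`t ≥ 2`: the factor at `2` is trivial) -/

section Euler

open Filter
open scoped _root_.Topology

variable {t M : ℕ} [NeZero M] {W : WeierstrassCurve ℚ} [W.IsElliptic]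

/-- **The key bound on `Re s = σ > 1` at level `N = 2ᵗM`** (`M` odd squarefree, `t ≥ 2`), for the
newform `f` of `E/ℚ`:
`‖(Σ_{c∣M} c^{-s}) · Σₙ |aₙ(f)|² n^{-(s+1)}‖ ≤ 2 ζ(2σ) ζ(σ)³ ζ(σ+1) · ‖ζ(s)‖`.
As `IsNewformOf.norm_sum_divisors_mul_LSeries_le` (the case of squarefree `N`), prime by prime:
the divisor sum over the ODD part completes the Euler factors at `p ∣ M` (`p ∥ N`), the primes
`p ∤ N` are bounded by Hasse, and at `p = 2` the local factor of `Σ |aₙ|² n^{-w}` is `1`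
(`a₂ = 0` as `4 ∣ N`) while the majorant's is `≥ 1/2` — whence the factor `2`.
[cite: MaiMurty1994, §2 (Proposition (Rademacher), hypothesis (ii) with d = 3 for Sym² f)] -/
theorem _root_.Literature.NumberTheory.EllipticCurves.ModularForms.IsNewformOf.norm_sum_divisors_mul_LSeries_le_of_two_pow_mul
    (hMo : Odd M) (hMs : Squarefree M) (ht : 2 ≤ t) {f : CuspForm (Gamma0 (2 ^ t * M)) 2}
    (hf : IsNewformOf W f) {s : ℂ} (hs : 1 < s.re) :
    ‖(∑ c ∈ M.divisors, (c : ℂ) ^ (-s)) * LSeries (fun n ↦ (((‖cuspCoeff f n‖ ^ 2 : ℝ)) : ℂ)) (s + 1)‖ ≤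
      2 * ((∑' n : ℕ, 1 / (n : ℝ) ^ (2 * s.re)) * (∑' n : ℕ, 1 / (n : ℝ) ^ s.re) ^ 3 *
        (∑' n : ℕ, 1 / (n : ℝ) ^ (s.re + 1))) * ‖riemannZeta s‖ := by
  set σ : ℝ := s.re with hσdef
  have hσ1 : 1 < σ := hs
  set g : ℕ → ℂ := fun n ↦ (((‖cuspCoeff f n‖ ^ 2 : ℝ)) : ℂ) with hg
  have hw : 2 < (s + 1).re := by
    simp only [Complex.add_re, Complex.one_re]
    linarith
  have hM0 : M ≠ 0 := NeZero.ne M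
  have h4 : 4 ∣ 2 ^ t * M := four_dvd_of_two_le ht
  have h2N : 2 ∣ 2 ^ t * M := (dvd_pow_self 2 (by omega)).mul_right M
  obtain ⟨S₀, hS₀⟩ := exists_finset_primes_mem_iff_dvd hM0
  -- (1) Euler products in norm
  set T : Nat.Primes → ℂ := fun p ↦
    ∑' e : ℕ, (((‖cuspCoeff f ((p : ℕ) ^ e)‖ ^ 2 : ℝ)) : ℂ) * (((p : ℕ) : ℂ) ^ (-(s + 1))) ^ e
    with hT
  have hE : HasProd (fun p ↦ ‖T p‖) ‖LSeries g (s + 1)‖ := (hf.1.hasProd_LSeries_normSq hw).norm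
  set z : Nat.Primes → ℝ := fun p ↦ ‖(1 - ((p : ℕ) : ℂ) ^ (-s))⁻¹‖ with hz
  have hZ : HasProd z ‖riemannZeta s‖ := (riemannZeta_eulerProduct_hasProd hs).norm
  -- (2) the correction factor at the primes dividing `M`
  set c : Nat.Primes → ℝ := fun p ↦ if (p : ℕ) ∣ M then ‖1 + ((p : ℕ) : ℂ) ^ (-s)‖ else 1 with hc
  have hc_of_not : ∀ p : Nat.Primes, ¬ (p : ℕ) ∣ M → c p = 1 := fun p hp ↦ by
    simp only [hc, if_neg hp]
  have hc_of : ∀ p : Nat.Primes, (p : ℕ) ∣ M → c p = ‖1 + ((p : ℕ) : ℂ) ^ (-s)‖ := fun p hp ↦ by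
    simp only [hc, if_pos hp]
  have hc0 : ∀ p, 0 ≤ c p := fun p ↦ by
    by_cases hp : (p : ℕ) ∣ M
    · rw [hc_of p hp]; exact norm_nonneg _
    · rw [hc_of_not p hp]; exact zero_le_one
  have hC : HasProd c (∏ p ∈ S₀, c p) :=
    hasProd_prod_of_ne_finset_one fun p hp ↦ hc_of_not p (fun h ↦ hp ((hS₀ p).mpr h))
  have hCval : ∏ p ∈ S₀, c p = ‖∑ c ∈ M.divisors, (c : ℂ) ^ (-s)‖ := by
    rw [sum_divisors_cpow_neg_eq_prod hMs, norm_prod]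
    have h1 : ∏ p ∈ S₀, c p = ∏ p ∈ S₀, ‖1 + ((p : ℕ) : ℂ) ^ (-s)‖ :=
      Finset.prod_congr rfl fun p hp ↦ hc_of p ((hS₀ p).mp hp)
    rw [h1]
    exact prod_finset_primes_eq_prod_primeFactors hM0 hS₀ (fun q : ℕ ↦ ‖1 + (q : ℂ) ^ (-s)‖)
  -- (2') the extra factor `2` at the prime `2`
  set b : Nat.Primes → ℝ := fun p ↦ if (p : ℕ) = 2 then 2 else 1 with hb
  have hb1 : ∀ p, 1 ≤ b p := fun p ↦ by
    simp only [hb]; split_ifs <;> norm_num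
  have hbS : ∀ S : Finset Nat.Primes, ∏ p ∈ S, b p ≤ 2 := by
    intro S
    by_cases h2 : (⟨2, Nat.prime_two⟩ : Nat.Primes) ∈ S
    · rw [← Finset.mul_prod_erase S b h2]
      have h1 : ∏ p ∈ S.erase ⟨2, Nat.prime_two⟩, b p = 1 := by
        refine Finset.prod_eq_one fun p hp ↦ ?_
        simp only [hb]
        rw [if_neg]
        intro h
        exact (Finset.ne_of_mem_erase hp) (Subtype.ext h)
      rw [h1, mul_one]
      simp [hb]
    · have h1 : ∏ p ∈ S, b p = 1 := by
        refine Finset.prod_eq_one fun p hp ↦ ?_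
        simp only [hb]
        rw [if_neg]
        intro h
        exact h2 (by rwa [show p = ⟨2, Nat.prime_two⟩ from Subtype.ext h] at hp)
      rw [h1]; norm_num
  -- (3) the real majorants `v_p` with `∏ v_p = ζ(2σ) ζ(σ)³ ζ(σ+1)`
  set K : ℝ := (∑' n : ℕ, 1 / (n : ℝ) ^ (2 * σ)) * (∑' n : ℕ, 1 / (n : ℝ) ^ σ) ^ 3 *
    (∑' n : ℕ, 1 / (n : ℝ) ^ (σ + 1)) with hK
  set v : Nat.Primes → ℝ := fun p ↦ (1 - (p : ℝ) ^ (-(2 * σ)))⁻¹ * ((1 - (p : ℝ) ^ (-σ))⁻¹) ^ 3 *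
    (1 - (p : ℝ) ^ (-(σ + 1)))⁻¹ with hv
  have hV : HasProd v K :=
    ((hasProd_one_sub_prime_rpow_neg_inv (s := 2 * σ) (by linarith)).mul
      ((hasProd_one_sub_prime_rpow_neg_inv hσ1).pow 3)).mul
      (hasProd_one_sub_prime_rpow_neg_inv (s := σ + 1) (by linarith))
  have hK0 : 0 ≤ K := by
    have h1 := tsum_one_div_nat_rpow_pos (by linarith : (1 : ℝ) < 2 * σ)
    have h2 := tsum_one_div_nat_rpow_pos (by linarith : (1 : ℝ) < σ)
    have h3 := tsum_one_div_nat_rpow_pos (by linarith : (1 : ℝ) < σ + 1)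
    positivity
  have hA2 : ∀ p : Nat.Primes, 0 < 1 - (p : ℝ) ^ (-(2 * σ)) ∧ 1 ≤ (1 - (p : ℝ) ^ (-(2 * σ)))⁻¹ :=
    fun p ↦ one_sub_prime_rpow_neg_pos p.2 (by linarith)
  have hB : ∀ p : Nat.Primes, 0 < 1 - (p : ℝ) ^ (-σ) ∧ 1 ≤ (1 - (p : ℝ) ^ (-σ))⁻¹ :=
    fun p ↦ one_sub_prime_rpow_neg_pos p.2 (by linarith)
  have hB1 : ∀ p : Nat.Primes, 0 < 1 - (p : ℝ) ^ (-(σ + 1)) ∧ 1 ≤ (1 - (p : ℝ) ^ (-(σ + 1)))⁻¹ :=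
    fun p ↦ one_sub_prime_rpow_neg_pos p.2 (by linarith)
  have hv1 : ∀ p, 1 ≤ v p := fun p ↦ by
    have h3 : (1 : ℝ) ≤ ((1 - (p : ℝ) ^ (-σ))⁻¹) ^ 3 := one_le_pow₀ (hB p).2
    calc (1 : ℝ) = 1 * 1 * 1 := by ring
      _ ≤ v p := mul_le_mul (mul_le_mul (hA2 p).2 h3 zero_le_one (zero_le_one.trans (hA2 p).2))
          (hB1 p).2 zero_le_one (mul_nonneg (zero_le_one.trans (hA2 p).2) (zero_le_one.trans h3))
  have hVle : ∀ S : Finset Nat.Primes, ∏ p ∈ S, v p ≤ K := prod_le_of_hasProd_of_one_le hV hv1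
  -- (4) the pointwise bound `‖T_p‖ c_p ≤ z_p v_p b_p`
  have hpt : ∀ p : Nat.Primes, ‖T p‖ * c p ≤ z p * v p * b p := by
    intro p
    have hq : (p : ℕ).Prime := p.2
    have hq0 : (0 : ℝ) < (p : ℕ) := by exact_mod_cast hq.pos
    have hq1 : (1 : ℝ) < (p : ℕ) := by exact_mod_cast hq.one_lt
    have hqC : ((p : ℕ) : ℂ) ≠ 0 := by exact_mod_cast hq.ne_zero
    set X : ℂ := ((p : ℕ) : ℂ) ^ (-(s + 1)) with hX
    set ws : ℂ := ((p : ℕ) : ℂ) ^ (-s) with hws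
    set y : ℝ := (p : ℝ) ^ (-σ) with hy
    have hy0 : 0 ≤ y := Real.rpow_nonneg hq0.le _
    have hy1 : y < 1 := Real.rpow_lt_one_of_one_lt_of_neg hq1 (by linarith)
    have hws_norm : ‖ws‖ = y := by
      rw [hws, Complex.norm_natCast_cpow_of_pos hq.pos, Complex.neg_re]
    have hpX : ((p : ℕ) : ℂ) * X = ws := by
      rw [hX, hws, show -(s + 1) = -s + (-1) by ring, Complex.cpow_add _ _ hqC, Complex.cpow_neg_one]
      field_simp
    have hpXn : (p : ℕ) * ‖X‖ = y := by
      rw [← hws_norm, ← hpX, norm_mul, Complex.norm_natCast]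
    have hXn : ‖X‖ = (p : ℝ) ^ (-(σ + 1)) := by
      rw [hX, Complex.norm_natCast_cpow_of_pos hq.pos]
      congr 1
    have hXlt : ‖X‖ < 1 := by
      rw [hXn]; exact Real.rpow_lt_one_of_one_lt_of_neg hq1 (by linarith)
    have hy2 : y ^ 2 = (p : ℝ) ^ (-(2 * σ)) := by
      rw [hy, ← Real.rpow_natCast, ← Real.rpow_mul hq0.le]
      congr 1; push_cast; ring
    -- `‖1 + p^{-s}‖ ≤ (1 − p^{-2σ})⁻¹ z_p`
    have hplus : ‖1 + ws‖ ≤ (1 - (p : ℝ) ^ (-(2 * σ)))⁻¹ * z p := by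
      have h := norm_one_add_le_mul_norm_inv_one_sub (w := ws) (by rw [hws_norm]; exact hy1)
      rw [hws_norm, hy2] at h
      refine h.trans (mul_le_mul_of_nonneg_right ?_ (norm_nonneg _))
      have ht0 : 0 ≤ (p : ℝ) ^ (-(2 * σ)) := Real.rpow_nonneg hq0.le _
      have ht1 : (p : ℝ) ^ (-(2 * σ)) < 1 := by rw [← hy2]; nlinarith
      rw [inv_eq_one_div, le_div_iff₀ (by linarith)]
      nlinarith
    -- `z_p ≥ 1/2`
    have hzhalf : 1 / 2 ≤ z p := by
      have h1 : ‖1 - ws‖ ≤ 2 := by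
        calc ‖1 - ws‖ ≤ ‖(1 : ℂ)‖ + ‖ws‖ := norm_sub_le _ _
          _ ≤ 1 + 1 := by rw [norm_one, hws_norm]; linarith
          _ = 2 := by norm_num
      have hne : (1 : ℂ) - ws ≠ 0 := by
        intro h
        have : ws = 1 := by linear_combination -h
        rw [this, norm_one] at hws_norm
        linarith
      have h0 : 0 < ‖1 - ws‖ := norm_pos_iff.mpr hne
      rw [hz]
      dsimp only
      rw [norm_inv, ← hws]
      rw [one_div, inv_le_inv₀ (by norm_num) h0]
      exact h1
    have hsT : Summable fun e : ℕ ↦ (((‖cuspCoeff f ((p : ℕ) ^ e)‖ ^ 2 : ℝ)) : ℂ) * X ^ e :=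
      summable_normSq_cuspCoeff_prime_pow_mul_cpow f hw hq
    have hzv : z p * v p = ((1 - (p : ℝ) ^ (-(2 * σ)))⁻¹ * z p) * ((1 - y)⁻¹) ^ 3 *
        (1 - (p : ℝ) ^ (-(σ + 1)))⁻¹ := by rw [hv]; ring
    have hzv1 : ((1 - (p : ℝ) ^ (-(2 * σ)))⁻¹ * z p) * ((1 - y)⁻¹) ^ 3 *
        (1 - (p : ℝ) ^ (-(σ + 1)))⁻¹ ≥ z p := by
      have h3 : (1 : ℝ) ≤ ((1 - y)⁻¹) ^ 3 := by
        have : (1 : ℝ) ≤ (1 - y)⁻¹ := by rw [one_le_inv₀ (by linarith)]; linarith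
        exact one_le_pow₀ this
      have hz0 : 0 ≤ z p := norm_nonneg _
      have hX0 : 0 ≤ (1 - (p : ℝ) ^ (-(2 * σ)))⁻¹ * z p := mul_nonneg (zero_le_one.trans (hA2 p).2) hz0
      have e1 : 1 * z p ≤ (1 - (p : ℝ) ^ (-(2 * σ)))⁻¹ * z p := mul_le_mul_of_nonneg_right (hA2 p).2 hz0
      have e2 : (1 * z p) * 1 ≤ ((1 - (p : ℝ) ^ (-(2 * σ)))⁻¹ * z p) * ((1 - y)⁻¹) ^ 3 :=
        mul_le_mul e1 h3 zero_le_one hX0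
      calc z p = (1 * z p) * 1 * 1 := by ring
        _ ≤ ((1 - (p : ℝ) ^ (-(2 * σ)))⁻¹ * z p) * ((1 - y)⁻¹) ^ 3 * (1 - (p : ℝ) ^ (-(σ + 1)))⁻¹ :=
            mul_le_mul e2 (hB1 p).2 zero_le_one (mul_nonneg hX0 (zero_le_one.trans h3))
    by_cases hp2 : (p : ℕ) = 2
    · -- the prime `2`: `T_2 = 1`, `c_2 = 1`, `b_2 = 2`
      have hcM : ¬ (p : ℕ) ∣ M := by
        rw [hp2]; intro h; exact (Nat.not_even_iff_odd.mpr hMo) (even_iff_two_dvd.mpr h)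
      have hT1 : T p = 1 := by
        rw [hT]
        dsimp only
        rw [tsum_eq_single 0]
        · simp [show cuspCoeff f 1 = 1 from hf.1.2.2]
        · intro e he
          have hp2N : (p : ℕ) ∣ 2 ^ t * M := by rw [hp2]; exact h2N
          have ha2 : cuspCoeff f (p : ℕ) = 0 := by
            have h0 := hf.1.norm_cuspCoeff_sq_of_dvd hq hp2N
            rw [if_pos (by rw [hp2]; exact h4)] at h0
            exact norm_eq_zero.mp (pow_eq_zero_iff two_ne_zero |>.mp h0)
          rw [hf.1.cuspCoeff_prime_pow_of_dvd hq hp2N e, ha2, zero_pow he, norm_zero]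
          simp
      rw [hT1, norm_one, hc_of_not p hcM, hzv, one_mul]
      simp only [hb, if_pos hp2]
      have := hzv1
      nlinarith [hzhalf]
    rw [hzv]
    by_cases hpM : (p : ℕ) ∣ M
    · -- bad prime `p ∣ M`, `p ∥ N`
      have hpN : (p : ℕ) ∣ 2 ^ t * M := hpM.mul_left _
      have hp2' : ¬ (p : ℕ) ^ 2 ∣ 2 ^ t * M := by
        intro h
        have hodd : Odd (p : ℕ) := hMo.of_dvd_nat hpM
        have hcop : Nat.Coprime ((p : ℕ) ^ 2) (2 ^ t) :=
          Nat.Coprime.pow _ _ (Nat.coprime_two_right.mpr hodd)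
        have h2 : (p : ℕ) ^ 2 ∣ M := hcop.dvd_of_dvd_mul_left h
        rw [pow_two] at h2
        exact absurd (Nat.squarefree_iff_prime_squarefree.mp hMs _ hq) (not_not.mpr h2)
      have hTle : ‖T p‖ ≤ (1 - (p : ℝ) ^ (-(σ + 1)))⁻¹ := by
        have h := hf.1.norm_tsum_normSq_mul_pow_le_of_dvd hq hpN hp2' hXlt
        rwa [hXn] at h
      rw [hc_of p hpM]
      have h3 : (1 : ℝ) ≤ ((1 - y)⁻¹) ^ 3 := by
        have : (1 : ℝ) ≤ (1 - y)⁻¹ := by rw [one_le_inv₀ (by linarith)]; linarith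
        exact one_le_pow₀ this
      calc ‖T p‖ * ‖1 + ws‖ ≤ (1 - (p : ℝ) ^ (-(σ + 1)))⁻¹ * ((1 - (p : ℝ) ^ (-(2 * σ)))⁻¹ * z p) :=
            mul_le_mul hTle hplus (norm_nonneg _) (zero_le_one.trans (hB1 p).2)
        _ = ((1 - (p : ℝ) ^ (-(2 * σ)))⁻¹ * z p) * 1 * (1 - (p : ℝ) ^ (-(σ + 1)))⁻¹ * 1 := by ring
        _ ≤ ((1 - (p : ℝ) ^ (-(2 * σ)))⁻¹ * z p) * ((1 - y)⁻¹) ^ 3 * (1 - (p : ℝ) ^ (-(σ + 1)))⁻¹ * b p := by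
            have hX0 : 0 ≤ (1 - (p : ℝ) ^ (-(2 * σ)))⁻¹ * z p :=
              mul_nonneg (zero_le_one.trans (hA2 p).2) (norm_nonneg _)
            have hC0 : 0 ≤ (1 - (p : ℝ) ^ (-(σ + 1)))⁻¹ := zero_le_one.trans (hB1 p).2
            have e1 : ((1 - (p : ℝ) ^ (-(2 * σ)))⁻¹ * z p) * 1 ≤
                ((1 - (p : ℝ) ^ (-(2 * σ)))⁻¹ * z p) * ((1 - y)⁻¹) ^ 3 := mul_le_mul_of_nonneg_left h3 hX0
            have e2 : ((1 - (p : ℝ) ^ (-(2 * σ)))⁻¹ * z p) * 1 * (1 - (p : ℝ) ^ (-(σ + 1)))⁻¹ ≤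
                ((1 - (p : ℝ) ^ (-(2 * σ)))⁻¹ * z p) * ((1 - y)⁻¹) ^ 3 * (1 - (p : ℝ) ^ (-(σ + 1)))⁻¹ :=
              mul_le_mul_of_nonneg_right e1 hC0
            exact mul_le_mul e2 (hb1 p) zero_le_one
              (mul_nonneg (mul_nonneg hX0 (zero_le_one.trans h3)) hC0)
    · -- good prime `p ∤ N`
      have hpN : ¬ (p : ℕ) ∣ 2 ^ t * M := by
        intro h
        rcases (Nat.Prime.dvd_mul hq).mp h with h1 | h1
        · exact hp2 ((Nat.prime_dvd_prime_iff_eq hq Nat.prime_two).mp (hq.dvd_of_dvd_pow h1))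
        · exact hpM h1
      have hTle : ‖T p‖ ≤ ‖1 + ws‖ * ((1 - y)⁻¹) ^ 3 := by
        have h := hf.norm_tsum_normSq_mul_pow_le_of_not_dvd hq hpN (x := X) (by rw [hpXn]; exact hy1) hsT
        rwa [hpX, hpXn] at h
      rw [hc_of_not p hpM, mul_one]
      have h3 : (0 : ℝ) ≤ ((1 - y)⁻¹) ^ 3 := pow_nonneg (inv_nonneg.mpr (by linarith)) 3
      calc ‖T p‖ ≤ ‖1 + ws‖ * ((1 - y)⁻¹) ^ 3 := hTle
        _ ≤ ((1 - (p : ℝ) ^ (-(2 * σ)))⁻¹ * z p) * ((1 - y)⁻¹) ^ 3 :=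
            mul_le_mul_of_nonneg_right hplus h3
        _ = ((1 - (p : ℝ) ^ (-(2 * σ)))⁻¹ * z p) * ((1 - y)⁻¹) ^ 3 * 1 * 1 := by ring
        _ ≤ ((1 - (p : ℝ) ^ (-(2 * σ)))⁻¹ * z p) * ((1 - y)⁻¹) ^ 3 * (1 - (p : ℝ) ^ (-(σ + 1)))⁻¹ * b p := by
            have hX0 : 0 ≤ ((1 - (p : ℝ) ^ (-(2 * σ)))⁻¹ * z p) * ((1 - y)⁻¹) ^ 3 :=
              mul_nonneg (mul_nonneg (zero_le_one.trans (hA2 p).2) (norm_nonneg _)) h3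
            have e1 : ((1 - (p : ℝ) ^ (-(2 * σ)))⁻¹ * z p) * ((1 - y)⁻¹) ^ 3 * 1 ≤
                ((1 - (p : ℝ) ^ (-(2 * σ)))⁻¹ * z p) * ((1 - y)⁻¹) ^ 3 * (1 - (p : ℝ) ^ (-(σ + 1)))⁻¹ :=
              mul_le_mul_of_nonneg_left (hB1 p).2 hX0
            exact mul_le_mul e1 (hb1 p) zero_le_one (mul_nonneg hX0 (zero_le_one.trans (hB1 p).2))
  -- (5) partial products and the limit
  have hlim1 : Tendsto (fun S : Finset Nat.Primes ↦ ∏ p ∈ S, ‖T p‖ * c p) atTop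
      (𝓝 (‖LSeries g (s + 1)‖ * ∏ p ∈ S₀, c p)) := hE.mul hC
  have hlim2 : Tendsto (fun S : Finset Nat.Primes ↦ (∏ p ∈ S, z p) * (K * 2)) atTop
      (𝓝 (‖riemannZeta s‖ * (K * 2))) := by
    have hZt : Tendsto (fun S : Finset Nat.Primes ↦ ∏ p ∈ S, z p) atTop (𝓝 ‖riemannZeta s‖) := hZ
    exact hZt.mul_const _
  have hle : ∀ S : Finset Nat.Primes, ∏ p ∈ S, ‖T p‖ * c p ≤ (∏ p ∈ S, z p) * (K * 2) := fun S ↦ by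
    have hz0 : 0 ≤ ∏ p ∈ S, z p := Finset.prod_nonneg fun p _ ↦ norm_nonneg _
    calc ∏ p ∈ S, ‖T p‖ * c p ≤ ∏ p ∈ S, z p * v p * b p :=
          Finset.prod_le_prod (fun p _ ↦ mul_nonneg (norm_nonneg _) (hc0 p)) (fun p _ ↦ hpt p)
      _ = (∏ p ∈ S, z p) * (∏ p ∈ S, v p) * ∏ p ∈ S, b p := by
          rw [Finset.prod_mul_distrib, Finset.prod_mul_distrib]
      _ ≤ (∏ p ∈ S, z p) * K * 2 := by
          have hb0 : 0 ≤ ∏ p ∈ S, b p := Finset.prod_nonneg fun p _ ↦ zero_le_one.trans (hb1 p)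
          exact mul_le_mul (mul_le_mul_of_nonneg_left (hVle S) hz0) (hbS S) hb0 (mul_nonneg hz0 hK0)
      _ = (∏ p ∈ S, z p) * (K * 2) := by ring
  have hfinal := le_of_tendsto_of_tendsto' hlim1 hlim2 hle
  rw [norm_mul, ← hCval, mul_comm]
  calc ‖LSeries g (s + 1)‖ * ∏ p ∈ S₀, c p ≤ ‖riemannZeta s‖ * (K * 2) := hfinal
    _ = 2 * K * ‖riemannZeta s‖ := by ring

end Euler

/-! ### 12. Mai–Murty's bound `(f, f) ≪ N (log N)³` at the levels `2ᵗM`, `t ∈ {2, 3}` -/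

section Main

open _root_.MeasureTheory _root_.Set _root_.Filter _root_.Real

variable {t M : ℕ} [NeZero M] {W : WeierstrassCurve ℚ} [W.IsElliptic]

/-- **The key bound on the line `Re s = 1 + δ` in the form used** at level `2ᵗM` (`t ≥ 2`):
`‖(Σ_{c∣M} c^{-s}) Σ|aₙ|²n^{-(s+1)}‖ ≤ 8 ζ(1+δ)³ ‖ζ(s)‖`.
[cite: MaiMurty1994, §2 (Proposition (Rademacher), hypothesis (ii) with d = 3 for Sym² f)] -/
theorem _root_.Literature.NumberTheory.EllipticCurves.ModularForms.IsNewformOf.norm_sum_divisors_mul_LSeries_le_eight_mul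
    (hMo : Odd M) (hMs : Squarefree M) (ht : 2 ≤ t) {f : CuspForm (Gamma0 (2 ^ t * M)) 2}
    (hf : IsNewformOf W f) {δ : ℝ} (hδ : 0 < δ) {s : ℂ} (hs : s.re = 1 + δ) :
    ‖(∑ c ∈ M.divisors, (c : ℂ) ^ (-s)) * LSeries (fun n ↦ (((‖cuspCoeff f n‖ ^ 2 : ℝ)) : ℂ)) (s + 1)‖ ≤
      8 * (∑' n : ℕ, 1 / (n : ℝ) ^ (1 + δ)) ^ 3 * ‖riemannZeta s‖ := by
  have hs1 : 1 < s.re := by rw [hs]; linarith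
  have h := hf.norm_sum_divisors_mul_LSeries_le_of_two_pow_mul hMo hMs ht hs1
  rw [hs] at h
  have h2 : ∑' n : ℕ, 1 / (n : ℝ) ^ (2 * (1 + δ)) ≤ 2 := tsum_one_div_nat_rpow_le_two (by linarith)
  have h1 : ∑' n : ℕ, 1 / (n : ℝ) ^ (1 + δ + 1) ≤ 2 := tsum_one_div_nat_rpow_le_two (by linarith)
  have hζpos : 0 < ∑' n : ℕ, 1 / (n : ℝ) ^ (1 + δ) := tsum_one_div_nat_rpow_pos (by linarith)
  have h1pos : 0 ≤ ∑' n : ℕ, 1 / (n : ℝ) ^ (1 + δ + 1) := (tsum_one_div_nat_rpow_pos (by linarith)).le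
  refine h.trans ?_
  have hz0 : 0 ≤ ‖riemannZeta s‖ := norm_nonneg _
  calc 2 * ((∑' n : ℕ, 1 / (n : ℝ) ^ (2 * (1 + δ))) * (∑' n : ℕ, 1 / (n : ℝ) ^ (1 + δ)) ^ 3 *
        (∑' n : ℕ, 1 / (n : ℝ) ^ (1 + δ + 1))) * ‖riemannZeta s‖
      ≤ 2 * (2 * (∑' n : ℕ, 1 / (n : ℝ) ^ (1 + δ)) ^ 3 * 2) * ‖riemannZeta s‖ := by gcongr
    _ = 8 * (∑' n : ℕ, 1 / (n : ℝ) ^ (1 + δ)) ^ 3 * ‖riemannZeta s‖ := by ring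

set_option maxHeartbeats 1000000 in
/-- **The Petersson norm of the newform of an elliptic curve of conductor `2ᵗM`, `M` odd
squarefree, `t ∈ {2, 3}`, is `≪ N (log N)³`** — Mai–Murty's printed exponent `3`
([MaiMurty1994], §2: "`L(1, Sym²(f)) = O((log N)³)`", "Proposition. `log⟨f,f⟩ = O(log N)`")
beyond squarefree levels: there is an absolute `C > 0` with

  `Re (f, f)_{Γ₀(N)} ≤ C · N · (1 + log N)³`, `N = 2ᵗ M`,

for every such level, every `E/ℚ` and every `f` with `IsNewformOf E f`. The proof is that of
`exists_petersson_le_mul_log_cube_of_squarefree` (Rankin–Selberg continuation of the trace zeta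
function, Rademacher's Phragmén–Lindelöf theorem between `Re s = -δ` and `1 + δ`,
`δ = 1/(2 + log N)`), with the dictionary of THIS file at the level `2ᵗM`: the Fourier expansions
of `f` at ALL cusps of `Γ₀(2ᵗM)` are dilates of `f` (`exists_slash_rep`: Atkin–Lehner at the odd
part, `L(c) = w_N (1 -c/N; 0 1) w_N⁻¹` with `c/N ∈ ½ℤ` at the `2`-part since `t ≤ 3`), so the trace
Dirichlet series is `N⁻¹ A_t(s) (Σ_{m∣M} m^{-s}) Σ|aₙ|²n^{-(s+1)}` with `|A_t(s)| ≤ 4`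
(`sum_tpC_mul_cpow_eq`, `norm_twoFactor_le`), and the Euler factor at `2` is trivial (`a₂ = 0`).
Constant: `C = 2·3⁵·(7/3)⁵·128·e·4³`. Among the Frey–Hellegouarch curves this covers the levels
with `2³ ∥ N`; with `exists_petersson_le_mul_log_cube_of_quadraticTwist_neg_one_squarefree` and the
squarefree case, every `v₂(N) ≤ 3` and the `t = 4` curves twisted from `t ≤ 1`.
[cite: MaiMurty1994, §2 (L(1, Sym² f) = O((log N)³); Proposition: log⟨f,f⟩ = O(log N))] -/
theorem exists_petersson_le_mul_log_cube_of_two_pow_mul :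
    ∃ C : ℝ, 0 < C ∧ ∀ (t M : ℕ) [NeZero M], 2 ≤ t → t ≤ 3 → Odd M → Squarefree M →
      ∀ (W : WeierstrassCurve ℚ) [W.IsElliptic] (f : CuspForm (Gamma0 (2 ^ t * M)) 2), IsNewformOf W f →
        (peterssonProduct (Gamma0 (2 ^ t * M)) 2 f f).re ≤
          C * (2 ^ t * M : ℕ) * (1 + Real.log (2 ^ t * M : ℕ)) ^ 3 := by
  obtain ⟨Q, hQ, hQbd⟩ := exists_norm_J₀_le_uniform
  refine ⟨2 * 3 ^ 5 * (7 / 3) ^ 5 * 128 * Real.exp 1 * 4 ^ 3, by positivity, ?_⟩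
  intro t M _ ht2 ht3 hMo hMs W _ f hf
  have hπ := Real.pi_pos
  have hN0 : (0 : ℝ) < ((2 ^ t * M : ℕ) : ℝ) := Nat.cast_pos.mpr (NeZero.pos (2 ^ t * M))
  have hN1 : (1 : ℝ) ≤ ((2 ^ t * M : ℕ) : ℝ) := by exact_mod_cast NeZero.one_le
  have hlogN : 0 ≤ Real.log ((2 ^ t * M : ℕ) : ℝ) := Real.log_nonneg hN1
  -- the horocycle datum of the trace `G_f` (as in `NewformPeterssonSizeSiegelProofs`)
  have hGc : Continuous (rsTrace (2 ^ t * M) 2 f) := continuous_rsTrace (ModularFormClass.continuous f)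
  have hGinv : ∀ (A : SL(2, ℤ)) (τ : UpperHalfPlane), rsTrace (2 ^ t * M) 2 f (A • τ) = rsTrace (2 ^ t * M) 2 f τ :=
    fun A τ ↦ rsTrace_smul f A τ
  have hG0 : ∀ τ, 0 ≤ rsTrace (2 ^ t * M) 2 f τ := fun τ ↦ rsTrace_nonneg _ τ
  obtain ⟨B, -, hB⟩ := exists_rsTrace_le f
  have hC : ∀ n, 0 ≤ rsCoeff (2 ^ t * M) 2 f n := fun n ↦ rsCoeff_nonneg _ n
  have hC0 : rsCoeff (2 ^ t * M) 2 f 0 = 0 := rsCoeff_zero f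
  set a : ℝ := 4 * π / ((2 ^ t * M : ℕ) : ℝ) with hadef
  have ha : 0 < a := by positivity
  have hs : ∀ y : ℝ, 0 < y → Summable fun n : ℕ ↦ rsCoeff (2 ^ t * M) 2 f n * Real.exp (-a * n * y) :=
    fun y hy ↦ summable_rsCoeff_mul_exp_datum f hy
  have hm : ∀ y : ℝ, 0 < y → ∫ x in (0 : ℝ)..1, rsTrace (2 ^ t * M) 2 f (pt x y) =
      y ^ (2 : ℝ) * ∑' n : ℕ, rsCoeff (2 ^ t * M) 2 f n * Real.exp (-a * n * y) :=
    fun y hy ↦ horocycle_rsTrace_datum f hy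
  have hκ : (0 : ℝ) ≤ 2 := by norm_num
  -- `J`, `V`, `Z`
  set J : ℂ → ℂ := fun s ↦ ∫ w in ModularGroup.fd, (rsTrace (2 ^ t * M) 2 f w : ℂ) * completedEisenstein₀ w s
    with hJdef
  set V : ℝ := ∫ w in ModularGroup.fd, rsTrace (2 ^ t * M) 2 f w with hVdef
  have hVeq : (peterssonProduct (Gamma0 (2 ^ t * M)) 2 f f).re = V :=
    peterssonProduct_self_re_eq_integral_rsTrace f
  have hV0 : 0 ≤ V := setIntegral_nonneg ModularGroup.isClosed_fd.measurableSet fun w _ ↦ hG0 w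
  have hJ : Differentiable ℂ J := differentiable_J₀ hGc hGinv hG0 hB hC hC0 ha hκ hs hm
  have hJbd : ∀ s : ℂ, -1 / 2 ≤ s.re → s.re ≤ 7 / 2 → ‖J s‖ ≤ Q * (1 + a⁻¹) ^ 4 * V :=
    fun s h1 h2 ↦ hQbd hGc hGinv hG0 hB hC hC0 ha hs hm h1 h2
  set Mb : ℝ := Q * (1 + a⁻¹) ^ 4 * V with hMbdef
  have hMb0 : 0 ≤ Mb := by positivity
  set Z : ℂ → ℂ := fun s ↦ s * (s - 1) * J s + (V : ℂ) / 2 with hZdef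
  have hZdiff : Differentiable ℂ Z :=
    ((differentiable_id.mul (differentiable_id.sub_const 1)).mul hJ).add_const _
  have hZsymm : ∀ s : ℂ, Z (1 - s) = Z s := by
    intro s
    have hJs : J (1 - s) = J s := J₀_one_sub (fun w ↦ rsTrace (2 ^ t * M) 2 f w) s
    show (1 - s) * (1 - s - 1) * J (1 - s) + (V : ℂ) / 2 = s * (s - 1) * J s + (V : ℂ) / 2
    rw [hJs]; ring
  have hZone : Z 1 = (V : ℂ) / 2 := by
    show (1 : ℂ) * (1 - 1) * J 1 + (V : ℂ) / 2 = (V : ℂ) / 2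
    ring
  -- finite order in the strip `-1/2 ≤ Re s ≤ 3/2`
  have hgrowth : ∀ z : ℂ, -1 / 2 ≤ z.re → z.re ≤ 3 / 2 →
      ‖Z z‖ ≤ (4 * Mb + V / 2) * Real.exp (|z.im| ^ (1 : ℝ)) := by
    intro z hz1 hz2
    rw [Real.rpow_one]
    have hz : ‖z‖ ≤ 2 + |z.im| := by
      have := Complex.norm_le_abs_re_add_abs_im z
      have : |z.re| ≤ 2 := abs_le.2 ⟨by linarith, by linarith⟩
      linarith
    have hz' : ‖z - 1‖ ≤ 2 + |z.im| := by
      have := Complex.norm_le_abs_re_add_abs_im (z - 1)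
      rw [Complex.sub_re, Complex.sub_im, Complex.one_re, Complex.one_im, sub_zero] at this
      have : |z.re - 1| ≤ 2 := abs_le.2 ⟨by linarith, by linarith⟩
      linarith
    have hexp := two_add_sq_le_four_mul_exp (abs_nonneg z.im)
    have h1e : 1 ≤ Real.exp |z.im| := Real.one_le_exp (abs_nonneg _)
    have hVn : ‖(V : ℂ) / 2‖ = V / 2 := by
      rw [norm_div, Complex.norm_real, Complex.norm_ofNat, Real.norm_of_nonneg hV0]
    calc ‖Z z‖ = ‖z * (z - 1) * J z + (V : ℂ) / 2‖ := rfl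
      _ ≤ ‖z * (z - 1) * J z‖ + ‖(V : ℂ) / 2‖ := norm_add_le _ _
      _ = ‖z‖ * ‖z - 1‖ * ‖J z‖ + V / 2 := by rw [norm_mul, norm_mul, hVn]
      _ ≤ (2 + |z.im|) * (2 + |z.im|) * Mb + V / 2 * 1 := by
          rw [mul_one]
          have hJz : ‖J z‖ ≤ Mb := hJbd z hz1 (by linarith)
          have h1 : ‖z‖ * ‖z - 1‖ ≤ (2 + |z.im|) * (2 + |z.im|) :=
            mul_le_mul hz hz' (norm_nonneg _) (by positivity)
          have h2 : ‖z‖ * ‖z - 1‖ * ‖J z‖ ≤ (2 + |z.im|) * (2 + |z.im|) * Mb :=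
            mul_le_mul h1 hJz (norm_nonneg _) (by positivity)
          linarith
      _ ≤ (4 * Real.exp |z.im|) * Mb + V / 2 * Real.exp |z.im| := by
          have h3 : (2 + |z.im|) * (2 + |z.im|) ≤ 4 * Real.exp |z.im| := by rw [← sq]; exact hexp
          have h4 : (2 + |z.im|) * (2 + |z.im|) * Mb ≤ 4 * Real.exp |z.im| * Mb :=
            mul_le_mul_of_nonneg_right h3 hMb0
          have h5 : V / 2 * 1 ≤ V / 2 * Real.exp |z.im| := mul_le_mul_of_nonneg_left h1e (by linarith)
          linarith
      _ = (4 * Mb + V / 2) * Real.exp |z.im| := by ring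
  -- the parameter `δ` and the real zeta value `ζ(1 + δ)`
  set δ : ℝ := 1 / (2 + Real.log ((2 ^ t * M : ℕ) : ℝ)) with hδdef
  have hδ0 : 0 < δ := by positivity
  have hδhalf : δ ≤ 1 / 2 := by
    rw [hδdef]; exact one_div_le_one_div_of_le (by norm_num) (by linarith)
  set ζδ : ℝ := ∑' n : ℕ, 1 / (n : ℝ) ^ (1 + δ) with hζδdef
  have hζδpos : 0 < ζδ := tsum_one_div_nat_rpow_pos (by linarith)
  have hζδle : ζδ ≤ 4 + Real.log ((2 ^ t * M : ℕ) : ℝ) := by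
    have h := tsum_one_div_nat_rpow_le (σ := 1 + δ) (by linarith)
    have hδne : δ ≠ 0 := hδ0.ne'
    have e1 : (1 + δ) / (1 + δ - 1) + 1 = 2 + 1 / δ := by
      rw [show (1 : ℝ) + δ - 1 = δ by ring]; field_simp; ring
    have e2 : 1 / δ = 2 + Real.log ((2 ^ t * M : ℕ) : ℝ) := by rw [hδdef, one_div_one_div]
    linarith
  have hNδ : ((2 ^ t * M : ℕ) : ℝ) ^ δ ≤ Real.exp 1 := by
    rw [Real.rpow_def_of_pos hN0]
    refine Real.exp_le_exp.2 ?_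
    rw [hδdef, mul_one_div]
    exact div_le_one_of_le₀ (by linarith) (by linarith)
  -- the bound on the line `Re s = 1 + δ`
  set A₀ : ℝ := 128 * (((2 ^ t * M : ℕ) : ℝ) * ((2 ^ t * M : ℕ) : ℝ) ^ δ) * ζδ ^ 3 with hA₀def
  have hA₀pos : 0 < A₀ := by positivity
  have hright : ∀ z : ℂ, z.re = 1 + δ → ‖Z z‖ ≤ A₀ * ‖z + 2‖ ^ 5 := by
    intro z hz
    have hz1 : 1 < z.re := by rw [hz]; linarith
    have hzne : z ≠ 1 := fun h ↦ by rw [h, Complex.one_re] at hz1; exact lt_irrefl _ hz1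
    have hZeq : Z z = z * (z - 1) * ((π : ℂ) ^ (-z) * Complex.Gamma z * riemannZeta (2 * z) *
          (Complex.Gamma (z + 1) * (((4 * π / ((2 ^ t * M : ℕ) : ℝ) : ℝ)) : ℂ) ^ (-(z + 1)))) *
        ((((2 ^ t * M : ℕ) : ℂ)⁻¹ * twoFactor t z * ∑ c ∈ M.divisors, (c : ℂ) ^ (-z)) *
          LSeries (fun n ↦ (((‖cuspCoeff f n‖ ^ 2 : ℝ)) : ℂ)) (z + 1)) := by
      have h := traceZeta_eq_of_sum_dilate (tpS t M) (tpC t M) (dilP t) (fun i hi ↦ dilP_pos hi) f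
        (hf.1.rsCoeff_eq_sum_tpS hMo hMs ht3) hz1
      rw [sum_tpC_mul_cpow_eq hMo hMs z] at h
      exact h
    have hZeq' : Z z = z * ((π : ℂ) ^ (-z) * Complex.Gamma z * riemannZeta (2 * z) *
          (Complex.Gamma (z + 1) * (((4 * π / ((2 ^ t * M : ℕ) : ℝ) : ℝ)) : ℂ) ^ (-(z + 1)))) * ((2 ^ t * M : ℕ) : ℂ)⁻¹ *
        ((z - 1) * (twoFactor t z * ((∑ c ∈ M.divisors, (c : ℂ) ^ (-z)) *
          LSeries (fun n ↦ (((‖cuspCoeff f n‖ ^ 2 : ℝ)) : ℂ)) (z + 1)))) := by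
      rw [hZeq]; ring
    -- the factors
    have b1 : ‖z‖ ≤ ‖z + 2‖ := norm_le_norm_add_two (by linarith)
    have b3 : ‖(π : ℂ) ^ (-z)‖ ≤ 1 :=
      norm_ofReal_cpow_neg_le_one (by linarith [Real.pi_gt_three]) (by linarith)
    have b4 : ‖Complex.Gamma z‖ ≤ 1 := norm_Gamma_le_one (by linarith) (by linarith)
    have b5 : ‖riemannZeta (2 * z)‖ ≤ 2 * ‖z + 2‖ := by
      have h := norm_riemannZeta_two_mul_le (s := z) (by linarith)
      have h3 : (3 : ℝ) ≤ ‖z + 2‖ := by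
        have := Complex.re_le_norm (z + 2)
        rw [Complex.add_re, Complex.re_ofNat] at this
        linarith
      linarith
    have b6 : ‖Complex.Gamma (z + 1)‖ ≤ ‖z + 2‖ := by
      have hz0 : z ≠ 0 := fun h ↦ by rw [h, Complex.zero_re] at hz1; linarith
      rw [Complex.Gamma_add_one z hz0, norm_mul]
      calc ‖z‖ * ‖Complex.Gamma z‖ ≤ ‖z + 2‖ * 1 := by gcongr
        _ = ‖z + 2‖ := mul_one _
    have b7 : ‖(((4 * π / ((2 ^ t * M : ℕ) : ℝ) : ℝ)) : ℂ) ^ (-(z + 1))‖ ≤ ((2 ^ t * M : ℕ) : ℝ) * (((2 ^ t * M : ℕ) : ℝ) * ((2 ^ t * M : ℕ) : ℝ) ^ δ) := by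
      have h := norm_cpow_level_le (NeZero.pos (2 ^ t * M)) (s := z) (by linarith)
      rw [hz, Real.rpow_add hN0, Real.rpow_one] at h
      exact h
    have b8 : ‖((2 ^ t * M : ℕ) : ℂ)⁻¹‖ = ((2 ^ t * M : ℕ) : ℝ)⁻¹ := by rw [norm_inv, Complex.norm_natCast]
    -- the key bound and the pole factor
    have b9 : ‖twoFactor t z * ((∑ c ∈ M.divisors, (c : ℂ) ^ (-z)) *
        LSeries (fun n ↦ (((‖cuspCoeff f n‖ ^ 2 : ℝ)) : ℂ)) (z + 1))‖ ≤ 32 * ζδ ^ 3 * ‖riemannZeta z‖ := by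
      rw [norm_mul]
      have h1 : ‖twoFactor t z‖ ≤ 4 := norm_twoFactor_le ht3 (by linarith)
      have h2 := hf.norm_sum_divisors_mul_LSeries_le_eight_mul hMo hMs ht2 hδ0 hz
      calc ‖twoFactor t z‖ * ‖(∑ c ∈ M.divisors, (c : ℂ) ^ (-z)) *
            LSeries (fun n ↦ (((‖cuspCoeff f n‖ ^ 2 : ℝ)) : ℂ)) (z + 1)‖
          ≤ 4 * (8 * ζδ ^ 3 * ‖riemannZeta z‖) :=
            mul_le_mul h1 h2 (norm_nonneg _) (by norm_num)
        _ = 32 * ζδ ^ 3 * ‖riemannZeta z‖ := by ring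
    have b10 : ‖z - 1‖ * ‖riemannZeta z‖ ≤ 2 * ‖z + 2‖ ^ 2 :=
      norm_sub_one_mul_norm_riemannZeta_le (by linarith) hzne
    have b11 : ‖(z - 1) * (twoFactor t z * ((∑ c ∈ M.divisors, (c : ℂ) ^ (-z)) *
        LSeries (fun n ↦ (((‖cuspCoeff f n‖ ^ 2 : ℝ)) : ℂ)) (z + 1)))‖ ≤ 64 * ζδ ^ 3 * ‖z + 2‖ ^ 2 := by
      rw [norm_mul]
      calc ‖z - 1‖ * ‖twoFactor t z * ((∑ c ∈ M.divisors, (c : ℂ) ^ (-z)) *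
            LSeries (fun n ↦ (((‖cuspCoeff f n‖ ^ 2 : ℝ)) : ℂ)) (z + 1))‖
          ≤ ‖z - 1‖ * (32 * ζδ ^ 3 * ‖riemannZeta z‖) := mul_le_mul_of_nonneg_left b9 (norm_nonneg _)
        _ = 32 * ζδ ^ 3 * (‖z - 1‖ * ‖riemannZeta z‖) := by ring
        _ ≤ 32 * ζδ ^ 3 * (2 * ‖z + 2‖ ^ 2) := by gcongr
        _ = 64 * ζδ ^ 3 * ‖z + 2‖ ^ 2 := by ring
    calc ‖Z z‖ = ‖z‖ * (‖(π : ℂ) ^ (-z)‖ * ‖Complex.Gamma z‖ * ‖riemannZeta (2 * z)‖ *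
          (‖Complex.Gamma (z + 1)‖ * ‖(((4 * π / ((2 ^ t * M : ℕ) : ℝ) : ℝ)) : ℂ) ^ (-(z + 1))‖)) * ‖((2 ^ t * M : ℕ) : ℂ)⁻¹‖ *
        ‖(z - 1) * (twoFactor t z * ((∑ c ∈ M.divisors, (c : ℂ) ^ (-z)) *
          LSeries (fun n ↦ (((‖cuspCoeff f n‖ ^ 2 : ℝ)) : ℂ)) (z + 1)))‖ := by
          rw [hZeq']; simp only [norm_mul]
      _ ≤ ‖z + 2‖ * (1 * 1 * (2 * ‖z + 2‖) * (‖z + 2‖ * (((2 ^ t * M : ℕ) : ℝ) * (((2 ^ t * M : ℕ) : ℝ) * ((2 ^ t * M : ℕ) : ℝ) ^ δ)))) * ((2 ^ t * M : ℕ) : ℝ)⁻¹ *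
        (64 * ζδ ^ 3 * ‖z + 2‖ ^ 2) := by
          rw [b8]
          gcongr
      _ = A₀ * ‖z + 2‖ ^ 5 := by
          rw [hA₀def]
          field_simp
          ring
  -- the bound on both lines, with `A = (7/3)⁵ A₀`
  set A : ℝ := (7 / 3) ^ 5 * A₀ with hAdef
  have hApos : 0 < A := by positivity
  have hA₀A : A₀ ≤ A := by
    rw [hAdef]
    have : (1 : ℝ) ≤ (7 / 3) ^ 5 := by norm_num
    nlinarith
  have hb : ∀ z : ℂ, z.re = 1 + δ → ‖Z z‖ ≤ A * ‖(2 : ℂ) + z‖ ^ (5 : ℝ) := by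
    intro z hz
    rw [show (5 : ℝ) = (5 : ℕ) by norm_num, Real.rpow_natCast, add_comm (2 : ℂ) z]
    exact (hright z hz).trans (mul_le_mul_of_nonneg_right hA₀A (by positivity))
  have ha' : ∀ z : ℂ, z.re = -δ → ‖Z z‖ ≤ A * ‖(2 : ℂ) + z‖ ^ (5 : ℝ) := by
    intro z hz
    rw [show (5 : ℝ) = (5 : ℕ) by norm_num, Real.rpow_natCast, add_comm (2 : ℂ) z]
    have hsym : Z z = Z (1 - z) := by
      have := hZsymm (1 - z); rwa [sub_sub_cancel] at this
    have h1z : (1 - z).re = 1 + δ := by simp [hz]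
    have h := hright (1 - z) h1z
    have h3 : ‖1 - z + 2‖ ≤ 7 / 3 * ‖z + 2‖ := by
      rw [show (1 : ℂ) - z + 2 = 3 - z by ring]
      exact norm_three_sub_le (by rw [hz]; linarith)
    rw [hsym]
    calc ‖Z (1 - z)‖ ≤ A₀ * ‖1 - z + 2‖ ^ 5 := h
      _ ≤ A₀ * (7 / 3 * ‖z + 2‖) ^ 5 := by gcongr
      _ = A * ‖z + 2‖ ^ 5 := by rw [hAdef]; ring
  -- Phragmén–Lindelöf at `s = 1`
  have hgr : ∀ z : ℂ, -δ < z.re → z.re < 1 + δ →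
      ‖Z z‖ ≤ (4 * Mb + V / 2) * Real.exp (|z.im| ^ (1 : ℝ)) :=
    fun z h1 h2 ↦ hgrowth z (by linarith) (by linarith)
  have hPL := Literature.Analysis.Complex.rademacher_phragmenLindelof_of_finiteOrder (f := Z) (a := -δ) (b := 1 + δ)
    (Q := 2) (A := A) (B := A) (α := 5) (β := 5) (C := 4 * Mb + V / 2) (c := 1)
    (by linarith) (by linarith) hApos hApos le_rfl hZdiff.diffContOnCl one_pos hgr ha' hb
    (z := 1) (by simp; linarith) (by simp; linarith)
  -- `‖Z 1‖ ≤ 243 A`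
  have h243 : ‖((2 : ℝ) : ℂ) + 1‖ ^ (5 : ℝ) = 243 := by
    rw [show ((2 : ℝ) : ℂ) + 1 = (3 : ℝ) by push_cast; norm_num, Complex.norm_real,
      Real.norm_of_nonneg (by norm_num : (0 : ℝ) ≤ 3), show (5 : ℝ) = (5 : ℕ) by norm_num,
      Real.rpow_natCast]
    norm_num
  have hx : 0 < A * 243 := by positivity
  have hZ1 : ‖Z 1‖ ≤ A * 243 := by
    rw [h243, Complex.one_re] at hPL
    have e : (1 + δ - 1) / (1 + δ - -δ) + (1 - -δ) / (1 + δ - -δ) = 1 := by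
      rw [← add_div, show (1 : ℝ) + δ - 1 + (1 - -δ) = 1 + δ - -δ by ring,
        div_self (by linarith : (1 : ℝ) + δ - -δ ≠ 0)]
    calc ‖Z 1‖ ≤ (A * 243) ^ ((1 + δ - 1) / (1 + δ - -δ)) * (A * 243) ^ ((1 - -δ) / (1 + δ - -δ)) := hPL
      _ = A * 243 := by rw [← Real.rpow_add hx, e, Real.rpow_one]
  -- conclusion
  have hV : V / 2 ≤ A * 243 := by
    have : ‖Z 1‖ = V / 2 := by
      rw [hZone, norm_div, Complex.norm_real, Complex.norm_ofNat, Real.norm_of_nonneg hV0]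
    rw [← this]; exact hZ1
  rw [hVeq]
  have hζ3 : ζδ ^ 3 ≤ (4 * (1 + Real.log ((2 ^ t * M : ℕ) : ℝ))) ^ 3 :=
    pow_le_pow_left₀ hζδpos.le (by linarith) 3
  calc V ≤ 2 * (A * 243) := by linarith
    _ = 2 * 3 ^ 5 * (7 / 3) ^ 5 * 128 * (((2 ^ t * M : ℕ) : ℝ) * ((2 ^ t * M : ℕ) : ℝ) ^ δ * ζδ ^ 3) := by
        rw [hAdef, hA₀def]; ring
    _ ≤ 2 * 3 ^ 5 * (7 / 3) ^ 5 * 128 * (((2 ^ t * M : ℕ) : ℝ) * Real.exp 1 * (4 * (1 + Real.log ((2 ^ t * M : ℕ) : ℝ))) ^ 3) := by gcongr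
    _ = 2 * 3 ^ 5 * (7 / 3) ^ 5 * 128 * Real.exp 1 * 4 ^ 3 * ((2 ^ t * M : ℕ) : ℝ) * (1 + Real.log ((2 ^ t * M : ℕ) : ℝ)) ^ 3 := by ring


/-- **Power form `(f, f) ≪ N^{1+ε}/ε³`** of `exists_petersson_le_mul_log_cube_of_two_pow_mul`.
[cite: MaiMurty1994, §2, Proposition] -/
theorem exists_petersson_le_mul_rpow_of_two_pow_mul :
    ∃ C : ℝ, 0 < C ∧ ∀ ε : ℝ, 0 < ε → ε ≤ 1 → ∀ (t M : ℕ) [NeZero M], 2 ≤ t → t ≤ 3 → Odd M → Squarefree M →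
      ∀ (W : WeierstrassCurve ℚ) [W.IsElliptic] (f : CuspForm (Gamma0 (2 ^ t * M)) 2), IsNewformOf W f →
        (peterssonProduct (Gamma0 (2 ^ t * M)) 2 f f).re ≤ C * ((2 ^ t * M : ℕ) : ℝ) ^ (1 + ε) / ε ^ 3 := by
  obtain ⟨C, hC, h⟩ := exists_petersson_le_mul_log_cube_of_two_pow_mul
  refine ⟨C * 4 ^ 3, by positivity, fun ε hε hε1 t M _ ht2 ht3 hMo hMs W _ f hf ↦ ?_⟩
  have hN1 : (1 : ℝ) ≤ ((2 ^ t * M : ℕ) : ℝ) := by exact_mod_cast NeZero.one_le (n := 2 ^ t * M)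
  calc (peterssonProduct (Gamma0 (2 ^ t * M)) 2 f f).re
      ≤ C * (2 ^ t * M : ℕ) * (1 + Real.log (2 ^ t * M : ℕ)) ^ 3 := h t M ht2 ht3 hMo hMs W f hf
    _ = C * ((2 ^ t * M : ℕ) * (1 + Real.log (2 ^ t * M : ℕ)) ^ 3) := by ring
    _ ≤ C * (4 ^ 3 * ((2 ^ t * M : ℕ) : ℝ) ^ (1 + ε) / ε ^ 3) :=
        mul_le_mul_of_nonneg_left (mul_one_add_log_pow_three_le_rpow hN1 hε hε1) hC.le
    _ = C * 4 ^ 3 * ((2 ^ t * M : ℕ) : ℝ) ^ (1 + ε) / ε ^ 3 := by ring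

/-- **Mai–Murty's exponent `3` for every level with `16 ∤ N` and squarefree odd part** (the
squarefree case of `…ConvexityCubeProofs` and the levels `4M`, `8M` of this file combined): an
absolute `C > 0` with `Re (f, f)_{Γ₀(N)} ≤ C · N · (1 + log N)³` for every such `N`, every `E/ℚ` and
every `f` with `IsNewformOf E f`. [cite: MaiMurty1994, §2, Proposition] -/
theorem exists_petersson_le_mul_log_cube_of_not_sixteen_dvd :
    ∃ C : ℝ, 0 < C ∧ ∀ (N : ℕ) [NeZero N], ¬ 16 ∣ N → (∀ p : ℕ, p.Prime → p ≠ 2 → ¬ p ^ 2 ∣ N) →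
      ∀ (W : WeierstrassCurve ℚ) [W.IsElliptic] (f : CuspForm (Gamma0 N) 2), IsNewformOf W f →
        (peterssonProduct (Gamma0 N) 2 f f).re ≤ C * N * (1 + Real.log N) ^ 3 := by
  obtain ⟨C₁, hC₁, h₁⟩ := exists_petersson_le_mul_log_cube_of_squarefree
  obtain ⟨C₂, hC₂, h₂⟩ := exists_petersson_le_mul_log_cube_of_two_pow_mul
  refine ⟨max C₁ C₂, lt_max_of_lt_left hC₁, ?_⟩
  intro N _ h16 hodd W _ f hf
  obtain ⟨t, M, hMo, hNtM⟩ := Nat.exists_eq_two_pow_mul_odd (NeZero.ne N)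
  subst hNtM
  haveI : NeZero M := ⟨fun h ↦ by rw [h] at hMo; exact (Nat.not_even_iff_odd.mpr hMo) (Even.zero)⟩
  have hMs : Squarefree M := by
    refine Nat.squarefree_iff_prime_squarefree.mpr fun p hp hpp ↦ ?_
    have hp2 : p ≠ 2 := by
      rintro rfl
      exact (Nat.not_even_iff_odd.mpr hMo) (even_iff_two_dvd.mpr ((dvd_mul_right 2 2).trans hpp))
    exact hodd p hp hp2 (by rw [sq]; exact hpp.trans (Dvd.intro_left _ rfl))
  have ht3 : t ≤ 3 := by
    by_contra h
    obtain ⟨k, rfl⟩ := Nat.exists_eq_add_of_le (by omega : 4 ≤ t)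
    exact h16 ⟨2 ^ k * M, by rw [pow_add]; ring⟩
  have hx0 : 0 ≤ ((2 ^ t * M : ℕ) : ℝ) * (1 + Real.log ((2 ^ t * M : ℕ) : ℝ)) ^ 3 := by
    have hN1 : (1 : ℝ) ≤ ((2 ^ t * M : ℕ) : ℝ) := by exact_mod_cast NeZero.one_le (n := 2 ^ t * M)
    have := Real.log_nonneg hN1
    positivity
  rcases Nat.lt_or_ge t 2 with ht | ht
  · have hsf : Squarefree (2 ^ t * M) := by
      interval_cases t
      · simpa using hMs
      · rw [pow_one]
        exact (Nat.squarefree_mul (Nat.coprime_two_left.mpr hMo)).mpr ⟨Nat.prime_two.prime.squarefree, hMs⟩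
    calc (peterssonProduct (Gamma0 (2 ^ t * M)) 2 f f).re
        ≤ C₁ * (2 ^ t * M : ℕ) * (1 + Real.log (2 ^ t * M : ℕ)) ^ 3 := h₁ (2 ^ t * M) hsf W f hf
      _ = C₁ * ((2 ^ t * M : ℕ) * (1 + Real.log (2 ^ t * M : ℕ)) ^ 3) := by ring
      _ ≤ max C₁ C₂ * ((2 ^ t * M : ℕ) * (1 + Real.log (2 ^ t * M : ℕ)) ^ 3) :=
          mul_le_mul_of_nonneg_right (le_max_left _ _) hx0
      _ = max C₁ C₂ * (2 ^ t * M : ℕ) * (1 + Real.log (2 ^ t * M : ℕ)) ^ 3 := by ring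
  · calc (peterssonProduct (Gamma0 (2 ^ t * M)) 2 f f).re
        ≤ C₂ * (2 ^ t * M : ℕ) * (1 + Real.log (2 ^ t * M : ℕ)) ^ 3 := h₂ t M ht ht3 hMo hMs W f hf
      _ = C₂ * ((2 ^ t * M : ℕ) * (1 + Real.log (2 ^ t * M : ℕ)) ^ 3) := by ring
      _ ≤ max C₁ C₂ * ((2 ^ t * M : ℕ) * (1 + Real.log (2 ^ t * M : ℕ)) ^ 3) :=
          mul_le_mul_of_nonneg_right (le_max_right _ _) hx0
      _ = max C₁ C₂ * (2 ^ t * M : ℕ) * (1 + Real.log (2 ^ t * M : ℕ)) ^ 3 := by ring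

/-- **Power form** of `exists_petersson_le_mul_log_cube_of_not_sixteen_dvd`: `Re (f, f) ≤ C N^{1+ε}/ε³`
for `0 < ε ≤ 1`, `16 ∤ N`, odd part of `N` squarefree. [cite: MaiMurty1994, §2, Proposition] -/
theorem exists_petersson_le_mul_rpow_of_not_sixteen_dvd :
    ∃ C : ℝ, 0 < C ∧ ∀ ε : ℝ, 0 < ε → ε ≤ 1 → ∀ (N : ℕ) [NeZero N], ¬ 16 ∣ N →
      (∀ p : ℕ, p.Prime → p ≠ 2 → ¬ p ^ 2 ∣ N) →
      ∀ (W : WeierstrassCurve ℚ) [W.IsElliptic] (f : CuspForm (Gamma0 N) 2), IsNewformOf W f →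
        (peterssonProduct (Gamma0 N) 2 f f).re ≤ C * (N : ℝ) ^ (1 + ε) / ε ^ 3 := by
  obtain ⟨C, hC, h⟩ := exists_petersson_le_mul_log_cube_of_not_sixteen_dvd
  refine ⟨C * 4 ^ 3, by positivity, fun ε hε hε1 N _ h16 hodd W _ f hf ↦ ?_⟩
  have hN1 : (1 : ℝ) ≤ N := by exact_mod_cast NeZero.one_le (n := N)
  calc (peterssonProduct (Gamma0 N) 2 f f).re ≤ C * N * (1 + Real.log N) ^ 3 := h N h16 hodd W f hf
    _ = C * (N * (1 + Real.log N) ^ 3) := by ring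
    _ ≤ C * (4 ^ 3 * (N : ℝ) ^ (1 + ε) / ε ^ 3) :=
        mul_le_mul_of_nonneg_left (mul_one_add_log_pow_three_le_rpow hN1 hε hε1) hC.le
    _ = C * 4 ^ 3 * (N : ℝ) ^ (1 + ε) / ε ^ 3 := by ring

/-- **The levels `16 ∣ N` whose twist by `−1` descends to `16 ∤ N'`** (e.g. the Frey–Hellegouarch
curves with `2⁴ ∥ N`, whose sign-swapped model `E^{(−1)}` has `v₂(N') ∈ {0, 1, 3}`): an absolute
`C > 0` with `Re (f, f)_{Γ₀(N)} ≤ C · N · (1 + log N)³` for every `E/ℚ` with newform `f` of level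
`N`, `16 ∣ N`, whose twist `E^{(−1)}` has a newform `g` of a level `N'` with `16 ∤ N'` and squarefree
odd part (`Re (f,f) ≤ 96 Re (g,g)`, `N' ∣ 16N`, `re_peterssonProduct_le_of_quadraticTwist_neg_one`,
and `exists_petersson_le_mul_log_cube_of_not_sixteen_dvd` for `g`). [cite: MaiMurty1994, §2, Proposition] -/
theorem exists_petersson_le_mul_log_cube_of_quadraticTwist_neg_one :
    ∃ C : ℝ, 0 < C ∧ ∀ (N N' : ℕ) [NeZero N] [NeZero N'], 16 ∣ N → ¬ 16 ∣ N' →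
      (∀ p : ℕ, p.Prime → p ≠ 2 → ¬ p ^ 2 ∣ N') →
      ∀ (W : WeierstrassCurve ℚ) [W.IsElliptic] (f : CuspForm (Gamma0 N) 2)
        (g : CuspForm (Gamma0 N') 2), IsNewformOf W f → IsNewformOf (W.quadraticTwist (-1)) g →
        (peterssonProduct (Gamma0 N) 2 f f).re ≤ C * N * (1 + Real.log N) ^ 3 := by
  obtain ⟨C₀, hC₀, hsq⟩ := exists_petersson_le_mul_log_cube_of_not_sixteen_dvd
  refine ⟨96 * 16 * 64 * C₀, by positivity, ?_⟩
  intro N N' _ _ h16 h16' hodd W _ f g hf hg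
  haveI : (W.quadraticTwist (-1 : ℚ)).IsElliptic := W.isElliptic_quadraticTwist (by norm_num)
  obtain ⟨hcmp, -, hN'N⟩ := re_peterssonProduct_le_of_quadraticTwist_neg_one hf hg h16
  have hg' := hsq N' h16' hodd (W.quadraticTwist (-1)) g hg
  have hN1 : (1 : ℝ) ≤ N := by exact_mod_cast NeZero.one_le (n := N)
  have hN'le : (N' : ℝ) ≤ 16 * N := by
    exact_mod_cast Nat.le_of_dvd (Nat.mul_pos (by norm_num) (NeZero.pos N)) hN'N
  have hlogN : 0 ≤ Real.log N := Real.log_nonneg hN1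
  have hN'1 : (1 : ℝ) ≤ N' := by exact_mod_cast NeZero.one_le (n := N')
  have hlog : 1 + Real.log N' ≤ 4 * (1 + Real.log N) := by
    have h1 : Real.log N' ≤ Real.log (16 * N) := Real.log_le_log (by positivity) hN'le
    have h2 : Real.log (16 * N) = Real.log 16 + Real.log N :=
      Real.log_mul (by norm_num) (by positivity)
    have h3 : Real.log 16 ≤ 3 := by
      rw [show (16 : ℝ) = 2 ^ 4 by norm_num, Real.log_pow]
      have := Real.log_two_lt_d9
      norm_num at this ⊢
      linarith
    linarith
  have hlog0 : 0 ≤ 1 + Real.log N' := by linarith [Real.log_nonneg hN'1]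
  calc (peterssonProduct (Gamma0 N) 2 f f).re ≤ 96 * (peterssonProduct (Gamma0 N') 2 g g).re := hcmp
    _ ≤ 96 * (C₀ * N' * (1 + Real.log N') ^ 3) := by gcongr
    _ ≤ 96 * (C₀ * (16 * N) * (4 * (1 + Real.log N)) ^ 3) := by gcongr
    _ = 96 * 16 * 64 * C₀ * N * (1 + Real.log N) ^ 3 := by ring

end Main







end Literature.NumberTheory.Automorphic
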